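import Summits.Ventures.HSemireg.Pad4TowerLineDesignCert12
import Summits.Ventures.HSemireg.Pad4TowerLineDesignCert8
import Summits.Ventures.HSemireg.Pad4TowerSeedB1OddCeiling
import Summits.Ventures.HSemireg.Pad4TowerLineLetters

/-!
# BlochSeedDiscOne ∕ DiamondLevelLaws — h-uniform LEVEL LAWS of static first-order designs in ◇_h and the KERNEL reduction of the odd threshold (control lens)

HONEST STATUS. Nothing here proves HC, HC_CM, HC_AV, H2 = `BlochSeedDiscOne` or any `(T_h)`; HC_CM is not used.  h-UNIFORM structural laws of `G₁`-closed
`H₁`-static two-level supports in ◇_h (vocabulary `Summit.Ventures.HSemireg.Pad4Tower`), their kernel consequences and reductions; laws marked CONJECTURE are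
displayed hypotheses, never proved here (MACHINE support = census rows named in the memos; machine ≠ kernel).  The long-form commentary of v1.0–v1.9 (mechanisms,
census numbers, every trimmed docstring verbatim) is archived in the memos `DIAMOND-LEVEL-LAWS-g11-v17 ∕ -v18 ∕ -v19 ∕ -v20.md` of this crux directory.
KERNEL MILESTONES: §4 `¬(T_h)` for even `h ≥ 12`; §5 `FD → LV → NS → CU₈ → OC₁₀ → (T_h)` (`h < 12`); §12 `ceilingProjectionLaw_iff_lns`; §15 `upLineLaw_holds`;
§19 `downLineLaw_of_dl3`; §21 `seedB1Odd_eight_of_partial_cd : CD₈ → LVN₈ → LVP3₈ → OL₈ → (T₈)`; §22 (v2.0) `xplus_fork`, `child_not_node_four`,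
**`dl3_of_partial_cd_le_ten : h ≤ 10 → CD_h → LVN_h → LVP3_h → (DL3_h)`** — the down-line law is a theorem of the three UP-facts at heights 8 AND 10.
v2.1 (docstrings only): `h ≤ 10` is SHARP — (DL), (DL3), (LNS), (CP) are machine-FALSE at `h = 12` (16 ∕ 466 band-4 SAT supports of the ◇₁₂ census of record
j329409 violate them while (LV), (CD), (LVN), (LVP3), (FD), (AD) hold 466 ∕ 466; `ALPHA-D12-BAND4-g11.md`); every earlier `h = 12` machine row is a BAND-2 row.
-/

set_option linter.dupNamespace false
set_option linter.style.longLine false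

namespace Summit.HodgeConjecture.HodgeConjecture.Cruxes.BlochSeedDiscOne.DiamondLevelLaws

open Finset Summit.Ventures.HSemireg.Pad4Tower Summit.Ventures.HSemireg.LinePhaseTorus

/-! ## §1 Node level and causal top -/

/-- NODE LEVEL `t(x) = α − |c|` (depth of the letter's own null ray above the floor `α = |c|`). -/
def nodeLevel (x : BPoint) : ℤ := x.1 - absCharge x

/-- CAUSAL TOP `A(x) = α + |c|` (the ceiling line through the letter). -/
def causalTop (x : BPoint) : ℤ := x.1 + absCharge x

theorem causalTop_eq (x : BPoint) : causalTop x = nodeLevel x + 2 * absCharge x := by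
  unfold causalTop nodeLevel; ring

theorem onCeiling_iff (h : ℤ) (x : BPoint) : OnCeiling h x ↔ causalTop x = h := Iff.rfl

theorem absCharge_nonneg (x : BPoint) : 0 ≤ absCharge x := abs_nonneg _

/-- in the diamond: `0 ≤ t`, `t` even, `A ≤ h`. -/
theorem inDiamond_levels {h : ℤ} {x : BPoint} (hx : InDiamond h x) :
    0 ≤ nodeLevel x ∧ nodeLevel x % 2 = 0 ∧ causalTop x ≤ h := by
  refine ⟨?_, hx.2.2.1, hx.2.2.2⟩
  have := hx.2.1; unfold nodeLevel; omega

/-- a charged μ₄ letter has `|c| ≥ 1`. -/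
theorem one_le_absCharge {x : BPoint} (hax : x.2 = (0, 0) ∨ AxisPt x) (hne : x.2 ≠ (0, 0)) : 1 ≤ absCharge x := by
  rcases hax with h0 | ⟨h1, h2⟩ | ⟨h1, h2⟩
  · exact absurd h0 hne
  · simp only [absCharge, chargeOf, h2, sub_zero]; exact Int.one_le_abs h1
  · simp only [absCharge, chargeOf, h1, zero_sub, abs_neg]; exact Int.one_le_abs h2

/-- the letters of a fully charged cell in the diamond have `|c| ≥ 1`. -/
theorem one_le_absCharge_of_fcc {h : ℤ} {Z : MCell} (hZ : MCell.InDiamond h Z) (hFC : FCc Z) (f : Fin 4) :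
    1 ≤ absCharge (Z f) := one_le_absCharge (hZ f).1 (hFC f)

theorem diamondLetter_fst (t c : ℤ) (k : Fin 4) : (diamondLetter t c k).1 = t + c := rfl

/-- `|c|` of the table letter `t·I + c·ℓ_{i^k}` is `c` (`c ≥ 0`). -/
theorem absCharge_diamondLetter (t c : ℤ) (k : Fin 4) (hc : 0 ≤ c) : absCharge (diamondLetter t c k) = c := by
  fin_cases k <;> simp [absCharge, chargeOf, abs_of_nonneg hc]

theorem nodeLevel_diamondLetter (t c : ℤ) (k : Fin 4) (hc : 0 ≤ c) : nodeLevel (diamondLetter t c k) = t := by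
  unfold nodeLevel; rw [absCharge_diamondLetter t c k hc, diamondLetter_fst]; ring

theorem causalTop_diamondLetter (t c : ℤ) (k : Fin 4) (hc : 0 ≤ c) : causalTop (diamondLetter t c k) = t + 2 * c := by
  unfold causalTop; rw [absCharge_diamondLetter t c k hc, diamondLetter_fst]; ring

/-- **the LINE letter is a diamond letter**: `lineLetter h c k = (h − 2c)·I + c·ℓ_{i^k}`. -/
theorem lineLetter_eq_diamondLetter (h : ℤ) (c : ℕ) (k : Fin 4) : lineLetter h c k = diamondLetter (h - 2 * c) c k := by
  refine Prod.ext (by simp [lineLetter]; ring) (Prod.ext (by simp [lineLetter]) (by simp [lineLetter]))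

/-- node level of a LINE-`h` letter of charge `c` is `h − 2c` … -/
theorem nodeLevel_lineLetter (h : ℤ) (c : ℕ) (k : Fin 4) : nodeLevel (lineLetter h c k) = h - 2 * c := by
  rw [lineLetter_eq_diamondLetter, nodeLevel_diamondLetter _ _ _ (by positivity)]

/-- … and its causal top is `h`. -/
theorem causalTop_lineLetter (h : ℤ) (c : ℕ) (k : Fin 4) : causalTop (lineLetter h c k) = h := by
  rw [lineLetter_eq_diamondLetter, causalTop_diamondLetter _ _ _ (by positivity)]; ring

/-- **(FD) on the LINE is the lineage's ceiling gap law**. -/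
theorem floorDepth_line_iff (h : ℤ) (c : ℕ) (k : Fin 4) :
    (6 ≤ nodeLevel (lineLetter h c k) ↔ 2 * (c : ℤ) + 6 ≤ h) ∧ (8 ≤ nodeLevel (lineLetter h c k) ↔ 2 * (c : ℤ) + 8 ≤ h) := by
  rw [nodeLevel_lineLetter]; omega

/-- the ceiling unit letter of the tree (`Pad4TowerSeedB1OddCeiling.cuH`) is the table letter `(h−2)·I + ℓ_u`. -/
theorem cuH_eq_diamondLetter (h : ℤ) (u : Fin 4) : cuH h u = diamondLetter (h - 2) 1 u := rfl

/-- **NORMAL FORM**: every diamond letter is the table letter of its own node level, charge and (some) phase. -/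
theorem exists_eq_diamondLetter {h : ℤ} {x : BPoint} (hx : InDiamond h x) :
    ∃ k : Fin 4, x = diamondLetter (nodeLevel x) (absCharge x) k := by
  obtain ⟨a, b1, b2⟩ := x
  rcases hx.1 with h0 | ⟨hb1, hb2⟩ | ⟨hb1, hb2⟩
  · simp only [Prod.mk.injEq] at h0
    obtain ⟨rfl, rfl⟩ := h0
    exact ⟨0, by simp [nodeLevel, absCharge, chargeOf, diamondLetter, ray]⟩
  · simp only at hb1 hb2
    subst hb2
    rcases lt_or_gt_of_ne hb1 with hneg | hpos
    · exact ⟨2, by simp [nodeLevel, absCharge, chargeOf, diamondLetter, ray, abs_of_neg hneg]⟩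
    · exact ⟨0, by simp [nodeLevel, absCharge, chargeOf, diamondLetter, ray, abs_of_pos hpos]⟩
  · simp only at hb1 hb2
    subst hb1
    rcases lt_or_gt_of_ne hb2 with hneg | hpos
    · exact ⟨1, by simp [nodeLevel, absCharge, chargeOf, diamondLetter, ray, abs_of_pos (neg_pos.mpr hneg)]⟩
    · exact ⟨3, by simp [nodeLevel, absCharge, chargeOf, diamondLetter, ray, abs_of_neg (neg_neg_of_pos hpos)]⟩

/-! ## §2 The three level laws and the two finite ceiling statements -/

/-- the FLOOR-DEPTH inequalities of ONE configuration: FC `P`-letters have node level `≥ 6`, FC `N`-letters `≥ 8`. -/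
def FDIneq (C : MConfig) : Prop :=
  (∀ P ∈ C.upper, FCc P → ∀ f, 6 ≤ nodeLevel (P f)) ∧ (∀ Z ∈ C.lower, FCc Z → ∀ f, 8 ≤ nodeLevel (Z f))

/-- **(FD_h) FLOOR DEPTH LAW at height `h`** (CONJECTURE, h-uniform; machine: ◇₈ W17, ◇₁₀ g55 residual census, ◇₁₂ band 2 W33 — sharp at 12;
LINE shadow KERNEL = Part F of `LinePhaseRigidity.lean` v1.9 via `floorDepth_line_iff`). -/
def FloorDepthLaw (h : ℤ) : Prop := ∀ C : MConfig, C.InDiamond h → C.G1Closed → C.StaticH1 → FDIneq C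

/-- a LEVEL cell: all four causal tops agree (the cell lies on one ceiling line `α + c = h'`). -/
def LevelCell (Z : MCell) : Prop := ∀ f g, causalTop (Z f) = causalTop (Z g)

/-- **(LV_h) LEVEL LAW** (CONJECTURE, h-uniform; machine: every realisable FC orbit of ◇₈, ◇₁₀ (8∕8) and ◇₁₂ band 2 (50∕50) is level;
trivially true on LINE supports, where every letter has top `h`). -/
def LevelLaw (h : ℤ) : Prop :=
  ∀ C : MConfig, C.InDiamond h → C.G1Closed → C.StaticH1 → ∀ Z ∈ C.lower ∪ C.upper, FCc Z → LevelCell Z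

/-- **(NS_h) NEST LAW** (CONJECTURE, h-uniform; machine: nest both ways between the ◇₈ ∕ ◇₁₀ ∕ ◇₁₂b2 censuses, `CROSSCHECK-d10-d12.txt`). -/
def NestLaw (h : ℤ) : Prop :=
  ∀ C : MConfig, C.InDiamond h → C.G1Closed → C.StaticH1 → ∀ h' : ℤ,
    (∀ Z ∈ C.lower, FCc Z → (∀ f, OnCeiling h' (Z f)) → CellRealisable h' true Z) ∧
    (∀ P ∈ C.upper, FCc P → (∀ f, OnCeiling h' (P f)) → CellRealisable h' false P)

/-- **(OC_h) ODD-CEILING-FREE at `h`**. -/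
def OddCeilingFree (h : ℤ) : Prop :=
  ∀ C : MConfig, C.InDiamond h → C.G1Closed → C.StaticH1 →
    ∀ Z ∈ C.lower ∪ C.upper, FCc Z → (∀ f, OnCeiling h (Z f)) → ¬ OddPat Z.pat

/-- **(CU_h) CEILING-UNIT ODD-FREE at `h`**. -/
def CeilingUnitOddFree (h : ℤ) : Prop :=
  ∀ C : MConfig, C.InDiamond h → C.G1Closed → C.StaticH1 → ∀ P ∈ C.upper, (∀ f, ∃ u : Fin 4, P f = cuH h u) → ¬ OddPat P.pat

/-- **(OL_h) in tree vocabulary**. -/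
def OddLineFree (h : ℤ) : Prop :=
  ∀ C : MConfig, C.InDiamond h → (∀ Z ∈ C.lower, ∀ f, OnCeiling h (Z f)) → (∀ P ∈ C.upper, ∀ f, OnCeiling h (P f)) →
    C.G1Closed → RuleDMu4Closed C → XPlusClosed C → ¬ C.HasOddFC

/-! ## §3 Monotonicity and the easy implications -/

theorem inDiamond_config_mono {h h' : ℤ} (hh : h ≤ h') {C : MConfig} (hU : C.InDiamond h) : C.InDiamond h' :=
  ⟨fun Z hZ f => inDiamond_mono hh (hU.1 Z hZ f), fun P hP f => inDiamond_mono hh (hU.2 P hP f)⟩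

/-- the laws are ANTITONE in `h` (a larger diamond is a stronger statement). -/
theorem floorDepthLaw_antitone {h h' : ℤ} (hh : h ≤ h') (H : FloorDepthLaw h') : FloorDepthLaw h :=
  fun C hU hG hS => H C (inDiamond_config_mono hh hU) hG hS

theorem levelLaw_antitone {h h' : ℤ} (hh : h ≤ h') (H : LevelLaw h') : LevelLaw h :=
  fun C hU hG hS => H C (inDiamond_config_mono hh hU) hG hS

theorem nestLaw_antitone {h h' : ℤ} (hh : h ≤ h') (H : NestLaw h') : NestLaw h :=
  fun C hU hG hS => H C (inDiamond_config_mono hh hU) hG hS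

theorem ceilingUnitOddFree_iff_pat (h : ℤ) : CeilingUnitOddFree h ↔
    ∀ C : MConfig, C.InDiamond h → C.G1Closed → C.StaticH1 → ∀ P ∈ C.upper, (∀ f, ∃ u : Fin 4, P f = cuH h u) → ¬ OddPat P.pat := Iff.rfl

/-- `(T_h) ⇒ (OC_h)`. -/
theorem oddCeilingFree_of_seed {h : ℤ} (H : SeedB1OddDiamondG1H1 h) : OddCeilingFree h := by
  intro C hU hG hS Z hZ hFC _ hpat
  rcases Finset.mem_union.mp hZ with hZ | hZ
  · exact H C hU hG hS (Or.inl ⟨Z, hZ, hFC, hpat⟩)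
  · exact H C hU hG hS (Or.inr ⟨Z, hZ, hFC, hpat⟩)

/-- `(T_h) ⇒ (CU_h)` (a ceiling-unit cell is fully charged). -/
theorem ceilingUnitOddFree_of_seed {h : ℤ} (H : SeedB1OddDiamondG1H1 h) : CeilingUnitOddFree h := by
  intro C hU hG hS P hP hcu hpat
  refine H C hU hG hS (Or.inr ⟨P, hP, fun f => ?_, hpat⟩)
  obtain ⟨u, hu⟩ := hcu f
  rw [hu]
  fin_cases u <;> simp

/-- `(OC_h) ⇒ (OL_h)`: a design on the ceiling line is `H₁`-static as soon as it is RULE-D ∕ X⁺-closed (`A2I⁻` vacuous), and its cells are ceiling cells. -/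
theorem oddLineFree_of_oddCeilingFree {h : ℤ} (H : OddCeilingFree h) : OddLineFree h := by
  intro C hU hN hP hG hD hX hodd
  have hS : C.StaticH1 := ⟨hD, hX, LineDesignCert12.a2iMinusClosed_of_onCeiling C h hU hN hP⟩
  rcases hodd with ⟨Z, hZ, hFC, hpat⟩ | ⟨Z, hZ, hFC, hpat⟩
  · exact H C hU hG hS Z (Finset.mem_union_left _ hZ) hFC (hN Z hZ) hpat
  · exact H C hU hG hS Z (Finset.mem_union_right _ hZ) hFC (hP Z hZ) hpat

/-- the ceiling of an ODD height is empty (tops are even), so `(OC_h)` holds vacuously at odd `h`. -/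
theorem oddCeilingFree_of_odd {h : ℤ} (hh : h % 2 = 1) : OddCeilingFree h := by
  intro C hU _ _ Z hZ _ hceil _
  have hx : InDiamond h (Z 0) := by
    rcases Finset.mem_union.mp hZ with hZ | hZ
    · exact hU.1 Z hZ 0
    · exact hU.2 Z hZ 0
  have h1 := hx.2.2.1
  have h2 : (Z 0).1 + absCharge (Z 0) = h := hceil 0
  omega

/-! ## §4 The SAT side is KERNEL -/

/-- an odd static `G₁` design ON THE CEILING LINE of ◇_h exists for `h = 12 + 2n` (the LINE-12 certificate boosted `n` times by `2`). -/
theorem exists_odd_ceiling_design (n : ℕ) : ∃ C : MConfig, C.InDiamond (12 + 2 * n) ∧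
    ((∀ Z ∈ C.lower, ∀ f, OnCeiling (12 + 2 * n) (Z f)) ∧ ∀ P ∈ C.upper, ∀ f, OnCeiling (12 + 2 * n) (P f)) ∧
    C.G1Closed ∧ C.StaticH1 ∧ C.HasOddFC := by
  induction n with
  | zero =>
    exact ⟨LineDesignCert12.cfg, by simpa using LineDesignCert12.cfg_inDiamond,
      by simpa using (⟨fun Z hZ => LineDesignCert12.lN_onLine Z hZ, fun P hP => LineDesignCert12.lP_onLine P hP⟩ :
        (∀ Z ∈ LineDesignCert12.cfg.lower, ∀ f, OnCeiling 12 (Z f)) ∧ ∀ P ∈ LineDesignCert12.cfg.upper, ∀ f, OnCeiling 12 (P f)),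
      LineDesignCert12.cfg_g1Closed, LineDesignCert12.cfg_staticH1, LineDesignCert12.cfg_hasOddFC⟩
  | succ n ih =>
    obtain ⟨C, hU, hL, hG, hS, hO⟩ := ih
    have e : (12 : ℤ) + 2 * ((n + 1 : ℕ) : ℤ) = 12 + 2 * (n : ℤ) + 2 := by push_cast; ring
    have hU' : (C.boostImage 2).InDiamond (12 + 2 * ((n + 1 : ℕ) : ℤ)) := by
      rw [e]; exact inDiamond_boostImage_two hU
    refine ⟨C.boostImage 2, hU', ⟨?_, ?_⟩, (g1Closed_boost_iff 2 C).mpr hG, ?_, (hasOddFC_boost_iff 2 C).mpr hO⟩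
    · intro W hW f
      obtain ⟨Z, hZ, rfl⟩ := Finset.mem_image.mp hW
      have := hL.1 Z hZ f
      simp only [OnCeiling, MCell.boost, boostPt_fst, absCharge_boostPt] at this ⊢
      push_cast; omega
    · intro W hW f
      obtain ⟨P, hP, rfl⟩ := Finset.mem_image.mp hW
      have := hL.2 P hP f
      simp only [OnCeiling, MCell.boost, boostPt_fst, absCharge_boostPt] at this ⊢
      push_cast; omega
    · exact ((staticH1BoostInvariant_holds 2 C (inCone_of_inDiamond' hU) (inCone_of_inDiamond' hU')).1).mp hS

/-- **`¬ (OC_{12+2n})`** (KERNEL): the ceiling odd threshold is at most `12`. -/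
theorem not_oddCeilingFree_ge_twelve (n : ℕ) : ¬ OddCeilingFree (12 + 2 * n) := by
  intro H
  obtain ⟨C, hU, hL, hG, hS, hO⟩ := exists_odd_ceiling_design n
  rcases hO with ⟨Z, hZ, hFC, hpat⟩ | ⟨Z, hZ, hFC, hpat⟩
  · exact H C hU hG hS Z (Finset.mem_union_left _ hZ) hFC (hL.1 Z hZ) hpat
  · exact H C hU hG hS Z (Finset.mem_union_right _ hZ) hFC (hL.2 Z hZ) hpat

/-- in particular `¬ (OC₁₂)`, next to the tree's `¬ (T₁₂)` (`LineDesignCert12.not_seedB1OddDiamondG1H1`). -/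
theorem not_oddCeilingFree_twelve : ¬ OddCeilingFree 12 := by simpa using not_oddCeilingFree_ge_twelve 0

/-! ## §5 Consequences of -/

/-- under `(FD_h)`: every FC letter has causal top `≥ 8` (`P`) ∕ `≥ 10` (`N`); hence NO FC cell below `8` and no FC `N`-cell below `10`. -/
theorem fc_tops_of_fd {h : ℤ} (hFD : FloorDepthLaw h) {C : MConfig} (hU : C.InDiamond h) (hG : C.G1Closed) (hS : C.StaticH1) :
    (∀ P ∈ C.upper, FCc P → ∀ f, 8 ≤ causalTop (P f) ∧ causalTop (P f) ≤ h) ∧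
    (∀ Z ∈ C.lower, FCc Z → ∀ f, 10 ≤ causalTop (Z f) ∧ causalTop (Z f) ≤ h) := by
  obtain ⟨hP6, hN8⟩ := hFD C hU hG hS
  refine ⟨fun P hP hFC f => ?_, fun Z hZ hFC f => ?_⟩
  · have h1 := one_le_absCharge_of_fcc (hU.2 P hP) hFC f
    have h2 := hP6 P hP hFC f
    have h3 := (inDiamond_levels (hU.2 P hP f)).2.2
    rw [causalTop_eq] at *; constructor <;> omega
  · have h1 := one_le_absCharge_of_fcc (hU.1 Z hZ) hFC f
    have h2 := hN8 Z hZ hFC f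
    have h3 := (inDiamond_levels (hU.1 Z hZ f)).2.2
    rw [causalTop_eq] at *; constructor <;> omega

/-- **`(FD_h) ⇒ (T_h)` for `h < 8`** (no FC cell at all), and no FC `N`-cell for `h < 10`. -/
theorem no_fc_of_fd {h : ℤ} (hFD : FloorDepthLaw h) {C : MConfig} (hU : C.InDiamond h) (hG : C.G1Closed) (hS : C.StaticH1) :
    (h < 8 → ∀ Z ∈ C.lower ∪ C.upper, ¬ FCc Z) ∧ (h < 10 → ∀ Z ∈ C.lower, ¬ FCc Z) := by
  obtain ⟨hP, hN⟩ := fc_tops_of_fd hFD hU hG hS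
  refine ⟨fun hh Z hZ hFC => ?_, fun hh Z hZ hFC => ?_⟩
  · rcases Finset.mem_union.mp hZ with hZ | hZ
    · have := hN Z hZ hFC 0; omega
    · have := hP Z hZ hFC 0; omega
  · have := hN Z hZ hFC 0; omega

theorem seedB1Odd_of_fd_lt_eight {h : ℤ} (hFD : FloorDepthLaw h) (hh : h < 8) : SeedB1OddDiamondG1H1 h := by
  intro C hU hG hS hodd
  rcases hodd with ⟨Z, hZ, hFC, -⟩ | ⟨Z, hZ, hFC, -⟩
  · exact (no_fc_of_fd hFD hU hG hS).1 hh Z (Finset.mem_union_left _ hZ) hFC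
  · exact (no_fc_of_fd hFD hU hG hS).1 hh Z (Finset.mem_union_right _ hZ) hFC

/-- **THE FC SHAPE AT ◇₈ under `(FD₈)`**. -/
theorem fc_shape_eight (hFD : FloorDepthLaw 8) {C : MConfig} (hU : C.InDiamond 8) (hG : C.G1Closed) (hS : C.StaticH1) :
    (∀ Z ∈ C.lower, ¬ FCc Z) ∧ (∀ P ∈ C.upper, FCc P → ∀ f, ∃ u : Fin 4, P f = cuH 8 u) := by
  refine ⟨(no_fc_of_fd hFD hU hG hS).2 (by norm_num), fun P hP hFC f => ?_⟩
  have h1 := one_le_absCharge_of_fcc (hU.2 P hP) hFC f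
  have h2 := (hFD C hU hG hS).1 P hP hFC f
  have h3 := (inDiamond_levels (hU.2 P hP f)).2.2
  rw [causalTop_eq] at h3
  obtain ⟨k, hk⟩ := exists_eq_diamondLetter (hU.2 P hP f)
  have ht : nodeLevel (P f) = 8 - 2 := by omega
  have hc : absCharge (P f) = 1 := by omega
  exact ⟨k, by rw [hk, ht, hc]⟩

/-- **`(FD₈) ∧ (CU₈) ⇒ (T₈)`** (KERNEL): at height 8 the whole odd-exclusion is the ceiling-unit statement. -/
theorem seedB1Odd_eight_of (hFD : FloorDepthLaw 8) (hCU : CeilingUnitOddFree 8) : SeedB1OddDiamondG1H1 8 := by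
  intro C hU hG hS hodd
  obtain ⟨hN, hP⟩ := fc_shape_eight hFD hU hG hS
  rcases hodd with ⟨Z, hZ, hFC, -⟩ | ⟨P, hPm, hFC, hpat⟩
  · exact hN Z hZ hFC
  · exact hCU C hU hG hS P hPm (hP P hPm hFC) hpat

/-- **THE FC ALPHABET AT ◇₁₀ under `(FD₁₀)`**. -/
theorem fc_alphabet_ten (hFD : FloorDepthLaw 10) {C : MConfig} (hU : C.InDiamond 10) (hG : C.G1Closed) (hS : C.StaticH1) :
    (∀ P ∈ C.upper, FCc P → ∀ f, ∃ k : Fin 4,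
        P f = diamondLetter 6 1 k ∨ P f = diamondLetter 6 2 k ∨ P f = diamondLetter 8 1 k) ∧
    (∀ Z ∈ C.lower, FCc Z → ∀ f, ∃ k : Fin 4, Z f = diamondLetter 8 1 k) := by
  obtain ⟨hP6, hN8⟩ := hFD C hU hG hS
  refine ⟨fun P hP hFC f => ?_, fun Z hZ hFC f => ?_⟩
  · have h1 := one_le_absCharge_of_fcc (hU.2 P hP) hFC f
    have h2 := hP6 P hP hFC f
    obtain ⟨-, h4, h3⟩ := inDiamond_levels (hU.2 P hP f)
    rw [causalTop_eq] at h3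
    obtain ⟨k, hk⟩ := exists_eq_diamondLetter (hU.2 P hP f)
    have key : (nodeLevel (P f) = 6 ∧ absCharge (P f) = 1) ∨ (nodeLevel (P f) = 6 ∧ absCharge (P f) = 2) ∨
        (nodeLevel (P f) = 8 ∧ absCharge (P f) = 1) := by omega
    refine ⟨k, ?_⟩
    rcases key with ⟨ht, hc⟩ | ⟨ht, hc⟩ | ⟨ht, hc⟩
    · exact Or.inl (by rw [hk, ht, hc])
    · exact Or.inr (Or.inl (by rw [hk, ht, hc]))
    · exact Or.inr (Or.inr (by rw [hk, ht, hc]))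
  · have h1 := one_le_absCharge_of_fcc (hU.1 Z hZ) hFC f
    have h2 := hN8 Z hZ hFC f
    obtain ⟨-, h4, h3⟩ := inDiamond_levels (hU.1 Z hZ f)
    rw [causalTop_eq] at h3
    obtain ⟨k, hk⟩ := exists_eq_diamondLetter (hU.1 Z hZ f)
    have ht : nodeLevel (Z f) = 8 := by omega
    have hc : absCharge (Z f) = 1 := by omega
    exact ⟨k, by rw [hk, ht, hc]⟩

/-- a level FC cell of a design in ◇_h lies on ONE ceiling line `h' ≤ h`. -/
theorem exists_ceiling_of_level {h : ℤ} {C : MConfig} (hU : C.InDiamond h) {Z : MCell} (hZ : Z ∈ C.lower ∪ C.upper)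
    (hL : LevelCell Z) : ∃ h' ≤ h, ∀ f, OnCeiling h' (Z f) := by
  have hx : InDiamond h (Z 0) := by
    rcases Finset.mem_union.mp hZ with hZ | hZ
    · exact hU.1 Z hZ 0
    · exact hU.2 Z hZ 0
  exact ⟨causalTop (Z 0), (inDiamond_levels hx).2.2, fun f => hL f 0⟩

/-- **THE GENERAL REDUCTION (KERNEL)**. -/
theorem seedB1Odd_of_level_nest {h : ℤ} (hL : LevelLaw h) (hN : NestLaw h) (hO : ∀ h' ≤ h, OddCeilingFree h') :
    SeedB1OddDiamondG1H1 h := by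
  intro C hU hG hS hodd
  rcases hodd with ⟨Z, hZ, hFC, hpat⟩ | ⟨Z, hZ, hFC, hpat⟩
  · have hZu : Z ∈ C.lower ∪ C.upper := Finset.mem_union_left _ hZ
    obtain ⟨h', hh', hceil⟩ := exists_ceiling_of_level hU hZu (hL C hU hG hS Z hZu hFC)
    obtain ⟨C', hU', hG', hS', hZ'⟩ := (hN C hU hG hS h').1 Z hZ hFC hceil
    have hZ'' : Z ∈ C'.lower := hZ'
    exact hO h' hh' C' hU' hG' hS' Z (Finset.mem_union_left _ hZ'') hFC hceil hpat
  · have hZu : Z ∈ C.lower ∪ C.upper := Finset.mem_union_right _ hZ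
    obtain ⟨h', hh', hceil⟩ := exists_ceiling_of_level hU hZu (hL C hU hG hS Z hZu hFC)
    obtain ⟨C', hU', hG', hS', hZ'⟩ := (hN C hU hG hS h').2 Z hZ hFC hceil
    have hZ'' : Z ∈ C'.upper := hZ'
    exact hO h' hh' C' hU' hG' hS' Z (Finset.mem_union_right _ hZ'') hFC hceil hpat

/-- … and conversely `(T_h) ⇒ ∀ h' ≤ h, (OC_{h'})` with no hypothesis; so under LEVEL + NEST for all heights **the diamond odd …. -/
theorem seedB1Odd_iff_ceiling (hL : ∀ h, LevelLaw h) (hN : ∀ h, NestLaw h) (h : ℤ) :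
    SeedB1OddDiamondG1H1 h ↔ ∀ h' ≤ h, OddCeilingFree h' :=
  ⟨fun H _ hh' => oddCeilingFree_of_seed (seedB1OddDiamondG1H1_antitone hh' H), fun H => seedB1Odd_of_level_nest (hL h) (hN h) H⟩

/-- **THE REDUCTION BELOW TWELVE (KERNEL)**. -/
theorem seedB1Odd_lt_twelve_of {h : ℤ} (hh : h < 12) (hFD : FloorDepthLaw h) (hL : LevelLaw h) (hN : NestLaw h)
    (hCU : CeilingUnitOddFree 8) (hOC : OddCeilingFree 10) : SeedB1OddDiamondG1H1 h := by
  intro C hU hG hS hodd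
  obtain ⟨hPt, hNt⟩ := fc_tops_of_fd hFD hU hG hS
  rcases hodd with ⟨Z, hZ, hFC, hpat⟩ | ⟨Z, hZ, hFC, hpat⟩
  · -- an FC `N`-cell: tops `≥ 10`, so the cell lies on the ceiling line `10`
    have hZu : Z ∈ C.lower ∪ C.upper := Finset.mem_union_left _ hZ
    obtain ⟨h', hh', hceil⟩ := exists_ceiling_of_level hU hZu (hL C hU hG hS Z hZu hFC)
    have h10 : h' = 10 := by
      have e0 : causalTop (Z 0) = h' := hceil 0
      have := (hNt Z hZ hFC 0).1
      have hev := (inDiamond_levels (hU.1 Z hZ 0)).2.1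
      have ce := causalTop_eq (Z 0); omega
    subst h10
    obtain ⟨C', hU', hG', hS', hZ'⟩ := (hN C hU hG hS 10).1 Z hZ hFC hceil
    have hZ'' : Z ∈ C'.lower := hZ'
    exact hOC C' hU' hG' hS' Z (Finset.mem_union_left _ hZ'') hFC hceil hpat
  · have hZu : Z ∈ C.lower ∪ C.upper := Finset.mem_union_right _ hZ
    obtain ⟨h', hh', hceil⟩ := exists_ceiling_of_level hU hZu (hL C hU hG hS Z hZu hFC)
    have h810 : h' = 8 ∨ h' = 10 := by
      have e0 : causalTop (Z 0) = h' := hceil 0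
      have := (hPt Z hZ hFC 0).1
      have hev := (inDiamond_levels (hU.2 Z hZ 0)).2.1
      have ce := causalTop_eq (Z 0); omega
    rcases h810 with rfl | rfl
    · -- a top-8 FC `P`-cell is a ceiling-unit cell of ◇₈
      obtain ⟨C', hU', hG', hS', hZ'⟩ := (hN C hU hG hS 8).2 Z hZ hFC hceil
      have hZ'' : Z ∈ C'.upper := hZ'
      refine hCU C' hU' hG' hS' Z hZ'' (fun f => ?_) hpat
      have h1 := one_le_absCharge_of_fcc (hU.2 Z hZ) hFC f
      have h2 := (hFD C hU hG hS).1 Z hZ hFC f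
      have e := hceil f
      rw [onCeiling_iff, causalTop_eq] at e
      obtain ⟨k, hk⟩ := exists_eq_diamondLetter (hU.2 Z hZ f)
      have ht : nodeLevel (Z f) = 8 - 2 := by omega
      have hc : absCharge (Z f) = 1 := by omega
      exact ⟨k, by rw [hk, ht, hc]⟩
    · obtain ⟨C', hU', hG', hS', hZ'⟩ := (hN C hU hG hS 10).2 Z hZ hFC hceil
      have hZ'' : Z ∈ C'.upper := hZ'
      exact hOC C' hU' hG' hS' Z (Finset.mem_union_right _ hZ'') hFC hceil hpat

/-- packaging: granted `(FD₁₁) ∧ (LV₁₁) ∧ (NS₁₁)`, **the odd threshold of the diamond family is `12` iff `(CU₈) ∧ (OC₁₀)`** (the tree decides `h ≥ 12`). -/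
theorem oddThreshold_iff (hFD : FloorDepthLaw 11) (hL : LevelLaw 11) (hN : NestLaw 11) :
    (∀ h : ℤ, SeedB1OddDiamondG1H1 h ↔ h < 12) ↔ (CeilingUnitOddFree 8 ∧ OddCeilingFree 10) := by
  constructor
  · intro H
    exact ⟨ceilingUnitOddFree_of_seed ((H 8).mpr (by norm_num)), oddCeilingFree_of_seed ((H 10).mpr (by norm_num))⟩
  · rintro ⟨hCU, hOC⟩ h
    refine ⟨fun H => ?_, fun hh => ?_⟩
    · by_contra hge
      exact LineDesignCert12.not_seedB1OddDiamondG1H1_ge (by omega) H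
    · have hh' : h ≤ 11 := by omega
      exact seedB1Odd_lt_twelve_of hh (floorDepthLaw_antitone hh' hFD) (levelLaw_antitone hh' hL) (nestLaw_antitone hh' hN) hCU hOC

/-! ## §6 (FD) is RELATIVE to the design's own floor -/

theorem nodeLevel_boostPt (s : ℤ) (x : BPoint) : nodeLevel (boostPt s x) = nodeLevel x + s := by
  unfold nodeLevel; rw [absCharge_boostPt, boostPt_fst]; ring

theorem fcc_boost_iff (s : ℤ) (Z : MCell) : FCc (Z.boost s) ↔ FCc Z := Iff.rfl

/-- a design all of whose letters have node level `≥ s` (`s` even) boosts DOWN by `s` inside the diamond of height `h − s`. -/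
theorem inDiamond_boostImage_down {h s : ℤ} (hs : s % 2 = 0) {C : MConfig} (hU : C.InDiamond h)
    (hlev : (∀ Z ∈ C.lower, ∀ f, s ≤ nodeLevel (Z f)) ∧ ∀ P ∈ C.upper, ∀ f, s ≤ nodeLevel (P f)) :
    (C.boostImage (-s)).InDiamond (h - s) := by
  constructor
  · intro W hW f
    obtain ⟨Z, hZ, rfl⟩ := Finset.mem_image.mp hW
    have h1 := hlev.1 Z hZ f
    have h2 := (inDiamond_levels (hU.1 Z hZ f)).2.2
    unfold nodeLevel at h1; rw [causalTop] at h2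
    exact inDiamond_boostPt (hU.1 Z hZ f) (by omega) (by omega) (by omega)
  · intro W hW f
    obtain ⟨P, hP, rfl⟩ := Finset.mem_image.mp hW
    have h1 := hlev.2 P hP f
    have h2 := (inDiamond_levels (hU.2 P hP f)).2.2
    unfold nodeLevel at h1; rw [causalTop] at h2
    exact inDiamond_boostPt (hU.2 P hP f) (by omega) (by omega) (by omega)

/-- **RELATIVE FLOOR DEPTH (KERNEL from (FD))**. -/
theorem fd_relative {h s : ℤ} (hs : s % 2 = 0) (hFD : FloorDepthLaw (h - s)) {C : MConfig} (hU : C.InDiamond h)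
    (hG : C.G1Closed) (hS : C.StaticH1)
    (hlev : (∀ Z ∈ C.lower, ∀ f, s ≤ nodeLevel (Z f)) ∧ ∀ P ∈ C.upper, ∀ f, s ≤ nodeLevel (P f)) :
    (∀ P ∈ C.upper, FCc P → ∀ f, s + 6 ≤ nodeLevel (P f)) ∧ (∀ Z ∈ C.lower, FCc Z → ∀ f, s + 8 ≤ nodeLevel (Z f)) := by
  have hU' := inDiamond_boostImage_down hs hU hlev
  have hG' : (C.boostImage (-s)).G1Closed := (g1Closed_boost_iff (-s) C).mpr hG
  have hS' : (C.boostImage (-s)).StaticH1 :=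
    ((staticH1BoostInvariant_holds (-s) C (inCone_of_inDiamond' hU) (inCone_of_inDiamond' hU')).1).mp hS
  obtain ⟨hP6, hN8⟩ := hFD _ hU' hG' hS'
  refine ⟨fun P hP hFC f => ?_, fun Z hZ hFC f => ?_⟩
  · have hmem : P.boost (-s) ∈ (C.boostImage (-s)).upper := Finset.mem_image_of_mem _ hP
    have := hP6 _ hmem ((fcc_boost_iff (-s) P).mpr hFC) f
    rw [MCell.boost, nodeLevel_boostPt] at this; omega
  · have hmem : Z.boost (-s) ∈ (C.boostImage (-s)).lower := Finset.mem_image_of_mem _ hZ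
    have := hN8 _ hmem ((fcc_boost_iff (-s) Z).mpr hFC) f
    rw [MCell.boost, nodeLevel_boostPt] at this; omega

/-! ## §7 THE MASTER FORM -/

/-- a configuration SUPPORTED ON THE CEILING LINE of ◇_h (every letter of every cell has causal top `h`): the lineage's LINE-`h` designs. -/
def OnLine (h : ℤ) (C : MConfig) : Prop :=
  (∀ W ∈ C.lower, ∀ f, OnCeiling h (W f)) ∧ ∀ P ∈ C.upper, ∀ f, OnCeiling h (P f)

/-- `Z` is LINE-REALISABLE at height `h` (at the lower ∕ upper level): a member of a `G₁`-closed `H₁`-static design in ◇_h supported …. -/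
def LineRealisable (h : ℤ) (lowerLevel : Bool) (Z : MCell) : Prop :=
  ∃ C : MConfig, C.InDiamond h ∧ OnLine h C ∧ C.G1Closed ∧ C.StaticH1 ∧ (if lowerLevel then Z ∈ C.lower else Z ∈ C.upper)

theorem cellRealisable_of_lineRealisable {h : ℤ} {b : Bool} {Z : MCell} (H : LineRealisable h b Z) : CellRealisable h b Z := by
  obtain ⟨C, hU, -, hG, hS, hZ⟩ := H
  exact ⟨C, hU, hG, hS, hZ⟩

/-- KERNEL WITNESS at 8: the ceiling unit cell `[6I+ℓ_{−1}]⁴` (`diagUnit 6 2`) is LINE-realisable at 8 (tree `LineDesignCert8.c8`) — …. -/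
theorem lineRealisable_cu_eight : LineRealisable 8 false LineDesignCert8.cuCell :=
  ⟨LineDesignCert8.c8, LineDesignCert8.c8_inDiamond, LineDesignCert8.c8_onLine, LineDesignCert8.c8_g1Closed, LineDesignCert8.c8_staticH1,
    by simpa using LineDesignCert8.cu_mem_upper⟩

/-- the odd FC cell `P[8I+2ℓ₋₁ | 10I+ℓ₋ᵢ³]` of ◇₁₂ (charges 2,1,1,1; one letter in the `±1` class, three in the `±i` class: odd). -/
def oddCellTwelve : MCell := mcellOf (10, -2, 0) (11, 0, 1) (11, 0, 1) (11, 0, 1)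

theorem oddCellTwelve_fc_odd : FCc oddCellTwelve ∧ OddPat oddCellTwelve.pat := by constructor <;> decide +kernel

theorem oddCellTwelve_mem_lP : oddCellTwelve ∈ LineDesignCert12.lP := by decide +kernel

/-- KERNEL WITNESS at 12: this odd ◇₁₂-band-2 realisable cell (W33 j328438, `e23a14857cb78d22`; solver support NOT on one line) IS …. -/
theorem lineRealisable_odd_twelve : LineRealisable 12 false oddCellTwelve :=
  ⟨LineDesignCert12.cfg, LineDesignCert12.cfg_inDiamond,
    ⟨fun Z hZ => LineDesignCert12.lN_onLine Z hZ, fun P hP => LineDesignCert12.lP_onLine P hP⟩,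
    LineDesignCert12.cfg_g1Closed, LineDesignCert12.cfg_staticH1, by simpa using LineDesignCert12.mem_upper_iff.mpr oddCellTwelve_mem_lP⟩

/-- **(LN_h) LINE-NEST LAW** (CONJECTURE, h-uniform; master form of (NS)). -/
def LineNestLaw (h : ℤ) : Prop :=
  ∀ C : MConfig, C.InDiamond h → C.G1Closed → C.StaticH1 → ∀ h' : ℤ,
    (∀ Z ∈ C.lower, FCc Z → (∀ f, OnCeiling h' (Z f)) → LineRealisable h' true Z) ∧
    (∀ P ∈ C.upper, FCc P → (∀ f, OnCeiling h' (P f)) → LineRealisable h' false P)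

theorem nestLaw_of_lineNest {h : ℤ} (H : LineNestLaw h) : NestLaw h := fun C hU hG hS h' =>
  ⟨fun Z hZ hFC hc => cellRealisable_of_lineRealisable ((H C hU hG hS h').1 Z hZ hFC hc),
   fun P hP hFC hc => cellRealisable_of_lineRealisable ((H C hU hG hS h').2 P hP hFC hc)⟩

theorem lineNestLaw_antitone {h h' : ℤ} (hh : h ≤ h') (H : LineNestLaw h') : LineNestLaw h :=
  fun C hU hG hS => H C (inDiamond_config_mono hh hU) hG hS

/-- **(LFD_h) the LINE FLOOR DEPTH**. -/
def LineFloorDepth (h : ℤ) : Prop :=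
  ∀ C : MConfig, C.InDiamond h → OnLine h C → C.G1Closed → RuleDMu4Closed C → XPlusClosed C → FDIneq C

/-- **(OL_h) ⟺ the lineage's `OddFCFreeLine h`**. -/
theorem oddLineFree_iff (h : ℤ) : OddLineFree h ↔
    ∀ C : MConfig, C.InDiamond h → OnLine h C → C.G1Closed → RuleDMu4Closed C → XPlusClosed C → ¬ C.HasOddFC :=
  ⟨fun H C hU hL hG hD hX => H C hU hL.1 hL.2 hG hD hX, fun H C hU hN hP hG hD hX => H C hU ⟨hN, hP⟩ hG hD hX⟩

/-- the common line of a LEVEL cell: all its letters lie on the ceiling line of height `causalTop (Z 0)`, which is `≤ h` inside ◇_h. -/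
theorem level_line {h : ℤ} {Z : MCell} (hZ : ∀ f, InDiamond h (Z f)) (hlev : LevelCell Z) :
    causalTop (Z 0) ≤ h ∧ ∀ f, OnCeiling (causalTop (Z 0)) (Z f) := by
  refine ⟨(inDiamond_levels (hZ 0)).2.2, fun f => ?_⟩
  show causalTop (Z f) = causalTop (Z 0)
  exact hlev f 0

/-- **(LV_h) ∧ (LN_h) ∧ (LFD_{≤h}) ⇒ (FD_h)** (KERNEL). -/
theorem floorDepthLaw_of_level_lineNest {h : ℤ} (hL : LevelLaw h) (hLN : LineNestLaw h) (hLFD : ∀ h' ≤ h, LineFloorDepth h') :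
    FloorDepthLaw h := by
  intro C hU hG hS
  refine ⟨fun P hP hFC f => ?_, fun Z hZ hFC f => ?_⟩
  · have hlev : LevelCell P := hL C hU hG hS P (Finset.mem_union_right _ hP) hFC
    obtain ⟨hle, hc⟩ := level_line (fun f => hU.2 P hP f) hlev
    obtain ⟨C', hU', hL', hG', hS', hP'⟩ := (hLN C hU hG hS _).2 P hP hFC hc
    have hP'' : P ∈ C'.upper := hP'
    exact (hLFD _ hle C' hU' hL' hG' hS'.1 hS'.2.1).1 P hP'' hFC f
  · have hlev : LevelCell Z := hL C hU hG hS Z (Finset.mem_union_left _ hZ) hFC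
    obtain ⟨hle, hc⟩ := level_line (fun f => hU.1 Z hZ f) hlev
    obtain ⟨C', hU', hL', hG', hS', hZ'⟩ := (hLN C hU hG hS _).1 Z hZ hFC hc
    have hZ'' : Z ∈ C'.lower := hZ'
    exact (hLFD _ hle C' hU' hL' hG' hS'.1 hS'.2.1).2 Z hZ'' hFC f

/-- **(LN_h) ∧ (OL_h) ⇒ (OC_h)** (KERNEL): an odd FC ceiling cell would be LINE-realisable on the ceiling, where (OL_h) forbids it. -/
theorem oddCeilingFree_of_lineNest {h : ℤ} (hLN : LineNestLaw h) (hOL : OddLineFree h) : OddCeilingFree h := by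
  intro C hU hG hS Z hZ hFC hc hodd
  rcases Finset.mem_union.mp hZ with hZl | hZu
  · obtain ⟨C', hU', hL', hG', hS', hZ'⟩ := (hLN C hU hG hS h).1 Z hZl hFC hc
    have hZ'' : Z ∈ C'.lower := hZ'
    exact hOL C' hU' hL'.1 hL'.2 hG' hS'.1 hS'.2.1 (Or.inl ⟨Z, hZ'', hFC, hodd⟩)
  · obtain ⟨C', hU', hL', hG', hS', hZ'⟩ := (hLN C hU hG hS h).2 Z hZu hFC hc
    have hZ'' : Z ∈ C'.upper := hZ'
    exact hOL C' hU' hL'.1 hL'.2 hG' hS'.1 hS'.2.1 (Or.inr ⟨Z, hZ'', hFC, hodd⟩)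

/-- **THE MASTER REDUCTION (KERNEL): (LV_h) ∧ (LN_h) ∧ (OL_{≤h}) ⇒ (T_h)**. -/
theorem seedB1Odd_of_level_lineNest {h : ℤ} (hL : LevelLaw h) (hLN : LineNestLaw h) (hOL : ∀ h' ≤ h, OddLineFree h') :
    SeedB1OddDiamondG1H1 h :=
  seedB1Odd_of_level_nest hL (nestLaw_of_lineNest hLN) fun h' hh' =>
    oddCeilingFree_of_lineNest (lineNestLaw_antitone hh' hLN) (hOL h' hh')

/-- **COROLLARY (KERNEL here; the displayed `hOL` is KERNEL in `LinePhaseRigidity.lean` v1.9, `oddFCFreeLine_of_lt_twelve`, f5c30e1c3066 — non-importable Cruxes module, hence DISPLAYED)**. -/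
theorem seedB1Odd_lt_twelve_of_lineNest {h : ℤ} (hh : h < 12) (hL : LevelLaw h) (hLN : LineNestLaw h)
    (hOL : ∀ h' < (12 : ℤ), OddLineFree h') : SeedB1OddDiamondG1H1 h :=
  seedB1Odd_of_level_lineNest hL hLN fun h' hh' => hOL h' (lt_of_le_of_lt hh' hh)

/-- **… and the EXACT THRESHOLD (KERNEL modulo the displayed LINE theorem): under (LV₁₁) ∧ (LN₁₁), `(T_h) ↔ h < 12` for every `h`.** -/
theorem oddThreshold_iff_lineNest (hL : LevelLaw 11) (hLN : LineNestLaw 11) (hOL : ∀ h' < (12 : ℤ), OddLineFree h') (h : ℤ) :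
    SeedB1OddDiamondG1H1 h ↔ h < 12 := by
  refine ⟨fun H => ?_, fun hh => ?_⟩
  · by_contra hge
    exact LineDesignCert12.not_seedB1OddDiamondG1H1_ge (not_lt.mp hge) H
  · have hle : h ≤ 11 := by omega
    exact seedB1Odd_lt_twelve_of_lineNest hh (levelLaw_antitone hle hL) (lineNestLaw_antitone hle hLN) hOL

/-! ## §8 CEILING PROJECTION -/

/-- on an axis letter the phase rotation `Δ` preserves the charge (NOT on a general point: `chargeOf` is the signed `Re β − Im β`). -/
theorem absCharge_deltaPt {x : BPoint} (hax : x.2 = (0, 0) ∨ AxisPt x) : absCharge (deltaPt x) = absCharge x := by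
  simp only [absCharge, chargeOf, deltaPt]
  rcases hax with h0 | ⟨-, h2⟩ | ⟨h1, -⟩
  · have h1 : x.2.1 = 0 := by rw [h0]
    have h2 : x.2.2 = 0 := by rw [h0]
    simp [h1, h2]
  · simp [h2, abs_neg]
  · simp [h1, abs_neg]

theorem onCeiling_deltaPt {h : ℤ} {x : BPoint} (hax : x.2 = (0, 0) ∨ AxisPt x) : OnCeiling h (deltaPt x) ↔ OnCeiling h x := by
  unfold OnCeiling
  rw [absCharge_deltaPt hax]
  exact Iff.rfl

/-- **the CEILING RESTRICTION** of a two-level configuration: the cells all four of whose letters lie on the ceiling line `α + c = h`. -/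
def lineRestrict (h : ℤ) (C : MConfig) : MConfig :=
  ⟨C.lower.filter (fun Z => ∀ f, OnCeiling h (Z f)), C.upper.filter (fun Z => ∀ f, OnCeiling h (Z f))⟩

theorem mem_lineRestrict_lower {h : ℤ} {C : MConfig} {Z : MCell} :
    Z ∈ (lineRestrict h C).lower ↔ Z ∈ C.lower ∧ ∀ f, OnCeiling h (Z f) := Finset.mem_filter

theorem mem_lineRestrict_upper {h : ℤ} {C : MConfig} {Z : MCell} :
    Z ∈ (lineRestrict h C).upper ↔ Z ∈ C.upper ∧ ∀ f, OnCeiling h (Z f) := Finset.mem_filter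

theorem lineRestrict_onLine (h : ℤ) (C : MConfig) : OnLine h (lineRestrict h C) :=
  ⟨fun _ hW => (mem_lineRestrict_lower.1 hW).2, fun _ hP => (mem_lineRestrict_upper.1 hP).2⟩

theorem lineRestrict_inDiamond {h h' : ℤ} {C : MConfig} (hU : C.InDiamond h') : (lineRestrict h C).InDiamond h' :=
  ⟨fun W hW => hU.1 W (mem_lineRestrict_lower.1 hW).1, fun P hP => hU.2 P (mem_lineRestrict_upper.1 hP).1⟩

/-- a configuration already on the line is its own ceiling restriction. -/
theorem lineRestrict_eq_self {h : ℤ} {C : MConfig} (hL : OnLine h C) : lineRestrict h C = C := by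
  obtain ⟨lo, up⟩ := C
  simp only [lineRestrict, MConfig.mk.injEq]
  exact ⟨Finset.filter_true_of_mem fun Z hZ => hL.1 Z hZ, Finset.filter_true_of_mem fun P hP => hL.2 P hP⟩

/-- the ceiling restriction of a `G₁`-closed design in a diamond is `G₁`-closed (factor permutations and the phase rotation `Δ` …. -/
theorem lineRestrict_g1Closed {h h' : ℤ} {C : MConfig} (hU : C.InDiamond h') (hG : C.G1Closed) : (lineRestrict h C).G1Closed := by
  obtain ⟨hPl, hPu, hDl, hDu⟩ := hG
  refine ⟨fun σ Z hZ => ?_, fun σ P hP => ?_, fun Z hZ => ?_, fun P hP => ?_⟩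
  · obtain ⟨hZC, hc⟩ := mem_lineRestrict_lower.1 hZ
    exact mem_lineRestrict_lower.2 ⟨hPl σ Z hZC, fun f => hc (σ f)⟩
  · obtain ⟨hPC, hc⟩ := mem_lineRestrict_upper.1 hP
    exact mem_lineRestrict_upper.2 ⟨hPu σ P hPC, fun f => hc (σ f)⟩
  · obtain ⟨hZC, hc⟩ := mem_lineRestrict_lower.1 hZ
    exact mem_lineRestrict_lower.2 ⟨hDl Z hZC, fun f => (onCeiling_deltaPt (hU.1 Z hZC f).1).2 (hc f)⟩
  · obtain ⟨hPC, hc⟩ := mem_lineRestrict_upper.1 hP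
    exact mem_lineRestrict_upper.2 ⟨hDu P hPC, fun f => (onCeiling_deltaPt (hU.2 P hPC f).1).2 (hc f)⟩

/-- **(CP_h) CEILING PROJECTION LAW** (CONJECTURE for `h ≤ 10` — there a THEOREM of (CD)+(LVN)+(LVP3) via (DL), §12∕§22; machine 449 ∕ 449 models of record at `h = 8, 10, 12|band 2`,
`PROJECTION-d8-d12.md`; machine-FALSE at `12|band 4`: RULE D-`N` of the ceiling restriction fails in 16 ∕ 466 supports, `ALPHA-D12-BAND4-g11.md`). -/
def CeilingProjectionLaw (h : ℤ) : Prop :=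
  ∀ C : MConfig, C.InDiamond h → C.G1Closed → C.StaticH1 → (lineRestrict h C).StaticH1

/-- KERNEL sanity: on LINE designs the law is tautological (tree `LineDesignCert8.c8`, `LineDesignCert12.cfg` are their own restrictions). -/
theorem lineRestrict_c8 : lineRestrict 8 LineDesignCert8.c8 = LineDesignCert8.c8 := lineRestrict_eq_self LineDesignCert8.c8_onLine

theorem lineRestrict_cfg12 : lineRestrict 12 LineDesignCert12.cfg = LineDesignCert12.cfg :=
  lineRestrict_eq_self LineDesignCert12.cfg_onLine

/-- **(CP_h) ⇒ every ceiling cell of a static `G₁` design in ◇_h is LINE-realisable at `h`** (KERNEL; any cell, FC or not). -/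
theorem lineRealisable_of_cp {h : ℤ} (H : CeilingProjectionLaw h) {C : MConfig} (hU : C.InDiamond h) (hG : C.G1Closed) (hS : C.StaticH1) :
    (∀ Z ∈ C.lower, (∀ f, OnCeiling h (Z f)) → LineRealisable h true Z) ∧
    (∀ P ∈ C.upper, (∀ f, OnCeiling h (P f)) → LineRealisable h false P) :=
  ⟨fun Z hZ hc => ⟨lineRestrict h C, lineRestrict_inDiamond hU, lineRestrict_onLine h C, lineRestrict_g1Closed hU hG, H C hU hG hS,
      by simpa using mem_lineRestrict_lower.2 ⟨hZ, hc⟩⟩,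
   fun P hP hc => ⟨lineRestrict h C, lineRestrict_inDiamond hU, lineRestrict_onLine h C, lineRestrict_g1Closed hU hG, H C hU hG hS,
      by simpa using mem_lineRestrict_upper.2 ⟨hP, hc⟩⟩⟩

/-- **(CP_h) ∧ (OL_h) ⇒ (OC_h)** (KERNEL; no nest, no level law). -/
theorem oddCeilingFree_of_cp {h : ℤ} (hCP : CeilingProjectionLaw h) (hOL : OddLineFree h) : OddCeilingFree h := by
  intro C hU hG hS Z hZ hFC hc hodd
  have hS' := hCP C hU hG hS
  refine hOL (lineRestrict h C) (lineRestrict_inDiamond hU) (lineRestrict_onLine h C).1 (lineRestrict_onLine h C).2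
    (lineRestrict_g1Closed hU hG) hS'.1 hS'.2.1 ?_
  rcases Finset.mem_union.mp hZ with hZl | hZu
  · exact Or.inl ⟨Z, mem_lineRestrict_lower.2 ⟨hZl, hc⟩, hFC, hodd⟩
  · exact Or.inr ⟨Z, mem_lineRestrict_upper.2 ⟨hZu, hc⟩, hFC, hodd⟩

theorem ceilingUnitOddFree_of_oddCeilingFree {h : ℤ} (H : OddCeilingFree h) : CeilingUnitOddFree h := by
  intro C hU hG hS P hP hcu
  refine H C hU hG hS P (Finset.mem_union_right _ hP) (fun f => ?_) (fun f => ?_)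
  · obtain ⟨u, hu⟩ := hcu f
    rw [hu]
    fin_cases u <;> simp
  · obtain ⟨u, hu⟩ := hcu f
    rw [hu, cuH_eq_diamondLetter]
    show (diamondLetter (h - 2) 1 u).1 + absCharge (diamondLetter (h - 2) 1 u) = h
    rw [diamondLetter_fst, absCharge_diamondLetter _ _ _ zero_le_one]
    ring

/-- **(T₈) ⇐ (FD₈) ∧ (CP₈) ∧ (OL₈)** (KERNEL; `OddLineFree 8` is PROVED in `LinePhaseRigidity.lean` v1.9, displayed). -/
theorem seedB1Odd_eight_of_cp (hFD : FloorDepthLaw 8) (hCP : CeilingProjectionLaw 8) (hOL : OddLineFree 8) : SeedB1OddDiamondG1H1 8 :=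
  seedB1Odd_eight_of hFD (ceilingUnitOddFree_of_oddCeilingFree (oddCeilingFree_of_cp hCP hOL))

/-- **(NS_h) ∧ (CP_{≤h}) ⇒ (LN_h)** (KERNEL): LINE-NEST is NEST followed by CEILING PROJECTION at the cell's own height. -/
theorem lineNestLaw_of_nest_cp {h : ℤ} (hN : NestLaw h) (hCP : ∀ h' ≤ h, CeilingProjectionLaw h') : LineNestLaw h := by
  intro C hU hG hS h'
  refine ⟨fun Z hZ hFC hc => ?_, fun P hP hFC hc => ?_⟩
  · have hle : h' ≤ h := by
      have h0 := hc 0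
      have := (hU.1 Z hZ 0).2.2.2
      unfold OnCeiling at h0
      omega
    obtain ⟨C', hU', hG', hS', hZ'⟩ := (hN C hU hG hS h').1 Z hZ hFC hc
    have hZ'' : Z ∈ C'.lower := hZ'
    exact (lineRealisable_of_cp (hCP h' hle) hU' hG' hS').1 Z hZ'' hc
  · have hle : h' ≤ h := by
      have h0 := hc 0
      have := (hU.2 P hP 0).2.2.2
      unfold OnCeiling at h0
      omega
    obtain ⟨C', hU', hG', hS', hP'⟩ := (hN C hU hG hS h').2 P hP hFC hc
    have hP'' : P ∈ C'.upper := hP'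
    exact (lineRealisable_of_cp (hCP h' hle) hU' hG' hS').2 P hP'' hc

/-- **MASTER FORM v1.1 (KERNEL): (LV_h) ∧ (NS_h) ∧ (CP_{≤h}) ∧ (OL_{≤h}) ⇒ (T_h).** -/
theorem seedB1Odd_of_level_nest_cp {h : ℤ} (hL : LevelLaw h) (hN : NestLaw h) (hCP : ∀ h' ≤ h, CeilingProjectionLaw h')
    (hOL : ∀ h' ≤ h, OddLineFree h') : SeedB1OddDiamondG1H1 h :=
  seedB1Odd_of_level_lineNest hL (lineNestLaw_of_nest_cp hN hCP) hOL

/-- **… and the exact threshold: under (LV₁₁) ∧ (NS₁₁) ∧ (CP_{≤11}), `(T_h) ↔ h < 12`** (KERNEL modulo the displayed LINE theorem `∀ h' < 12, OL_{h'}`). -/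
theorem oddThreshold_iff_cp (hL : LevelLaw 11) (hN : NestLaw 11) (hCP : ∀ h' ≤ (11 : ℤ), CeilingProjectionLaw h')
    (hOL : ∀ h' < (12 : ℤ), OddLineFree h') (h : ℤ) : SeedB1OddDiamondG1H1 h ↔ h < 12 :=
  oddThreshold_iff_lineNest hL (lineNestLaw_of_nest_cp hN hCP) hOL h

/-! ## §9 The PROVABLE parts of -/

theorem abs_le_add_abs_add_int (a e : ℤ) (he : 0 ≤ e) : |a| ≤ e + |a + e| := by
  have h1 : |a| = |(a + e) - e| := by congr 1; ring
  have h2 := abs_sub (a + e) e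
  rw [abs_of_nonneg he] at h2
  omega

theorem abs_le_add_abs_sub_int (a e : ℤ) (he : 0 ≤ e) : |a| ≤ e + |a - e| := by
  have h1 : |a| = |(a - e) + e| := by congr 1; ring
  have h2 := abs_add_le (a - e) e
  rw [abs_of_nonneg he] at h2
  omega

theorem ray_fst (x : BPoint) (k : Fin 4) (e : ℤ) : (ray x k e).1 = x.1 + e := rfl

theorem chargeOf_ray (x : BPoint) (k : Fin 4) (e : ℤ) :
    chargeOf (ray x k e) = chargeOf x + e * (![1, 0, -1, 0] k - ![0, -1, 0, 1] k) := by
  simp only [chargeOf]; ring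

theorem raySign_cases (k : Fin 4) :
    ((![1, 0, -1, 0] k : ℤ) - ![0, -1, 0, 1] k = 1) ∨ ((![1, 0, -1, 0] k : ℤ) - ![0, -1, 0, 1] k = -1) := by
  fin_cases k <;> simp

/-- **a null step up never lowers the causal top**: `α + |c|` is weakly increasing along every null ray (any point, any direction). -/
theorem causalTop_ray_ge (x : BPoint) (k : Fin 4) {e : ℤ} (he : 0 ≤ e) :
    x.1 + absCharge x ≤ (ray x k e).1 + absCharge (ray x k e) := by
  have h1 := abs_le_add_abs_add_int (chargeOf x) e he
  have h2 := abs_le_add_abs_sub_int (chargeOf x) e he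
  have hc := chargeOf_ray x k e
  show x.1 + |chargeOf x| ≤ (ray x k e).1 + |chargeOf (ray x k e)|
  rw [ray_fst]
  rcases raySign_cases k with hs | hs
  · rw [hs, mul_one] at hc
    rw [hc]; omega
  · rw [hs, mul_neg, mul_one, ← sub_eq_add_neg] at hc
    rw [hc]; omega

/-- **a point of ◇_h null-above a ceiling letter is on the ceiling.** -/
theorem onCeiling_of_ray_up {h : ℤ} {x y : BPoint} (hx : OnCeiling h x) (hy : InDiamond h y) (k : Fin 4) {e : ℤ} (he : 0 ≤ e)
    (hxy : y = ray x k e) : OnCeiling h y := by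
  have h1 := causalTop_ray_ge x k he
  rw [← hxy] at h1
  have h2 := hy.2.2.2
  unfold OnCeiling at hx ⊢
  omega

/-- a `U`-partner ABOVE a ceiling cell (agreeing off one factor, null-above on it) inside ◇_h is a ceiling cell. -/
theorem onCeiling_of_uPartner_above {h : ℤ} {P N : MCell} (hPc : ∀ f, OnCeiling h (P f)) (hN : MCell.InDiamond h N) {σ k : Fin 4}
    (hNP : UPartner N P σ k) : ∀ f, OnCeiling h (N f) := by
  intro f
  by_cases hf : f = σ
  · subst hf
    exact onCeiling_of_ray_up (hPc f) (hN f) k (by have := hNP.2.1; omega) hNP.2.2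
  · rw [← hNP.1 f hf]; exact hPc f

/-- **RULE D at a ceiling `P`-cell survives the ceiling projection** (KERNEL). -/
theorem ruleDMu4P_lineRestrict {h : ℤ} {C : MConfig} (hU : C.InDiamond h) {P : MCell} (hPc : ∀ f, OnCeiling h (P f)) (hD : RuleDMu4P C P) :
    RuleDMu4P (lineRestrict h C) P := by
  intro g j hgj k k' hk hk' hne
  have settle : ∀ (f r : Fin 4), MServedAbove C P f r → MServedAbove (lineRestrict h C) P f r := by
    rintro f r ⟨N, hN, hNP⟩
    exact ⟨N, mem_lineRestrict_lower.2 ⟨hN, onCeiling_of_uPartner_above hPc (hU.1 N hN) hNP⟩, hNP⟩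
  rcases hD g j hgj k k' hk hk' hne with ⟨r, hr, hs⟩ | ⟨r, hr, hs⟩ | ⟨a, b, ha, hb, N, hN, hag, hg1, hg2, hj1, hj2⟩
  · exact Or.inl ⟨r, hr, settle g r hs⟩
  · exact Or.inr (Or.inl ⟨r, hr, settle j r hs⟩)
  · refine Or.inr (Or.inr ⟨a, b, ha, hb, N, mem_lineRestrict_lower.2 ⟨hN, fun f => ?_⟩, hag, hg1, hg2, hj1, hj2⟩)
    by_cases hfg : f = g
    · subst hfg; exact onCeiling_of_ray_up (hPc f) (hU.1 N hN f) a (by omega) hg2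
    by_cases hfj : f = j
    · subst hfj; exact onCeiling_of_ray_up (hPc f) (hU.1 N hN f) b (by omega) hj2
    · rw [hag f hfg hfj]; exact hPc f

/-- hence the `P`-half of RULE-D closure of the ceiling restriction is a THEOREM. -/
theorem ruleDMu4P_lineRestrict_all {h : ℤ} {C : MConfig} (hU : C.InDiamond h) (hD : RuleDMu4Closed C) :
    ∀ P ∈ (lineRestrict h C).upper, RuleDMu4P (lineRestrict h C) P := fun P hP =>
  ruleDMu4P_lineRestrict hU (mem_lineRestrict_upper.1 hP).2 (hD.2 P (mem_lineRestrict_upper.1 hP).1)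

/-- and `A2I⁻` of the ceiling restriction is a THEOREM (vacuous on the line: tree `LineDesignCert12.a2iMinusClosed_of_onCeiling`). -/
theorem a2iMinusClosed_lineRestrict {h : ℤ} {C : MConfig} (hU : C.InDiamond h) : A2IMinusClosed (lineRestrict h C) :=
  LineDesignCert12.a2iMinusClosed_of_onCeiling _ h (lineRestrict_inDiamond hU) (lineRestrict_onLine h C).1 (lineRestrict_onLine h C).2

/-- **(CPN_h)**. -/
def CeilingProjectionN (h : ℤ) : Prop :=
  ∀ C : MConfig, C.InDiamond h → C.G1Closed → C.StaticH1 → ∀ Z ∈ (lineRestrict h C).lower, RuleDMu4N (lineRestrict h C) Z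

/-- **(CPX_h)**. -/
def CeilingProjectionX (h : ℤ) : Prop :=
  ∀ C : MConfig, C.InDiamond h → C.G1Closed → C.StaticH1 → XPlusClosed (lineRestrict h C)

/-- **(CPN_h) ∧ (CPX_h) ⇒ (CP_h)** (KERNEL): the `P`-half of RULE D and `A2I⁻` are theorems on the restriction. -/
theorem ceilingProjectionLaw_of_N_X {h : ℤ} (hN : CeilingProjectionN h) (hX : CeilingProjectionX h) : CeilingProjectionLaw h :=
  fun C hU hG hS => ⟨⟨hN C hU hG hS, ruleDMu4P_lineRestrict_all hU hS.1⟩, hX C hU hG hS, a2iMinusClosed_lineRestrict hU⟩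

/-- conversely (trivially) (CP_h) gives both halves. -/
theorem ceilingProjection_N_X_of_law {h : ℤ} (H : CeilingProjectionLaw h) : CeilingProjectionN h ∧ CeilingProjectionX h :=
  ⟨fun C hU hG hS => (H C hU hG hS).1.1, fun C hU hG hS => (H C hU hG hS).2.1⟩

/-! ## §10 The `N`-half reduced to LINE NODE SERVICE -/

/-- an apex letter on the ceiling has all four coordinates equal to `h`. -/
theorem coord_apex_onCeiling {h : ℤ} {x : BPoint} (hap : isApex x) (hx : OnCeiling h x) (k : Fin 4) : coord x k = h := by
  obtain ⟨α, a, b⟩ := x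
  simp only [isApex] at hap
  obtain ⟨rfl, rfl⟩ := hap
  simp only [OnCeiling, absCharge, chargeOf, sub_self, abs_zero, add_zero] at hx
  fin_cases k <;> simp [coord, hx]

/-- **stepping down from a ceiling letter stays on the ceiling unless the step is in a charged letter's top direction**. -/
theorem onCeiling_of_ray_down {h : ℤ} {x y : BPoint} (r : Fin 4) {d : ℤ} (hd : 0 ≤ d) (hxy : x = ray y r d)
    (hx : OnCeiling h x) (hxax : x.2 = (0, 0) ∨ AxisPt x) (hy : y.2 = (0, 0) ∨ AxisPt y) (hdir : isApex x ∨ coord x r ≠ h) :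
    OnCeiling h y := by
  obtain ⟨α, a, b⟩ := y
  subst hxy
  simp only [OnCeiling, absCharge, chargeOf, isApex, coord, AxisPt, Prod.mk.injEq] at *
  fin_cases r <;> simp at hx hxax hdir ⊢ <;>
    (simp only [abs_eq_max_neg, max_def] at *; split_ifs at * <;> omega)

/-- **for a charged ceiling letter, only the top direction has coordinate `h`**. -/
theorem coord_ne_top_of_node {h : ℤ} {x : BPoint} (hx : OnCeiling h x) (hax : x.2 = (0, 0) ∨ AxisPt x) (hna : ¬ isApex x)
    {k r : Fin 4} (hk : Adapted x k) (hkh : coord x k ≠ h) (hr : r ≠ k + 2) : coord x r ≠ h := by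
  obtain ⟨α, a, b⟩ := x
  simp only [OnCeiling, absCharge, chargeOf, isApex, coord, AxisPt, Adapted, Prod.mk.injEq] at *
  fin_cases k <;> fin_cases r <;> simp at hk hkh hr ⊢ <;>
    (simp only [abs_eq_max_neg, max_def] at *; split_ifs at * <;> omega)

theorem fin4_ne_add_two (k : Fin 4) : k ≠ k + 2 := by fin_cases k <;> decide

/-- a `DirOK` cover direction at a letter all of whose non-antipodal directions are safe is safe. -/
theorem dirOK_safe {h : ℤ} {x : BPoint} {k a : Fin 4} (ha : DirOK x k a) (H : ∀ r, r ≠ k + 2 → (isApex x ∨ coord x r ≠ h)) :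
    isApex x ∨ coord x a ≠ h := by
  rcases ha with rfl | ⟨hap, _⟩
  · exact H _ (fin4_ne_add_two _)
  · exact Or.inl hap

/-- **LINE NODE SERVICE at a ceiling `N`-cell `Z`** (the residual, non-transferring RULE-D requirement). -/
abbrev LineNodeSettled (h : ℤ) (C : MConfig) (Z : MCell) : Prop :=
  ∀ g j : Fin 4, g ≠ j → ¬ isApex (Z g) → ¬ isApex (Z j) → ∀ k : Fin 4, Adapted (Z j) k → coord (Z j) k ≠ h →
    SettledBelow (lineRestrict h C) Z j k

/-- **RULE D at a ceiling `N`-cell transfers to the ceiling restriction, given line node service** (KERNEL). -/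
theorem ruleDMu4N_lineRestrict {h : ℤ} {C : MConfig} (hU : C.InDiamond h) {Z : MCell} (hZ : Z ∈ C.lower) (hZc : ∀ f, OnCeiling h (Z f))
    (hD : RuleDMu4N C Z) (hL : LineNodeSettled h C Z) : RuleDMu4N (lineRestrict h C) Z := by
  intro g j hgj k k' hk hk' hne
  by_cases hcase : ¬ isApex (Z g) ∧ ¬ isApex (Z j)
  · obtain ⟨hg, hj⟩ := hcase
    by_cases hgk : coord (Z g) k = h
    · have hjk : coord (Z j) k' ≠ h := fun e => hne (hgk.trans e.symm)
      exact Or.inr (Or.inl (hL g j hgj hg hj k' hk' hjk))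
    · exact Or.inl (hL j g (Ne.symm hgj) hj hg k hk hgk)
  · -- at least one of the two letters is an apex: every witness of `C` stays on the line
    have key : ∀ (f r : Fin 4) (P : MCell), P ∈ C.upper → UPartner Z P f r → (isApex (Z f) ∨ coord (Z f) r ≠ h) →
        P ∈ (lineRestrict h C).upper := by
      intro f r P hP hZP hdir
      refine mem_lineRestrict_upper.2 ⟨hP, fun f' => ?_⟩
      by_cases hf : f' = f
      · rw [hf]
        exact onCeiling_of_ray_down r (by have := hZP.2.1; omega) hZP.2.2 (hZc f) (hU.1 Z hZ f).1 (hU.2 P hP f).1 hdir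
      · rw [hZP.1 f' hf]; exact hZc f'
    have hapex : isApex (Z g) ∨ isApex (Z j) := by
      by_contra hh
      exact hcase ⟨fun h1 => hh (Or.inl h1), fun h2 => hh (Or.inr h2)⟩
    have dirg : ∀ r, r ≠ k + 2 → (isApex (Z g) ∨ coord (Z g) r ≠ h) := by
      intro r hr
      by_cases hga : isApex (Z g)
      · exact Or.inl hga
      · have hja : isApex (Z j) := hapex.resolve_left hga
        have hgk : coord (Z g) k ≠ h := by rw [← coord_apex_onCeiling hja (hZc j) k']; exact hne
        exact Or.inr (coord_ne_top_of_node (hZc g) (hU.1 Z hZ g).1 hga hk hgk hr)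
    have dirj : ∀ r, r ≠ k' + 2 → (isApex (Z j) ∨ coord (Z j) r ≠ h) := by
      intro r hr
      by_cases hja : isApex (Z j)
      · exact Or.inl hja
      · have hga : isApex (Z g) := hapex.resolve_right hja
        have hjk : coord (Z j) k' ≠ h := by rw [← coord_apex_onCeiling hga (hZc g) k]; exact Ne.symm hne
        exact Or.inr (coord_ne_top_of_node (hZc j) (hU.1 Z hZ j).1 hja hk' hjk hr)
    rcases hD g j hgj k k' hk hk' hne with ⟨r, hr, P, hP, hZP⟩ | ⟨r, hr, P, hP, hZP⟩ | ⟨a, b, ha, hb, P, hP, hag, hg1, hg2, hj1, hj2⟩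
    · exact Or.inl ⟨r, hr, P, key g r P hP hZP (dirg r hr), hZP⟩
    · exact Or.inr (Or.inl ⟨r, hr, P, key j r P hP hZP (dirj r hr), hZP⟩)
    · refine Or.inr (Or.inr ⟨a, b, ha, hb, P, mem_lineRestrict_upper.2 ⟨hP, fun f => ?_⟩, hag, hg1, hg2, hj1, hj2⟩)
      by_cases hfg : f = g
      · rw [hfg]; exact onCeiling_of_ray_down a (by omega) hg2 (hZc g) (hU.1 Z hZ g).1 (hU.2 P hP g).1 (dirOK_safe ha dirg)
      · by_cases hfj : f = j
        · rw [hfj]; exact onCeiling_of_ray_down b (by omega) hj2 (hZc j) (hU.1 Z hZ j).1 (hU.2 P hP j).1 (dirOK_safe hb dirj)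
        · rw [hag f hfg hfj]; exact hZc f

/-- **(LNS_h) LINE NODE SERVICE LAW** (⟺ (CP_h), §12; THEOREM of (CD)+(LVN)+(LVP3) for `h ≤ 10` via (DL); machine-FALSE at `12|band 4`, `ALPHA-D12-BAND4-g11.md`). -/
def LineNodeServiceLaw (h : ℤ) : Prop :=
  ∀ C : MConfig, C.InDiamond h → C.G1Closed → C.StaticH1 → ∀ Z ∈ (lineRestrict h C).lower, LineNodeSettled h C Z

/-- **(LNS_h) ⇒ (CPN_h)** (KERNEL). -/
theorem ceilingProjectionN_of_lns {h : ℤ} (H : LineNodeServiceLaw h) : CeilingProjectionN h := fun C hU hG hS Z hZ =>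
  ruleDMu4N_lineRestrict hU (mem_lineRestrict_lower.1 hZ).1 (mem_lineRestrict_lower.1 hZ).2
    (hS.1.1 Z (mem_lineRestrict_lower.1 hZ).1) (H C hU hG hS Z hZ)

/-- **(LNS_h) ∧ (CPX_h) ⇒ (CP_h)** (KERNEL): the whole conjectural content of the ceiling projection law is LINE NODE SERVICE + `X⁺`. -/
theorem ceilingProjectionLaw_of_lns_X {h : ℤ} (hL : LineNodeServiceLaw h) (hX : CeilingProjectionX h) : CeilingProjectionLaw h :=
  ceilingProjectionLaw_of_N_X (ceilingProjectionN_of_lns hL) hX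

/-- and therefore (T₈) ⇐ FD₈ ∧ LNS₈ ∧ CPX₈ ∧ OL₈ (KERNEL chain `seedB1Odd_eight_of_cp`). -/
theorem seedB1Odd_eight_of_lns (hFD : FloorDepthLaw 8) (hL : LineNodeServiceLaw 8) (hX : CeilingProjectionX 8) (hOL : OddLineFree 8) :
    SeedB1OddDiamondG1H1 8 :=
  seedB1Odd_eight_of_cp hFD (ceilingProjectionLaw_of_lns_X hL hX) hOL

/-! ## §11 The converse (KERNEL) -/

/-- every ceiling μ₄ letter has a TOP direction: an adapted coordinate of value `h`. -/
theorem exists_top_dir {h : ℤ} {x : BPoint} (hx : OnCeiling h x) (hxax : x.2 = (0, 0) ∨ AxisPt x) :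
    ∃ m : Fin 4, Adapted x m ∧ coord x m = h := by
  obtain ⟨α, a, b⟩ := x
  simp only [OnCeiling, absCharge, chargeOf, AxisPt, Prod.mk.injEq] at hx hxax
  by_cases hb : b = 0
  · subst hb
    by_cases ha : 0 ≤ a
    · exact ⟨0, by simp [Adapted], by simp [coord]; rw [abs_of_nonneg (by omega)] at hx; omega⟩
    · exact ⟨2, by simp [Adapted], by simp [coord]; rw [abs_of_neg (by omega)] at hx; omega⟩
  · have ha : a = 0 := by omega
    subst ha
    by_cases hb' : 0 ≤ b
    · exact ⟨3, by simp [Adapted], by simp [coord]; rw [abs_of_nonpos (by omega)] at hx; omega⟩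
    · exact ⟨1, by simp [Adapted], by simp [coord]; rw [abs_of_pos (by omega)] at hx; omega⟩

/-- **no ceiling letter lies strictly below a charged ceiling letter in its top direction or off its frame.** -/
theorem not_onCeiling_below_top {h : ℤ} {x y : BPoint} {m r : Fin 4} {d : ℤ} (hx : OnCeiling h x) (hxax : x.2 = (0, 0) ∨ AxisPt x)
    (hna : ¬ isApex x) (hm : Adapted x m) (hmh : coord x m = h) (hr : r ≠ m + 2) (hd : 0 < d) (hxy : x = ray y r d)
    (hyax : y.2 = (0, 0) ∨ AxisPt y) (hyc : OnCeiling h y) : False := by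
  obtain ⟨α, a, b⟩ := y
  subst hxy
  simp only [OnCeiling, absCharge, chargeOf, isApex, coord, AxisPt, Adapted, Prod.mk.injEq] at *
  fin_cases m <;> fin_cases r <;> simp at hx hxax hna hm hmh hr hyc <;>
    (simp only [abs_eq_max_neg, max_def] at *; split_ifs at * <;> omega)

/-- **RULE D on the ceiling restriction forces line node service** (KERNEL converse of `ruleDMu4N_lineRestrict`). -/
theorem lineNodeSettled_of_ruleDMu4N {h : ℤ} {C : MConfig} (hU : C.InDiamond h) {Z : MCell} (hZ : Z ∈ C.lower)
    (hZc : ∀ f, OnCeiling h (Z f)) (hD : RuleDMu4N (lineRestrict h C) Z) : LineNodeSettled h C Z := by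
  intro g j hgj hg hj k hk hkh
  obtain ⟨m, hm, hmh⟩ := exists_top_dir (hZc g) (hU.1 Z hZ g).1
  have hne : coord (Z g) m ≠ coord (Z j) k := by rw [hmh]; exact Ne.symm hkh
  rcases hD g j hgj m k hm hk hne with ⟨r, hr, P, hP, hZP⟩ | h2 | ⟨a, b, ha, _, P, hP, _, hg1, hg2, _, _⟩
  · exact (not_onCeiling_below_top (hZc g) (hU.1 Z hZ g).1 hg hm hmh hr (by have := hZP.2.1; omega) hZP.2.2
      (hU.2 P (mem_lineRestrict_upper.1 hP).1 g).1 ((mem_lineRestrict_upper.1 hP).2 g)).elim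
  · exact h2
  · rcases ha with rfl | ⟨hap, _⟩
    · exact (not_onCeiling_below_top (hZc g) (hU.1 Z hZ g).1 hg hm hmh (fin4_ne_add_two _) (by omega) hg2
        (hU.2 P (mem_lineRestrict_upper.1 hP).1 g).1 ((mem_lineRestrict_upper.1 hP).2 g)).elim
    · exact (hg hap).elim

/-- **(CPN_h) ⇒ (LNS_h)** (KERNEL). -/
theorem lns_of_ceilingProjectionN {h : ℤ} (H : CeilingProjectionN h) : LineNodeServiceLaw h := fun C hU hG hS Z hZ =>
  lineNodeSettled_of_ruleDMu4N hU (mem_lineRestrict_lower.1 hZ).1 (mem_lineRestrict_lower.1 hZ).2 (H C hU hG hS Z hZ)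

/-- **(CPN_h) ⟺ (LNS_h)** and **(CP_h) ⟺ (LNS_h) ∧ (CPX_h)** (KERNEL): the ceiling projection law IS line node service plus `X⁺`. -/
theorem ceilingProjectionN_iff_lns (h : ℤ) : CeilingProjectionN h ↔ LineNodeServiceLaw h :=
  ⟨lns_of_ceilingProjectionN, ceilingProjectionN_of_lns⟩

theorem ceilingProjectionLaw_iff_lns_X (h : ℤ) : CeilingProjectionLaw h ↔ LineNodeServiceLaw h ∧ CeilingProjectionX h :=
  ⟨fun H => ⟨lns_of_ceilingProjectionN (ceilingProjection_N_X_of_law H).1, (ceilingProjection_N_X_of_law H).2⟩,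
   fun H => ceilingProjectionLaw_of_lns_X H.1 H.2⟩

/-! ## §12 `X⁺` survives the ceiling projection -/

theorem bsub_dualPt0 (x y : BPoint) : bsub (dualPt 0 x) (dualPt 0 y) = bsub y x := by
  obtain ⟨a, b, c⟩ := x
  obtain ⟨a', b', c'⟩ := y
  simp only [bsub, Prod.mk.injEq]
  refine ⟨by ring, by ring, by ring⟩

theorem nullBelow_effective {y x : BPoint} (hN : NullBelow y x) : Effective (bsub x y) :=
  ⟨by show 0 ≤ x.1 - y.1; have := hN.1; omega,
   by show (x.2.1 - y.2.1) ^ 2 + (x.2.2 - y.2.2) ^ 2 ≤ (x.1 - y.1) ^ 2; exact hN.2.le⟩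

theorem ray_add (x : BPoint) (k : Fin 4) (a b : ℤ) : ray x k (a + b) = ray (ray x k a) k b := by
  obtain ⟨p, q, r⟩ := x
  simp only [ray, Prod.mk.injEq]
  refine ⟨by ring, by ring, by ring⟩

/-- two points on the same null ray above `x` lie on one null ray. -/
theorem ray_between {x p n : BPoint} {w : Fin 4} (hp : p = ray x w (p.1 - x.1)) (hn : n = ray x w (n.1 - x.1)) :
    n = ray p w (n.1 - p.1) := by
  obtain ⟨x1, x2, x3⟩ := x
  obtain ⟨p1, p2, p3⟩ := p
  obtain ⟨n1, n2, n3⟩ := n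
  fin_cases w <;> simp [ray, Prod.ext_iff] at hp hn ⊢ <;> omega

/-- **a ◇_h letter causally above a ceiling letter is on the ceiling** (any causal direction, μ₄ or Pythagorean). -/
theorem onCeiling_of_effective_above {h : ℤ} {x y : BPoint} (hx : OnCeiling h x) (hxax : x.2 = (0, 0) ∨ AxisPt x)
    (hy : InDiamond h y) (hE : Effective (bsub y x)) : OnCeiling h y := by
  obtain ⟨α, a, b⟩ := x
  obtain ⟨α', a', b'⟩ := y
  obtain ⟨hyax, _, _, hytop⟩ := hy
  simp only [OnCeiling, absCharge, chargeOf, AxisPt, Effective, Prod.mk.injEq] at *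
  obtain ⟨hD, hsq⟩ := hE
  have h1 : a' - a ≤ α' - α := by nlinarith [sq_nonneg (b' - b), sq_nonneg (a' - a)]
  have h2 : -(a' - a) ≤ α' - α := by nlinarith [sq_nonneg (b' - b), sq_nonneg (a' - a)]
  have h3 : b' - b ≤ α' - α := by nlinarith [sq_nonneg (b' - b), sq_nonneg (a' - a)]
  have h4 : -(b' - b) ≤ α' - α := by nlinarith [sq_nonneg (b' - b), sq_nonneg (a' - a)]
  simp only [abs_eq_max_neg, max_def] at *
  split_ifs at * <;> omega

/-- dual form: a dual-side letter causally BELOW a dual-ceiling letter (`Effective (bsub z p)`) is dual-ceiling. -/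
theorem dual_onCeiling_of_effective {h : ℤ} {z p : BPoint} (hz : OnCeiling h (dualPt 0 z))
    (hzax : (dualPt 0 z).2 = (0, 0) ∨ AxisPt (dualPt 0 z)) (hp : InDiamond h (dualPt 0 p)) (hE : Effective (bsub z p)) :
    OnCeiling h (dualPt 0 p) :=
  onCeiling_of_effective_above hz hzax hp (by rw [bsub_dualPt0]; exact hE)

/-- **`X⁺`-closure survives the ceiling projection** (KERNEL): every breaker of a ceiling `X⁺` clause is a ceiling cell. -/
theorem xPlusClosed_lineRestrict {h : ℤ} {C : MConfig} (hU : C.InDiamond h) (hX : XPlusClosed C) : XPlusClosed (lineRestrict h C) := by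
  intro Z hZ q hq n hn σ u w f hF
  have hZ1 := mem_lineRestrict_upper.1 (mem_dual_lower.1 hZ)
  have hq1 := mem_lineRestrict_lower.1 (mem_dual_upper.1 hq)
  have hn1 := mem_lineRestrict_upper.1 (mem_dual_lower.1 hn)
  have hZ0 : Z ∈ (C.dual 0).lower := mem_dual_lower.2 hZ1.1
  have hq0 : q ∈ (C.dual 0).upper := mem_dual_upper.2 hq1.1
  have hn0 : n ∈ (C.dual 0).lower := mem_dual_lower.2 hn1.1
  have memD : ∀ P ∈ (C.dual 0).upper, (∀ g, OnCeiling h (dualPt 0 (P g))) → P ∈ ((lineRestrict h C).dual 0).upper :=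
    fun P hP hc => mem_dual_upper.2 (mem_lineRestrict_lower.2 ⟨mem_dual_upper.1 hP, hc⟩)
  have coneZ : ∀ P ∈ (C.dual 0).upper, ∀ g, Effective (bsub (Z g) (P g)) → OnCeiling h (dualPt 0 (P g)) :=
    fun P hP g hE => dual_onCeiling_of_effective (hZ1.2 g) (hU.2 _ hZ1.1 g).1 (hU.1 _ (mem_dual_upper.1 hP) g) hE
  have conen : ∀ P ∈ (C.dual 0).upper, ∀ g, Effective (bsub (n g) (P g)) → OnCeiling h (dualPt 0 (P g)) :=
    fun P hP g hE => dual_onCeiling_of_effective (hn1.2 g) (hU.2 _ hn1.1 g).1 (hU.1 _ (mem_dual_upper.1 hP) g) hE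
  obtain ⟨h1, h2, h3, hTop, h5, h6, hNC, hHe, hHb, hWf⟩ := hF
  refine hX Z hZ0 q hq0 n hn0 σ u w f ⟨h1, h2, h3, ?_, h5, h6, ?_, ?_, ?_, ?_⟩
  · -- the escape set: a higher `u`-partner of the head is null-above a ceiling letter
    intro P hP hUP
    refine hTop P (memD P hP fun g => ?_) hUP
    by_cases hg : g = σ
    · rw [hg]
      have he := effective_ray_sub (P σ) u (e := (Z σ).1 - (P σ).1) (by have := hUP.2.1; omega)
      rw [← hUP.2.2] at he
      exact coneZ P hP σ he
    · rw [hUP.1 g hg]; exact hZ1.2 g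
  · -- a companion strictly between the partner and the sibling lies on their common null ray below the sibling
    intro P hP hag hlt1 hlt2 heq
    have hc : ∀ g, OnCeiling h (dualPt 0 (P g)) := by
      intro g
      by_cases hg : g = σ
      · rw [hg]
        have e1 : n σ = ray (P σ) w ((n σ).1 - (P σ).1) := ray_between heq h6.2.2
        have he := effective_ray_sub (P σ) w (e := (n σ).1 - (P σ).1) (by omega)
        rw [← e1] at he
        exact conen P hP σ he
      · rw [hag g hg]; exact hq1.2 g
    exact hNC P (memD P hP hc) hag hlt1 hlt2 heq
  · -- an (H-e′) participant is causally below the sibling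
    intro P hP hag hne hEff hnT
    refine hHe P (memD P hP fun g => ?_) hag hne hEff hnT
    by_cases hg : g = σ
    · rw [hg]; exact conen P hP σ hEff
    · rw [hag g hg]; exact hZ1.2 g
  · -- an (H-b) participant: null-below the head on `f`, causally below the sibling on `σ`
    intro P hP hag2 hNull hEff
    refine hHb P (memD P hP fun g => ?_) hag2 hNull hEff
    by_cases hgs : g = σ
    · rw [hgs]; exact conen P hP σ hEff
    · by_cases hgf : g = f
      · rw [hgf]; exact coneZ P hP f (nullBelow_effective hNull)
      · rw [hag2 g hgs hgf]; exact hZ1.2 g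
  · -- a `W_f` leg ∕ (r2a) partner: null-below the head on `f` (and `g`)
    intro P hP hNull
    constructor
    · intro hag
      have hc : ∀ g, OnCeiling h (dualPt 0 (P g)) := fun g => by
        by_cases hgf : g = f
        · rw [hgf]; exact coneZ P hP f (nullBelow_effective hNull)
        · rw [hag g hgf]; exact hZ1.2 g
      exact (hWf P (memD P hP hc) hNull).1 hag
    · intro g hg hag2 hNull2
      have hc : ∀ g', OnCeiling h (dualPt 0 (P g')) := fun g' => by
        by_cases e1 : g' = f
        · rw [e1]; exact coneZ P hP f (nullBelow_effective hNull)
        · by_cases e2 : g' = g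
          · rw [e2]; exact coneZ P hP g (nullBelow_effective hNull2)
          · rw [hag2 g' e1 e2]; exact hZ1.2 g'
      exact (hWf P (memD P hP hc) hNull).2 g hg hag2 hNull2

/-- **(CPX_h) holds for every `h`** (KERNEL). -/
theorem ceilingProjectionX_holds (h : ℤ) : CeilingProjectionX h := fun _ hU _ hS => xPlusClosed_lineRestrict hU hS.2.1

/-- **(CP_h) ⟺ (LNS_h)** (KERNEL): the ceiling projection law is exactly LINE NODE SERVICE. -/
theorem ceilingProjectionLaw_iff_lns (h : ℤ) : CeilingProjectionLaw h ↔ LineNodeServiceLaw h :=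
  ⟨fun H => ((ceilingProjectionLaw_iff_lns_X h).1 H).1, fun H => ceilingProjectionLaw_of_lns_X H (ceilingProjectionX_holds h)⟩

/-- **(T₈) ⇐ FD₈ ∧ LNS₈ ∧ OL₈** (KERNEL chain). -/
theorem seedB1Odd_eight_of_lns' (hFD : FloorDepthLaw 8) (hL : LineNodeServiceLaw 8) (hOL : OddLineFree 8) :
    SeedB1OddDiamondG1H1 8 :=
  seedB1Odd_eight_of_cp hFD ((ceilingProjectionLaw_iff_lns 8).2 hL) hOL

/-- **(NS_h) ∧ (LNS_{≤h}) ⇒ (LN_h)** (KERNEL). -/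
theorem lineNestLaw_of_nest_lns {h : ℤ} (hN : NestLaw h) (hL : ∀ h' ≤ h, LineNodeServiceLaw h') : LineNestLaw h :=
  lineNestLaw_of_nest_cp hN fun h' hh => (ceilingProjectionLaw_iff_lns h').2 (hL h' hh)

/-- **LEVEL ∧ NEST ∧ LINE NODE SERVICE ∧ odd-line-freeness ⇒ (T_h)** (KERNEL master reduction, v1.2 form). -/
theorem seedB1Odd_of_level_nest_lns {h : ℤ} (hLV : LevelLaw h) (hN : NestLaw h) (hL : ∀ h' ≤ h, LineNodeServiceLaw h')
    (hOL : ∀ h' ≤ h, OddLineFree h') : SeedB1OddDiamondG1H1 h :=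
  seedB1Odd_of_level_nest_cp hLV hN (fun h' hh => (ceilingProjectionLaw_iff_lns h').2 (hL h' hh)) hOL

/-- **the odd threshold under LEVEL ∧ NEST ∧ LNS** (KERNEL, given the kernel LINE theorem `∀ h' < 12, OddLineFree h'` as a displayed hypothesis). -/
theorem oddThreshold_iff_lns (hL : LevelLaw 11) (hN : NestLaw 11) (hS : ∀ h' ≤ (11 : ℤ), LineNodeServiceLaw h')
    (hOL : ∀ h' < (12 : ℤ), OddLineFree h') (h : ℤ) : SeedB1OddDiamondG1H1 h ↔ h < 12 :=
  oddThreshold_iff_cp hL hN (fun h' hh => (ceilingProjectionLaw_iff_lns h').2 (hS h' hh)) hOL h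

/-! ## §13 (LNS) instantiated on the tree's kernel line designs -/

/-- the ◇₈ ceiling-unit design `c8` (14 orbits on LINE 8, tree `Pad4TowerLineDesignCert8`) is line-node-settled at every `N`-cell. -/
theorem lineNodeSettled_c8 : ∀ Z ∈ LineDesignCert8.c8.lower, LineNodeSettled 8 LineDesignCert8.c8 Z := fun Z hZ =>
  lineNodeSettled_of_ruleDMu4N LineDesignCert8.c8_inDiamond hZ (LineDesignCert8.c8_onLine.1 Z hZ)
    (by rw [lineRestrict_c8]; exact LineDesignCert8.c8_staticH1.1.1 Z hZ)

/-- the ◇₁₂ odd design `cfg` (46 orbits on LINE 12, tree `Pad4TowerLineDesignCert12`) is line-node-settled at every `N`-cell. -/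
theorem lineNodeSettled_cfg12 : ∀ Z ∈ LineDesignCert12.cfg.lower, LineNodeSettled 12 LineDesignCert12.cfg Z := fun Z hZ =>
  lineNodeSettled_of_ruleDMu4N LineDesignCert12.cfg_inDiamond hZ (LineDesignCert12.cfg_onLine.1 Z hZ)
    (by rw [lineRestrict_cfg12]; exact LineDesignCert12.cfg_staticH1.1.1 Z hZ)

/-! ## §14 (LNS) at FULLY CHARGED heads follows from -/

theorem isApex_iff_snd (x : BPoint) : isApex x ↔ x.2 = (0, 0) := by
  obtain ⟨α, a, b⟩ := x
  simp [isApex, Prod.mk.injEq]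

theorem not_isApex_of_fcc {Z : MCell} (hFC : FCc Z) (f : Fin 4) : ¬ isApex (Z f) := fun hap => hFC f ((isApex_iff_snd _).1 hap)

/-- a cell is FC or has an apex letter. -/
theorem fcc_or_exists_apex (Z : MCell) : FCc Z ∨ ∃ f, isApex (Z f) := by
  by_cases hFC : FCc Z
  · exact Or.inl hFC
  · refine Or.inr ?_
    simp only [FCc, not_forall, not_not] at hFC
    obtain ⟨f, hf⟩ := hFC
    exact ⟨f, (isApex_iff_snd _).2 hf⟩

/-- **stepping down in a NODE direction of a ceiling letter never reaches an apex**. -/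
theorem not_isApex_below_node {h : ℤ} {x y : BPoint} {k : Fin 4} {d : ℤ} (hxy : x = ray y k d) (hx : OnCeiling h x) (hd : 0 ≤ d)
    (hkh : coord x k ≠ h) : ¬ isApex y := by
  obtain ⟨α, a, b⟩ := y
  rintro ⟨ha, hb⟩
  simp only at ha hb
  subst ha; subst hb; subst hxy
  simp only [OnCeiling, absCharge, chargeOf, coord] at hx hkh
  fin_cases k <;> simp at hx hkh <;> (simp only [abs_eq_max_neg, max_def] at *; split_ifs at * <;> omega)

/-- an **APEX-DROP cell** of ◇_h: one letter is an APEX strictly BELOW the ceiling, the other three are CHARGED CEILING …. -/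
def ApexDropCell (h : ℤ) (P : MCell) : Prop :=
  ∃ g : Fin 4, isApex (P g) ∧ ¬ OnCeiling h (P g) ∧ ∀ f, f ≠ g → OnCeiling h (P f) ∧ ¬ isApex (P f)

/-- **(AD_h) APEX-DROP EXCLUSION** (CONJECTURE, h-uniform; a THEOREM of (LVP3), §17). -/
def ApexDropLaw (h : ℤ) : Prop :=
  ∀ C : MConfig, C.InDiamond h → C.G1Closed → C.StaticH1 → ∀ P ∈ C.upper, ¬ ApexDropCell h P

/-- **LINE NODE SERVICE AT A FULLY CHARGED CEILING HEAD from RULE D, levelness of the present FC `P`-cells and apex-drop exclusion** (KERNEL). -/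
theorem lineNodeSettled_of_fc {h : ℤ} {C : MConfig} (hU : C.InDiamond h) {Z : MCell} (hZ : Z ∈ C.lower) (hZc : ∀ f, OnCeiling h (Z f))
    (hFC : FCc Z) (hD : RuleDMu4N C Z) (hLV : ∀ P ∈ C.upper, FCc P → LevelCell P) (hAD : ∀ P ∈ C.upper, ¬ ApexDropCell h P) :
    LineNodeSettled h C Z := by
  intro g j hgj hg hj k hk hkh
  obtain ⟨m, hm, hmh⟩ := exists_top_dir (hZc g) (hU.1 Z hZ g).1
  have hne : coord (Z g) m ≠ coord (Z j) k := by rw [hmh]; exact Ne.symm hkh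
  -- the common contradiction: a present `P` strictly below `Z` on `g`, off the node ray of `x_g`, whose other three letters are charged ceiling letters
  have clash : ∀ P : MCell, P ∈ C.upper → ∀ (r : Fin 4) (d : ℤ), r ≠ m + 2 → 0 < d → Z g = ray (P g) r d →
      (∀ f, f ≠ g → OnCeiling h (P f) ∧ ¬ isApex (P f)) → False := by
    intro P hP r d hr hd hray hoth
    have hnc : ¬ OnCeiling h (P g) := fun hyc =>
      not_onCeiling_below_top (hZc g) (hU.1 Z hZ g).1 hg hm hmh hr hd hray (hU.2 P hP g).1 hyc
    by_cases hap : isApex (P g)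
    · exact hAD P hP ⟨g, hap, hnc, hoth⟩
    · have hFCP : FCc P := fun f => by
        by_cases hf : f = g
        · rw [hf]; exact fun e => hap ((isApex_iff_snd _).2 e)
        · exact fun e => (hoth f hf).2 ((isApex_iff_snd _).2 e)
      have hlev : causalTop (P g) = causalTop (P j) := hLV P hP hFCP g j
      have hjc : causalTop (P j) = h := (hoth j (Ne.symm hgj)).1
      exact hnc (show causalTop (P g) = h by rw [hlev, hjc])
  rcases hD g j hgj m k hm hk hne with ⟨r, hr, P, hP, hZP⟩ | ⟨r, hr, P, hP, hZP⟩ | ⟨a, b, ha, hb, P, hP, hag, hg1, hg2, hj1, hj2⟩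
  · -- served below on `g` off the node ray: impossible
    exact (clash P hP r _ hr (by have := hZP.2.1; omega) hZP.2.2
      (fun f hf => by rw [hZP.1 f hf]; exact ⟨hZc f, not_isApex_of_fcc hFC f⟩)).elim
  · -- served below on `j` in a direction `r ≠ k + 2`: the server is a ceiling cell, i.e. line service
    refine ⟨r, hr, P, mem_lineRestrict_upper.2 ⟨hP, fun f => ?_⟩, hZP⟩
    by_cases hf : f = j
    · rw [hf]
      exact onCeiling_of_ray_down r (by have := hZP.2.1; omega) hZP.2.2 (hZc j) (hU.1 Z hZ j).1 (hU.2 P hP j).1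
        (Or.inr (coord_ne_top_of_node (hZc j) (hU.1 Z hZ j).1 hj hk hkh hr))
    · rw [hZP.1 f hf]; exact hZc f
  · -- a cover moving `g` in its top direction (`a = m`, `x_g` charged) and `j` down the line (`b = k`): impossible
    have ha' : a = m := by
      rcases ha with h1 | ⟨hap, _⟩
      · exact h1
      · exact (hg hap).elim
    have hb' : b = k := by
      rcases hb with h1 | ⟨hap, _⟩
      · exact h1
      · exact (hj hap).elim
    rw [ha'] at hg2
    rw [hb'] at hj2
    have hPj : OnCeiling h (P j) :=
      onCeiling_of_ray_down k (by omega) hj2 (hZc j) (hU.1 Z hZ j).1 (hU.2 P hP j).1 (Or.inr hkh)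
    have hPj' : ¬ isApex (P j) := not_isApex_below_node hj2 (hZc j) (by omega) hkh
    exact (clash P hP m _ (fin4_ne_add_two m) (by omega) hg2 (fun f hf => by
      by_cases hfj : f = j
      · rw [hfj]; exact ⟨hPj, hPj'⟩
      · rw [hag f hf hfj]; exact ⟨hZc f, not_isApex_of_fcc hFC f⟩)).elim

/-- **(LNS-FC_h)**: line node service at the FULLY CHARGED ceiling heads. -/
def LineNodeServiceLawFC (h : ℤ) : Prop :=
  ∀ C : MConfig, C.InDiamond h → C.G1Closed → C.StaticH1 → ∀ Z ∈ (lineRestrict h C).lower, FCc Z → LineNodeSettled h C Z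

/-- **(LNS-MX_h)**: line node service at the MIXED ceiling heads (an apex letter `hI` present) — the independent content of (LNS_h). -/
def LineNodeServiceLawMixed (h : ℤ) : Prop :=
  ∀ C : MConfig, C.InDiamond h → C.G1Closed → C.StaticH1 → ∀ Z ∈ (lineRestrict h C).lower, (∃ f, isApex (Z f)) → LineNodeSettled h C Z

/-- (LNS_h) ⟺ (LNS-FC_h) ∧ (LNS-MX_h). -/
theorem lns_iff_fc_mixed (h : ℤ) : LineNodeServiceLaw h ↔ LineNodeServiceLawFC h ∧ LineNodeServiceLawMixed h := by
  constructor
  · exact fun H => ⟨fun C hU hG hS Z hZ _ => H C hU hG hS Z hZ, fun C hU hG hS Z hZ _ => H C hU hG hS Z hZ⟩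
  · rintro ⟨hF, hM⟩ C hU hG hS Z hZ
    rcases fcc_or_exists_apex Z with hFC | hap
    · exact hF C hU hG hS Z hZ hFC
    · exact hM C hU hG hS Z hZ hap

/-- **(LV_h) ∧ (AD_h) ⇒ (LNS-FC_h)** (KERNEL). -/
theorem lnsFC_of_level_apexDrop {h : ℤ} (hLV : LevelLaw h) (hAD : ApexDropLaw h) : LineNodeServiceLawFC h :=
  fun C hU hG hS Z hZ hFC =>
    lineNodeSettled_of_fc hU (mem_lineRestrict_lower.1 hZ).1 (mem_lineRestrict_lower.1 hZ).2 hFC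
      (hS.1.1 Z (mem_lineRestrict_lower.1 hZ).1) (fun P hP hP' => hLV C hU hG hS P (Finset.mem_union_right _ hP) hP') (hAD C hU hG hS)

/-- **(LV_h) ∧ (AD_h) ∧ (LNS-MX_h) ⇒ (LNS_h) = (CP_h)** (KERNEL). -/
theorem lns_of_level_apexDrop_mixed {h : ℤ} (hLV : LevelLaw h) (hAD : ApexDropLaw h) (hM : LineNodeServiceLawMixed h) :
    LineNodeServiceLaw h :=
  (lns_iff_fc_mixed h).2 ⟨lnsFC_of_level_apexDrop hLV hAD, hM⟩

/-- **(T₈) ⇐ FD₈ ∧ LV₈ ∧ AD₈ ∧ LNS-MX₈ ∧ OL₈** (KERNEL). -/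
theorem seedB1Odd_eight_of_laws (hFD : FloorDepthLaw 8) (hLV : LevelLaw 8) (hAD : ApexDropLaw 8) (hM : LineNodeServiceLawMixed 8)
    (hOL : OddLineFree 8) : SeedB1OddDiamondG1H1 8 :=
  seedB1Odd_eight_of_lns' hFD (lns_of_level_apexDrop_mixed hLV hAD hM) hOL

/-- **LEVEL ∧ NEST ∧ APEX-DROP ∧ MIXED LINE NODE SERVICE ∧ odd-line-freeness ⇒ (T_h)** (KERNEL master reduction, v1.3 form). -/
theorem seedB1Odd_of_laws {h : ℤ} (hLV : LevelLaw h) (hN : NestLaw h) (hAD : ∀ h' ≤ h, ApexDropLaw h')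
    (hM : ∀ h' ≤ h, LineNodeServiceLawMixed h') (hOL : ∀ h' ≤ h, OddLineFree h') : SeedB1OddDiamondG1H1 h :=
  seedB1Odd_of_level_nest_lns hLV hN (fun h' hh => lns_of_level_apexDrop_mixed (levelLaw_antitone hh hLV) (hAD h' hh) (hM h' hh)) hOL

/-- **the odd threshold, v1.3 form**. -/
theorem oddThreshold_iff_laws (hL : LevelLaw 11) (hN : NestLaw 11) (hAD : ∀ h' ≤ (11 : ℤ), ApexDropLaw h')
    (hM : ∀ h' ≤ (11 : ℤ), LineNodeServiceLawMixed h') (hOL : ∀ h' < (12 : ℤ), OddLineFree h') (h : ℤ) :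
    SeedB1OddDiamondG1H1 h ↔ h < 12 :=
  oddThreshold_iff_lns hL hN (fun h' hh => lns_of_level_apexDrop_mixed (levelLaw_antitone hh hL) (hAD h' hh) (hM h' hh)) hOL h

/-! ## §15 UP-LINE SERVICE at ceiling `P`-cells is a THEOREM of RULE D -/

/-- **no μ₄ point of ◇_h lies strictly above a ceiling letter off its node ray**. -/
theorem not_inDiamond_above_offnode {h : ℤ} {x y : BPoint} {m r : Fin 4} {e : ℤ} (hx : OnCeiling h x) (hxax : x.2 = (0, 0) ∨ AxisPt x)
    (hm : Adapted x m) (hmh : coord x m = h) (hr : r ≠ m + 2) (he : 0 < e) (hxy : y = ray x r e)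
    (hyax : y.2 = (0, 0) ∨ AxisPt y) (hyh : y.1 + absCharge y ≤ h) : False := by
  obtain ⟨α, a, b⟩ := x
  subst hxy
  simp only [OnCeiling, absCharge, chargeOf, coord, AxisPt, Adapted, Prod.mk.injEq] at *
  fin_cases m <;> fin_cases r <;> simp at hx hxax hm hmh hr hyax hyh <;>
    (simp only [abs_eq_max_neg, max_def] at *; split_ifs at * <;> omega)

/-- from a CHARGED μ₄ letter adapted to the frame `{k, k+2}`, a null step of positive length lands on a μ₄ point only in the directions `k`, `k + 2`. -/
theorem ray_dir_of_adapted {x y : BPoint} {k r : Fin 4} {e : ℤ} (hxax : x.2 = (0, 0) ∨ AxisPt x) (hna : ¬ isApex x) (hk : Adapted x k)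
    (he : 0 < e) (hxy : y = ray x r e) (hyax : y.2 = (0, 0) ∨ AxisPt y) : r = k ∨ r = k + 2 := by
  obtain ⟨α, a, b⟩ := x
  subst hxy
  simp only [isApex, AxisPt, Adapted, Prod.mk.injEq] at *
  fin_cases k <;> fin_cases r <;> simp at hxax hna hk hyax ⊢ <;> omega

/-- **UP-LINE SERVICE** (KERNEL). -/
theorem upLine_of_ruleDMu4P {h : ℤ} {C : MConfig} (hU : C.InDiamond h) {P : MCell} (hP : P ∈ C.upper) (hD : RuleDMu4P C P) {g j : Fin 4}
    (hgj : g ≠ j) (hgc : OnCeiling h (P g)) (hj : ¬ isApex (P j)) {k : Fin 4} (hk : Adapted (P j) k)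
    (hkh : coord (P j) k ≠ h) : MServedAbove C P j k := by
  obtain ⟨m, hm, hmh⟩ := exists_top_dir hgc (hU.2 P hP g).1
  have hne : coord (P g) m ≠ coord (P j) k := by rw [hmh]; exact Ne.symm hkh
  have above : ∀ N ∈ C.lower, ∀ a : Fin 4, a ≠ m + 2 → (P g).1 < (N g).1 → N g = ray (P g) a ((N g).1 - (P g).1) → False :=
    fun N hN a ha hlt hray =>
      not_inDiamond_above_offnode hgc (hU.2 P hP g).1 hm hmh ha (by omega) hray (hU.1 N hN g).1 (hU.1 N hN g).2.2.2
  rcases hD g j hgj m k hm hk hne with ⟨r, hr, N, hN, hNP⟩ | ⟨r, hr, N, hN, hNP⟩ | ⟨a, b, ha, _, N, hN, _, hg1, hg2, _, _⟩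
  · exact (above N hN r hr hNP.2.1 hNP.2.2).elim
  · rcases ray_dir_of_adapted (hU.2 P hP j).1 hj hk (by have := hNP.2.1; omega) hNP.2.2 (hU.1 N hN j).1 with rfl | rfl
    · exact ⟨N, hN, hNP⟩
    · exact (hr rfl).elim
  · have ha' : a ≠ m + 2 := by
      rcases ha with e | ⟨_, hne2⟩
      · rw [e]; exact fin4_ne_add_two m
      · exact hne2
    exact (above N hN a ha' hg1 hg2).elim

/-- at a CEILING `P`-cell the up-line server is itself a ceiling cell: up-line service happens INSIDE `lineRestrict h C` (KERNEL). -/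
theorem upLine_lineRestrict {h : ℤ} {C : MConfig} (hU : C.InDiamond h) {P : MCell} (hP : P ∈ C.upper) (hPc : ∀ f, OnCeiling h (P f))
    (hD : RuleDMu4P C P) {g j : Fin 4} (hgj : g ≠ j) (hj : ¬ isApex (P j)) {k : Fin 4} (hk : Adapted (P j) k) (hkh : coord (P j) k ≠ h) :
    MServedAbove (lineRestrict h C) P j k := by
  obtain ⟨N, hN, hNP⟩ := upLine_of_ruleDMu4P hU hP hD hgj (hPc g) hj hk hkh
  exact ⟨N, mem_lineRestrict_lower.2 ⟨hN, onCeiling_of_uPartner_above hPc (hU.1 N hN) hNP⟩, hNP⟩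

/-- **(UL_h) UP-LINE LAW**: in a static design in ◇_h every charged letter of a ceiling `P`-cell is served UP the line (inside the ceiling restriction). -/
def UpLineLaw (h : ℤ) : Prop :=
  ∀ C : MConfig, C.InDiamond h → C.G1Closed → C.StaticH1 → ∀ P ∈ (lineRestrict h C).upper,
    ∀ g j : Fin 4, g ≠ j → ¬ isApex (P j) → ∀ k : Fin 4, Adapted (P j) k → coord (P j) k ≠ h → MServedAbove (lineRestrict h C) P j k

/-- **(UL_h) is a THEOREM** (of RULE D at `P`-cells alone; KERNEL, every `h`). -/
theorem upLineLaw_holds (h : ℤ) : UpLineLaw h := fun _ hU _ hS P hP _ _ hgj hj _ hk hkh =>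
  upLine_lineRestrict hU (mem_lineRestrict_upper.1 hP).1 (mem_lineRestrict_upper.1 hP).2 (hS.1.2 P (mem_lineRestrict_upper.1 hP).1) hgj hj hk hkh

/-- **(DL_h) DOWN-LINE LAW** (mirror of (UL_h); a THEOREM of (CD_h) ∧ (LVN_h) ∧ (LVP3_h) for `h ≤ 10`, §22; CONJECTURE-free there modulo those three;
machine-FALSE at `h = 12`: 16 ∕ 466 band-4 SAT supports of j329409 violate it while (CD), (LVN), (LVP3) hold — `ALPHA-D12-BAND4-g11.md`; `DLFORCE-d8-d12`'s d = 12 row is band 2). -/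
def DownLineLaw (h : ℤ) : Prop :=
  ∀ C : MConfig, C.InDiamond h → C.G1Closed → C.StaticH1 → ∀ Z ∈ (lineRestrict h C).lower,
    ∀ j : Fin 4, ¬ isApex (Z j) → ∀ k : Fin 4, Adapted (Z j) k → coord (Z j) k ≠ h → MServedBelow (lineRestrict h C) Z j k

/-- **(DL_h) ⇒ (LNS_h)** (KERNEL; (LNS_h) is (DL_h) restricted to heads with two charged letters and weakened to `SettledBelow`). -/
theorem lns_of_downLine {h : ℤ} (H : DownLineLaw h) : LineNodeServiceLaw h := fun C hU hG hS Z hZ _ j _ _ hj k hk hkh =>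
  ⟨k, fin4_ne_add_two k, H C hU hG hS Z hZ j hj k hk hkh⟩

/-- **(DL_h) ⇒ (CP_h)** (KERNEL). -/
theorem ceilingProjectionLaw_of_downLine {h : ℤ} (H : DownLineLaw h) : CeilingProjectionLaw h :=
  (ceilingProjectionLaw_iff_lns h).2 (lns_of_downLine H)

/-- **(T₈) ⇐ FD₈ ∧ DL₈ ∧ OL₈** (KERNEL). -/
theorem seedB1Odd_eight_of_downLine (hFD : FloorDepthLaw 8) (hDL : DownLineLaw 8) (hOL : OddLineFree 8) : SeedB1OddDiamondG1H1 8 :=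
  seedB1Odd_eight_of_lns' hFD (lns_of_downLine hDL) hOL

/-- **LEVEL ∧ NEST ∧ DOWN-LINE ∧ odd-line-freeness ⇒ (T_h)** (KERNEL master reduction, two-way-line-service form). -/
theorem seedB1Odd_of_level_nest_downLine {h : ℤ} (hLV : LevelLaw h) (hN : NestLaw h) (hDL : ∀ h' ≤ h, DownLineLaw h')
    (hOL : ∀ h' ≤ h, OddLineFree h') : SeedB1OddDiamondG1H1 h :=
  seedB1Odd_of_level_nest_lns hLV hN (fun h' hh => lns_of_downLine (hDL h' hh)) hOL

/-- **the odd threshold, down-line form**: `SeedB1OddDiamondG1H1 h ↔ h < 12` under LV₁₁ ∧ NS₁₁ ∧ DL_{≤11} (kernel LINE theorem displayed). -/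
theorem oddThreshold_iff_downLine (hL : LevelLaw 11) (hN : NestLaw 11) (hDL : ∀ h' ≤ (11 : ℤ), DownLineLaw h')
    (hOL : ∀ h' < (12 : ℤ), OddLineFree h') (h : ℤ) : SeedB1OddDiamondG1H1 h ↔ h < 12 :=
  oddThreshold_iff_lns hL hN (fun h' hh => lns_of_downLine (hDL h' hh)) hOL h


/-! ## §16 The floor engine on the ceiling -/

/-- the adapted coordinates of a μ₄ letter are its causal top `α + |c|` and its node `α − |c|`. -/
theorem coord_adapted_cases {x : BPoint} (hxax : x.2 = (0, 0) ∨ AxisPt x) {k : Fin 4} (hk : Adapted x k) :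
    coord x k = x.1 + absCharge x ∨ coord x k = x.1 - absCharge x := by
  obtain ⟨α, a, b⟩ := x
  simp only [absCharge, chargeOf, coord, AxisPt, Adapted, Prod.mk.injEq] at *
  fin_cases k <;> simp at hxax hk ⊢ <;> (simp only [abs_eq_max_neg, max_def] at *; split_ifs at * <;> omega)

/-- every μ₄ letter has a NODE direction: an adapted coordinate of value `α − |c|`. -/
theorem exists_node_dir {x : BPoint} (hxax : x.2 = (0, 0) ∨ AxisPt x) : ∃ m : Fin 4, Adapted x m ∧ coord x m = x.1 - absCharge x := by
  obtain ⟨α, a, b⟩ := x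
  simp only [absCharge, chargeOf, AxisPt, Prod.mk.injEq] at hxax ⊢
  by_cases hb : b = 0
  · subst hb
    by_cases ha : 0 ≤ a
    · exact ⟨2, by simp [Adapted], by simp [coord, abs_of_nonneg ha]; omega⟩
    · exact ⟨0, by simp [Adapted], by simp [coord, abs_of_neg (not_le.1 ha)]⟩
  · have ha : a = 0 := by omega
    subst ha
    by_cases hb' : 0 ≤ b
    · exact ⟨1, by simp [Adapted], by simp [coord, abs_of_nonneg hb']; omega⟩
    · exact ⟨3, by simp [Adapted], by simp [coord, abs_of_neg (not_le.1 hb')]⟩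

/-- a charged μ₄ letter has positive charge `|c| ≥ 1`. -/
theorem absCharge_pos_of_not_isApex {x : BPoint} (hxax : x.2 = (0, 0) ∨ AxisPt x) (hna : ¬ isApex x) : 0 < absCharge x := by
  obtain ⟨α, a, b⟩ := x
  simp only [absCharge, chargeOf, isApex, AxisPt, Prod.mk.injEq] at *
  rcases hxax with ⟨ha, hb⟩ | ⟨ha, hb⟩ | ⟨ha, hb⟩
  · exact (hna ⟨ha, hb⟩).elim
  · rw [hb, sub_zero]; exact abs_pos.2 ha
  · rw [ha, zero_sub, abs_neg]; exact abs_pos.2 hb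

/-- **no room below the floor off the top ray**. -/
theorem not_inDiamond_below_offtop {x y : BPoint} {m r : Fin 4} {e : ℤ} (hx : OnFloor x) (hxax : x.2 = (0, 0) ∨ AxisPt x)
    (hm : Adapted x m) (hm0 : coord x m = 0) (hr : r ≠ m + 2) (he : 0 < e) (hxy : x = ray y r e)
    (hyax : y.2 = (0, 0) ∨ AxisPt y) (hy : absCharge y ≤ y.1) : False := by
  obtain ⟨α, a, b⟩ := y
  subst hxy
  simp only [OnFloor, absCharge, chargeOf, coord, AxisPt, Adapted, Prod.mk.injEq] at *
  fin_cases m <;> fin_cases r <;> simp at hx hxax hm hm0 hr hyax hy <;>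
    (simp only [abs_eq_max_neg, max_def] at *; split_ifs at * <;> omega)

/-- from a CHARGED μ₄ letter adapted to `{k, k+2}`, a null step DOWN of positive length to a μ₄ point runs in direction `k` or `k + …. -/
theorem ray_dir_of_adapted_down {x y : BPoint} {k r : Fin 4} {d : ℤ} (hxax : x.2 = (0, 0) ∨ AxisPt x) (hna : ¬ isApex x) (hk : Adapted x k)
    (hd : 0 < d) (hxy : x = ray y r d) (hyax : y.2 = (0, 0) ∨ AxisPt y) : r = k ∨ r = k + 2 := by
  obtain ⟨α, a, b⟩ := y
  subst hxy
  simp only [isApex, AxisPt, Adapted, Prod.mk.injEq] at *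
  fin_cases k <;> fin_cases r <;> simp at hxax hna hk hyax ⊢ <;> omega

/-- **SERVICE BELOW FORCED BY A FLOOR LETTER** (KERNEL, every `h`; the tree's floor engine in served form, mirror of `upLine_of_ruleDMu4P`). -/
theorem servedBelow_of_floorLetter {h : ℤ} {C : MConfig} (hU : C.InDiamond h) {Z : MCell} (hZ : Z ∈ C.lower) (hD : RuleDMu4N C Z) {i g : Fin 4}
    (hig : i ≠ g) (hi : OnFloor (Z i)) (hg : ¬ isApex (Z g)) {k : Fin 4} (hk : Adapted (Z g) k) (hk0 : coord (Z g) k ≠ 0) :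
    MServedBelow C Z g k := by
  obtain ⟨m, hm, hm0⟩ := exists_node_dir (hU.1 Z hZ i).1
  have hm0' : coord (Z i) m = 0 := by rw [hm0, hi, sub_self]
  have hne : coord (Z i) m ≠ coord (Z g) k := by rw [hm0']; exact Ne.symm hk0
  have below : ∀ P ∈ C.upper, ∀ a : Fin 4, a ≠ m + 2 → (P i).1 < (Z i).1 → Z i = ray (P i) a ((Z i).1 - (P i).1) → False :=
    fun P hP a ha hlt hray =>
      not_inDiamond_below_offtop hi (hU.1 Z hZ i).1 hm hm0' ha (by omega) hray (hU.2 P hP i).1 (hU.2 P hP i).2.1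
  rcases hD i g hig m k hm hk hne with ⟨r, hr, P, hP, hZP⟩ | ⟨r, hr, P, hP, hZP⟩ | ⟨a, b, ha, _, P, hP, _, hi1, hi2, _, _⟩
  · exact (below P hP r hr hZP.2.1 hZP.2.2).elim
  · rcases ray_dir_of_adapted_down (hU.1 Z hZ g).1 hg hk (by have := hZP.2.1; omega) hZP.2.2 (hU.2 P hP g).1 with rfl | rfl
    · exact ⟨P, hP, hZP⟩
    · exact (hr rfl).elim
  · have ha' : a ≠ m + 2 := by
      rcases ha with e | ⟨_, hne2⟩
      · rw [e]; exact fin4_ne_add_two m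
      · exact hne2
    exact (below P hP a ha' hi1 hi2).elim

/-- **DOWN-LINE SERVICE AT A HEAD WITH A PURE LETTER** (KERNEL, every `h`). -/
theorem downLine_of_pureLetter {h : ℤ} {C : MConfig} (hU : C.InDiamond h) {Z : MCell} (hZ : Z ∈ C.lower) (hZc : ∀ f, OnCeiling h (Z f))
    (hD : RuleDMu4N C Z) {i g : Fin 4} (hig : i ≠ g) (hi : OnFloor (Z i)) (hg : ¬ isApex (Z g)) (hgf : ¬ OnFloor (Z g)) {k : Fin 4}
    (hk : Adapted (Z g) k) (hkh : coord (Z g) k ≠ h) : MServedBelow (lineRestrict h C) Z g k := by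
  have hk0 : coord (Z g) k ≠ 0 := by
    have htop : (Z g).1 + absCharge (Z g) = h := hZc g
    rcases coord_adapted_cases (hU.1 Z hZ g).1 hk with e | e
    · exact absurd (e.trans htop) hkh
    · intro h0; apply hgf; show (Z g).1 = absCharge (Z g); omega
  obtain ⟨P, hP, hZP⟩ := servedBelow_of_floorLetter hU hZ hD hig hi hg hk hk0
  refine ⟨P, mem_lineRestrict_upper.2 ⟨hP, fun f => ?_⟩, hZP⟩
  by_cases hf : f = g
  · rw [hf]
    exact onCeiling_of_ray_down k (by have := hZP.2.1; omega) hZP.2.2 (hZc g) (hU.1 Z hZ g).1 (hU.2 P hP g).1 (Or.inr hkh)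
  · rw [hZP.1 f hf]; exact hZc f

/-- **THE EXCLUSION HIDDEN IN (DL_h)** (KERNEL). -/
theorem no_pureLetter_of_downLine {h : ℤ} (H : DownLineLaw h) {C : MConfig} (hU : C.InDiamond h) (hG : C.G1Closed) (hS : C.StaticH1)
    {Z : MCell} (hZ : Z ∈ (lineRestrict h C).lower) {j : Fin 4} (hj : ¬ isApex (Z j)) : ¬ OnFloor (Z j) := by
  intro hfl
  obtain ⟨hZC, hZc⟩ := mem_lineRestrict_lower.1 hZ
  obtain ⟨m, hm, hm0⟩ := exists_node_dir (hU.1 Z hZC j).1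
  have hm0' : coord (Z j) m = 0 := by rw [hm0, hfl, sub_self]
  have hc : 0 < absCharge (Z j) := absCharge_pos_of_not_isApex (hU.1 Z hZC j).1 hj
  have htop : (Z j).1 + absCharge (Z j) = h := hZc j
  have hfl' : (Z j).1 = absCharge (Z j) := hfl
  have hh : coord (Z j) m ≠ h := by rw [hm0']; omega
  obtain ⟨P, hP, hZP⟩ := H C hU hG hS Z hZ j hj m hm hh
  have hPC := (mem_lineRestrict_upper.1 hP).1
  exact not_inDiamond_below_offtop hfl (hU.1 Z hZC j).1 hm hm0' (fin4_ne_add_two m) (by have := hZP.2.1; omega) hZP.2.2 (hU.2 P hPC j).1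
    (hU.2 P hPC j).2.1

/-- hence under (DL_h) every charged letter of a ceiling `N`-cell has node level `t ≥ 2` (`t = α − |c|` is even in ◇_h and non-zero). -/
theorem two_le_nodeLevel_of_downLine {h : ℤ} (H : DownLineLaw h) {C : MConfig} (hU : C.InDiamond h) (hG : C.G1Closed) (hS : C.StaticH1)
    {Z : MCell} (hZ : Z ∈ (lineRestrict h C).lower) {j : Fin 4} (hj : ¬ isApex (Z j)) : 2 ≤ nodeLevel (Z j) := by
  have hnf := no_pureLetter_of_downLine H hU hG hS hZ hj
  have hD := hU.1 Z (mem_lineRestrict_lower.1 hZ).1 j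
  have h1 : absCharge (Z j) ≤ (Z j).1 := hD.2.1
  have h2 : ((Z j).1 - absCharge (Z j)) % 2 = 0 := hD.2.2.1
  have h3 : (Z j).1 ≠ absCharge (Z j) := hnf
  show 2 ≤ (Z j).1 - absCharge (Z j)
  omega



/-! ## §17 (v1.5) THE CHARGE-DEPTH LAW and the PARTIAL LEVEL LAWS -/

/-- the number of CHARGED (non-apex) letters of a cell. -/
def chargeCount (Z : MCell) : ℕ := (Finset.univ.filter (fun f : Fin 4 => (Z f).2 ≠ (0, 0))).card

theorem chargeCount_le_four (Z : MCell) : chargeCount Z ≤ 4 :=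
  (Finset.card_filter_le _ _).trans (by simp)

theorem chargeCount_of_fcc {Z : MCell} (hZ : FCc Z) : chargeCount Z = 4 := by
  unfold chargeCount
  rw [Finset.filter_true_of_mem (fun f _ => hZ f)]; simp

theorem one_le_chargeCount {Z : MCell} {f : Fin 4} (hf : (Z f).2 ≠ (0, 0)) : 1 ≤ chargeCount Z :=
  Finset.card_pos.mpr ⟨f, by simp [hf]⟩

/-- a non-apex letter is a charged letter in the sense of `chargeCount`. -/
theorem snd_ne_of_not_isApex {x : BPoint} (hx : ¬ isApex x) : x.2 ≠ (0, 0) := by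
  intro h0; apply hx
  simp only [isApex]
  exact ⟨by rw [h0], by rw [h0]⟩

theorem not_isApex_of_snd_ne {x : BPoint} (hx : x.2 ≠ (0, 0)) : ¬ isApex x := by
  rintro ⟨h1, h2⟩; apply hx; exact Prod.ext h1 h2

/-- the CHARGE-DEPTH inequalities of ONE configuration: a charged letter of a level `n`-charged `P`-cell has node level `≥ 2n − 2`, of an `N`-cell `≥ 2n`. -/
def CDIneq (C : MConfig) : Prop :=
  (∀ P ∈ C.upper, LevelCell P → ∀ f, (P f).2 ≠ (0, 0) → 2 * (chargeCount P : ℤ) - 2 ≤ nodeLevel (P f)) ∧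
    (∀ Z ∈ C.lower, LevelCell Z → ∀ f, (Z f).2 ≠ (0, 0) → 2 * (chargeCount Z : ℤ) ≤ nodeLevel (Z f))

/-- **(CD_h) THE CHARGE-DEPTH LAW** (CONJECTURE, h-uniform and line-uniform; UP-fact at 8, 10, 12|band 2; census 12|band 4: 466 ∕ 466; sharp at every (kind, n, line) observed). -/
def ChargeDepthLaw (h : ℤ) : Prop := ∀ C : MConfig, C.InDiamond h → C.G1Closed → C.StaticH1 → CDIneq C

/-- **(LVN_h) PARTIAL LEVEL LAW, `N` side** (CONJECTURE; UP-fact at 8, 10; census 12|band 4: 466 ∕ 466): an `N`-cell with at least two charged letters is level. -/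
def LevelNLaw (h : ℤ) : Prop :=
  ∀ C : MConfig, C.InDiamond h → C.G1Closed → C.StaticH1 → ∀ Z ∈ C.lower, 2 ≤ chargeCount Z → LevelCell Z

/-- **(LVP3_h) PARTIAL LEVEL LAW, `P` side** (CONJECTURE; UP-fact at 8, 10; census 12|band 4: 466 ∕ 466; sharp: 2-charged non-level `P`-cells are realisable at 10). -/
def LevelP3Law (h : ℤ) : Prop :=
  ∀ C : MConfig, C.InDiamond h → C.G1Closed → C.StaticH1 → ∀ P ∈ C.upper, 3 ≤ chargeCount P → LevelCell P

/-- (LVN) ∧ (LVP3) ⇒ (LV) (KERNEL). -/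
theorem levelLaw_of_partial {h : ℤ} (hN : LevelNLaw h) (hP : LevelP3Law h) : LevelLaw h := by
  intro C hU hG hS Z hZ hFC
  rcases Finset.mem_union.mp hZ with hl | hu
  · exact hN C hU hG hS Z hl (by rw [chargeCount_of_fcc hFC]; norm_num)
  · exact hP C hU hG hS Z hu (by rw [chargeCount_of_fcc hFC]; norm_num)

/-- (LV) ∧ (CD) ⇒ the floor-depth inequalities (KERNEL): `n = 4` of the charge-depth law IS the floor-depth law. -/
theorem fdIneq_of_level_cd {C : MConfig} (hLV : ∀ Z ∈ C.lower ∪ C.upper, FCc Z → LevelCell Z) (hCD : CDIneq C) : FDIneq C := by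
  refine ⟨fun P hP hFC f => ?_, fun Z hZ hFC f => ?_⟩
  · have h1 := hCD.1 P hP (hLV P (Finset.mem_union_right _ hP) hFC) f (hFC f)
    rw [chargeCount_of_fcc hFC] at h1; push_cast at h1; omega
  · have h1 := hCD.2 Z hZ (hLV Z (Finset.mem_union_left _ hZ) hFC) f (hFC f)
    rw [chargeCount_of_fcc hFC] at h1; push_cast at h1; omega

/-- **(LV_h) ∧ (CD_h) ⇒ (FD_h)** (KERNEL). -/
theorem floorDepthLaw_of_level_chargeDepth {h : ℤ} (hLV : LevelLaw h) (hCD : ChargeDepthLaw h) : FloorDepthLaw h :=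
  fun C hU hG hS => fdIneq_of_level_cd (hLV C hU hG hS) (hCD C hU hG hS)

/-- **(LVN_h) ∧ (LVP3_h) ∧ (CD_h) ⇒ (FD_h)** (KERNEL). -/
theorem floorDepthLaw_of_partial_chargeDepth {h : ℤ} (hN : LevelNLaw h) (hP : LevelP3Law h) (hCD : ChargeDepthLaw h) : FloorDepthLaw h :=
  floorDepthLaw_of_level_chargeDepth (levelLaw_of_partial hN hP) hCD

/-- an apex-drop cell has at least three charged letters. -/
theorem three_le_chargeCount_of_apexDrop {h : ℤ} {P : MCell} (hP : ApexDropCell h P) : 3 ≤ chargeCount P := by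
  obtain ⟨g, _, _, hrest⟩ := hP
  unfold chargeCount
  have hsub : Finset.univ.erase g ⊆ Finset.univ.filter (fun f : Fin 4 => (P f).2 ≠ (0, 0)) := by
    intro f hf
    rw [Finset.mem_erase] at hf
    simp only [Finset.mem_filter, Finset.mem_univ, true_and]
    exact snd_ne_of_not_isApex (hrest f hf.1).2
  have hc := Finset.card_le_card hsub
  rw [Finset.card_erase_of_mem (Finset.mem_univ g)] at hc
  simpa using hc

/-- an apex-drop cell is NOT level (its apex lies strictly below the ceiling line of the other three letters). -/
theorem not_levelCell_of_apexDrop {h : ℤ} {P : MCell} (hP : ApexDropCell h P) : ¬ LevelCell P := by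
  obtain ⟨g, _, hgc, hrest⟩ := hP
  intro hlev
  have hf : g + 1 ≠ g := by
    intro he
    have := congrArg (fun x : Fin 4 => x - g) he
    simp at this
  have hc : OnCeiling h (P (g + 1)) := (hrest (g + 1) hf).1
  apply hgc
  show (P g).1 + absCharge (P g) = h
  have e := hlev g (g + 1)
  simp only [causalTop] at e
  have hc' : (P (g + 1)).1 + absCharge (P (g + 1)) = h := hc
  omega

/-- **(LVP3_h) ⇒ (AD_h)** (KERNEL): apex-drop exclusion is a corollary of the partial level law on the `P` side. -/
theorem apexDropLaw_of_levelP3 {h : ℤ} (hP : LevelP3Law h) : ApexDropLaw h :=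
  fun C hU hG hS P hPC hAD => not_levelCell_of_apexDrop hAD (hP C hU hG hS P hPC (three_le_chargeCount_of_apexDrop hAD))

/-- a charged axis letter on the line `h'` has node level `≤ h' − 2`. -/
theorem nodeLevel_le_of_charged {x : BPoint} (hax : x.2 = (0, 0) ∨ AxisPt x) (hne : x.2 ≠ (0, 0)) :
    nodeLevel x ≤ causalTop x - 2 := by
  have h1 := one_le_absCharge hax hne
  rw [causalTop_eq]; omega

/-- **MAX CHARGE NUMBER on a line, `P` side** (KERNEL from (CD)): a level `P`-cell on the line `h'` carries at most `h'∕2` charged letters. -/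
theorem two_chargeCount_le_line_P {h : ℤ} {C : MConfig} (hU : C.InDiamond h) (hCD : CDIneq C) {P : MCell} (hP : P ∈ C.upper)
    (hlev : LevelCell P) {f : Fin 4} (hf : (P f).2 ≠ (0, 0)) : 2 * (chargeCount P : ℤ) ≤ causalTop (P f) := by
  have h1 := hCD.1 P hP hlev f hf
  have h2 := nodeLevel_le_of_charged (hU.2 P hP f).1 hf
  omega

/-- **MAX CHARGE NUMBER on a line, `N` side** (KERNEL from (CD)): a level `N`-cell on the line `h'` carries at most `h'∕2 − 1` charged letters. -/
theorem two_chargeCount_le_line_N {h : ℤ} {C : MConfig} (hU : C.InDiamond h) (hCD : CDIneq C) {Z : MCell} (hZ : Z ∈ C.lower)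
    (hlev : LevelCell Z) {f : Fin 4} (hf : (Z f).2 ≠ (0, 0)) : 2 * (chargeCount Z : ℤ) + 2 ≤ causalTop (Z f) := by
  have h1 := hCD.2 Z hZ hlev f hf
  have h2 := nodeLevel_le_of_charged (hU.1 Z hZ f).1 hf
  omega

/-- **FC cells need room** (KERNEL from (CD)). -/
theorem fc_line_ge {h : ℤ} {C : MConfig} (hU : C.InDiamond h) (hCD : CDIneq C) (hLV : ∀ Z ∈ C.lower ∪ C.upper, FCc Z → LevelCell Z) :
    (∀ P ∈ C.upper, FCc P → ∀ f, 8 ≤ causalTop (P f)) ∧ (∀ Z ∈ C.lower, FCc Z → ∀ f, 10 ≤ causalTop (Z f)) := by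
  refine ⟨fun P hP hFC f => ?_, fun Z hZ hFC f => ?_⟩
  · have h1 := two_chargeCount_le_line_P hU hCD hP (hLV P (Finset.mem_union_right _ hP) hFC) (hFC f)
    rw [chargeCount_of_fcc hFC] at h1; push_cast at h1; omega
  · have h1 := two_chargeCount_le_line_N hU hCD hZ (hLV Z (Finset.mem_union_left _ hZ) hFC) (hFC f)
    rw [chargeCount_of_fcc hFC] at h1; push_cast at h1; omega

/-- **no FC cell below the thresholds** (KERNEL from (CD_h) ∧ (LV_h)): for `h < 8` a static `G₁` design in ◇_h has no FC `P`-cell, for `h < 10` no FC `N`-cell. -/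
theorem no_fc_below {h : ℤ} (hCD : ChargeDepthLaw h) (hLV : LevelLaw h) {C : MConfig} (hU : C.InDiamond h) (hG : C.G1Closed) (hS : C.StaticH1) :
    (h < 8 → ∀ P ∈ C.upper, ¬ FCc P) ∧ (h < 10 → ∀ Z ∈ C.lower, ¬ FCc Z) := by
  obtain ⟨hP, hN⟩ := fc_line_ge hU (hCD C hU hG hS) (hLV C hU hG hS)
  refine ⟨fun h8 P hPC hFC => ?_, fun h10 Z hZ hFC => ?_⟩
  · have := hP P hPC hFC 0
    have := (inDiamond_levels (hU.2 P hPC 0)).2.2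
    omega
  · have := hN Z hZ hFC 0
    have := (inDiamond_levels (hU.1 Z hZ 0)).2.2
    omega

/-- **(CD) ⇒ no pure charged letter in a level `N`-cell** (KERNEL; the exclusion hidden in (DL_h), §16, now from the depth law: `n ≥ 1 ⇒ t ≥ 2 > 0`). -/
theorem not_onFloor_of_cd {C : MConfig} (hCD : CDIneq C) {Z : MCell} (hZ : Z ∈ C.lower) (hlev : LevelCell Z) {f : Fin 4}
    (hf : (Z f).2 ≠ (0, 0)) : ¬ OnFloor (Z f) := by
  have h1 := hCD.2 Z hZ hlev f hf
  have h2 := one_le_chargeCount (Z := Z) hf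
  intro hfl
  have : nodeLevel (Z f) = 0 := by
    have e : (Z f).1 = absCharge (Z f) := hfl
    simp only [nodeLevel]; omega
  omega

/-- **(CD) kills the deep companions and covers** (KERNEL, the DL arena at the deepest single-charged heads). -/
theorem no_shallow_two_charged_of_cd {C : MConfig} (hCD : CDIneq C) :
    (∀ Z ∈ C.lower, LevelCell Z → 2 ≤ chargeCount Z → ∀ f, (Z f).2 ≠ (0, 0) → 4 ≤ nodeLevel (Z f)) ∧
      (∀ P ∈ C.upper, LevelCell P → 2 ≤ chargeCount P → ∀ f, (P f).2 ≠ (0, 0) → ¬ OnFloor (P f)) := by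
  refine ⟨fun Z hZ hlev h2 f hf => ?_, fun P hP hlev h2 f hf hfl => ?_⟩
  · have := hCD.2 Z hZ hlev f hf; omega
  · have h1 := hCD.1 P hP hlev f hf
    have e : (P f).1 = absCharge (P f) := hfl
    simp only [nodeLevel] at h1; omega

/-! ## §18 (v1.6) THE X⁺ SIBLING CLAUSE AT A CEILING APEX, AND -/

theorem fin4_add_two_add_two (r : Fin 4) : r + 2 + 2 = r := by fin_cases r <;> decide

theorem ray_zero (x : BPoint) (k : Fin 4) : ray x k 0 = x := by
  obtain ⟨a, b, c⟩ := x
  simp [ray]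

/-- a point strictly below an apex on a null ray is charged. -/
theorem not_isApex_below_apex {a : ℤ} {y : BPoint} {r : Fin 4} {e : ℤ} (he : 0 < e) (hy : ((a, 0, 0) : BPoint) = ray y r e) :
    ¬ isApex y := by
  obtain ⟨α, b, c⟩ := y
  simp only [ray, isApex, Prod.mk.injEq] at *
  fin_cases r <;> simp at hy ⊢ <;> omega

/-- a point of a null ray through an apex, other than the apex, is charged. -/
theorem not_isApex_between {a : ℤ} {y x : BPoint} {r : Fin 4} {e e₁ : ℤ} (h1 : ((a, 0, 0) : BPoint) = ray y r e₁) (hx : x = ray y r e)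
    (hne : e ≠ e₁) : ¬ isApex x := by
  obtain ⟨α, b, c⟩ := y
  subst hx
  simp only [ray, isApex, Prod.mk.injEq] at *
  fin_cases r <;> simp at h1 ⊢ <;> omega

/-- the part of a null ray below an apex `hI` lies on the ceiling line `h`. -/
theorem onCeiling_between {h : ℤ} {y x : BPoint} {r : Fin 4} {e e₁ : ℤ} (h1 : ((h, 0, 0) : BPoint) = ray y r e₁) (hx : x = ray y r e)
    (hle : e ≤ e₁) : OnCeiling h x := by
  obtain ⟨α, b, c⟩ := y
  subst hx
  simp only [ray, OnCeiling, absCharge, chargeOf, Prod.mk.injEq] at *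
  fin_cases r <;> simp at h1 ⊢ <;> (simp only [abs_eq_max_neg, max_def]; split_ifs <;> omega)

/-- letters of ◇_h lie causally below the ceiling apex `hI`. -/
theorem effective_ceilingApex_sub {h : ℤ} {y : BPoint} (hy : InDiamond h y) : Effective (bsub (h, 0, 0) y) := by
  obtain ⟨α, a, b⟩ := y
  obtain ⟨hax, h1, _, h3⟩ := hy
  simp only [AxisPt, absCharge, chargeOf, Effective] at *
  have key : ∀ z w : ℤ, |z| ≤ w → (0 - z) ^ 2 + (0 - 0) ^ 2 ≤ w ^ 2 ∧ (0 - 0) ^ 2 + (0 - z) ^ 2 ≤ w ^ 2 := fun z w hzw => by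
    have h0 : 0 ≤ |z| := abs_nonneg z
    have e : (0 - z) ^ 2 = |z| ^ 2 := by rw [sq_abs z]; ring
    have hp : |z| ^ 2 ≤ w ^ 2 := pow_le_pow_left₀ h0 hzw 2
    constructor <;> nlinarith
  rcases hax with h0 | ⟨_, hb⟩ | ⟨ha, _⟩
  · simp only [Prod.mk.injEq] at h0
    obtain ⟨rfl, rfl⟩ := h0
    simp only [sub_zero, abs_zero] at *
    exact ⟨by omega, by nlinarith⟩
  · subst hb
    simp only [sub_zero] at *
    exact ⟨by have := abs_nonneg a; omega, (key a (h - α) (by omega)).1⟩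
  · subst ha
    simp only [zero_sub, abs_neg] at *
    exact ⟨by have := abs_nonneg b; omega, (key b (h - α) (by omega)).2⟩

theorem fst_le_of_inDiamond {h : ℤ} {y : BPoint} (hy : InDiamond h y) : y.1 ≤ h := by
  have h3 := hy.2.2.2
  have h0 : 0 ≤ absCharge y := abs_nonneg _
  omega

/-- in ◇_h every frame coordinate is non-negative (it is at least the node level `α − |c| ≥ 0`). -/
theorem coord_nonneg_of_inDiamond {h : ℤ} {y : BPoint} (hy : InDiamond h y) (k : Fin 4) : 0 ≤ coord y k := by
  obtain ⟨α, a, b⟩ := y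
  obtain ⟨hax, h1, _, _⟩ := hy
  simp only [AxisPt, absCharge, chargeOf, coord, Prod.mk.injEq] at *
  rcases hax with ⟨ha, hb⟩ | ⟨_, hb⟩ | ⟨ha, _⟩ <;> fin_cases k <;> simp <;>
    (simp only [abs_eq_max_neg, max_def] at h1; split_ifs at h1 <;> omega)

/-- in ◇_h a letter with a frame coordinate `0` is a FLOOR letter (`α = |c|`). -/
theorem onFloor_of_coord_zero {h : ℤ} {y : BPoint} (hy : InDiamond h y) {k : Fin 4} (hk : coord y k = 0) : OnFloor y := by
  obtain ⟨α, a, b⟩ := y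
  obtain ⟨hax, h1, _, _⟩ := hy
  simp only [AxisPt, absCharge, chargeOf, coord, OnFloor, Prod.mk.injEq] at *
  rcases hax with ⟨ha, hb⟩ | ⟨_, hb⟩ | ⟨ha, _⟩ <;> fin_cases k <;> simp at hk ⊢ <;>
    (simp only [abs_eq_max_neg, max_def] at h1 ⊢; split_ifs at h1 ⊢ <;> omega)

/-- two distinct charged slots give `chargeCount ≥ 2`. -/
theorem two_le_chargeCount {Z : MCell} {σ τ : Fin 4} (hστ : σ ≠ τ) (hσ : (Z σ).2 ≠ (0, 0)) (hτ : (Z τ).2 ≠ (0, 0)) :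
    2 ≤ chargeCount Z := by
  unfold chargeCount
  calc 2 = ({σ, τ} : Finset (Fin 4)).card := (Finset.card_pair hστ).symm
    _ ≤ _ := Finset.card_le_card (by
      intro f hf
      simp only [Finset.mem_insert, Finset.mem_singleton] at hf
      rcases hf with rfl | rfl <;> simp [hσ, hτ])

/-- a cell all of whose letters lie on the ceiling `h` is a level cell. -/
theorem levelCell_of_onCeiling {h : ℤ} {Z : MCell} (hZ : ∀ f, OnCeiling h (Z f)) : LevelCell Z := fun f g => by
  show (Z f).1 + absCharge (Z f) = (Z g).1 + absCharge (Z g)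
  rw [show (Z f).1 + absCharge (Z f) = h from hZ f, show (Z g).1 + absCharge (Z g) = h from hZ g]

theorem onCeiling_apex (h : ℤ) : OnCeiling h ((h, 0, 0) : BPoint) := by
  show h + absCharge ((h, 0, 0) : BPoint) = h
  simp [absCharge, chargeOf]

/-- **THE X⁺ SIBLING CLAUSE AT A CEILING APEX — GENERAL HEAD** (KERNEL, every `h`; v1.8). -/
theorem xplus_two_children_gen {h : ℤ} {C : MConfig} (hU : C.InDiamond h) (hX : XPlusClosed C) {Z : MCell} (hZ : Z ∈ C.lower)
    {g f : Fin 4} (hfg : f ≠ g) (hg : Z g = (h, 0, 0)) (hf : Z f = (h, 0, 0)) {P₁ P₂ : MCell}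
    (hP₁ : P₁ ∈ C.upper) (hP₂ : P₂ ∈ C.upper) {r₁ r₂ : Fin 4} (hr : r₂ ≠ r₁) (h1 : UPartner Z P₁ g r₁) (h2 : UPartner Z P₂ g r₂)
    (hNT : ∀ X ∈ C.lower, MAgree X Z g → ¬ isApex (X g) → OnCeiling h (X g) → False) : False := by
  have hZg1 : (Z g).1 = h := by rw [hg]
  have h1lt : (P₁ g).1 < h := by have := h1.2.1; omega
  have h1ray : ((h, 0, 0) : BPoint) = ray (P₁ g) r₁ (h - (P₁ g).1) := by have := h1.2.2; rw [hg] at this; exact this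
  refine hX (dualCell 0 P₁) (dualCell_mem_dual_lower hP₁) (dualCell 0 Z) (dualCell_mem_dual_upper hZ) (dualCell 0 P₂)
    (dualCell_mem_dual_lower hP₂) g r₁ r₂ f ⟨?_, hfg, (uPartner_dual 0 Z P₁ g r₁).mpr h1, ?_, hr, ?_, ?_, ?_, ?_, ?_⟩
  · -- `(P₁ g)^∨` is charged: `P₁ g` is a child of the apex `hI`
    exact fun hap => not_isApex_below_apex (by omega) h1ray ((isApex_dual 0 (P₁ g)).mp hap)
  · -- topmost partner: no `N`-twin strictly between `P₁ g` and `hI` on the `r₁`-ray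
    intro P hP hPu
    obtain ⟨X, hXl, rfl⟩ := Finset.mem_image.mp hP
    have hu : UPartner X P₁ g r₁ := (uPartner_dual 0 X P₁ g r₁).mp hPu
    show 0 - (X g).1 ≤ 0 - (Z g).1
    by_contra hlt
    have hXg : (X g).1 < h := by omega
    have hagZ : MAgree X Z g := fun j hj => (hu.1 j hj).symm.trans (h1.1 j hj)
    exact hNT X hXl hagZ (not_isApex_between h1ray hu.2.2 (by omega)) (onCeiling_between h1ray hu.2.2 (by omega))
  · -- `P₂^∨` is an `r₂`-sibling of `Z^∨`
    exact ⟨magree_dual.mpr (fun j hj => (h2.1 j hj).symm), (ray_dual_iff 0 (Z g) (P₂ g) r₂).mpr ⟨h2.2.1, h2.2.2⟩⟩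
  · -- no companion: an `N`-twin strictly between `P₂ g` and `hI` on the `r₂`-ray is absent
    intro P hP hag hlt1 _ hray
    obtain ⟨X, hXl, rfl⟩ := Finset.mem_image.mp hP
    have hag' : MAgree Z X g := magree_dual.mp hag
    obtain ⟨hlt, hZX⟩ := (ray_dual_iff 0 (Z g) (X g) r₂).mp ⟨hlt1, hray⟩
    rw [hg] at hZX
    have hagZ : MAgree X Z g := fun j hj => (hag' j hj).symm
    exact hNT X hXl hagZ (not_isApex_below_apex (by show (0 : ℤ) < h - (X g).1; omega) hZX)
      (onCeiling_between hZX (ray_zero (X g) r₂).symm (by show (0 : ℤ) ≤ h - (X g).1; omega))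
  · -- `HeOkP⁺`: every letter of ◇_h lies causally below `hI`
    intro P hP _ _ _ _
    obtain ⟨X, hXl, rfl⟩ := Finset.mem_image.mp hP
    show Effective (bsub (dualPt 0 (X g)) (dualPt 0 (Z g)))
    rw [bsub_dualPt0, hg]
    exact effective_ceilingApex_sub (hU.1 X hXl g)
  · -- `HbOkP⁺`: vacuous
    intro P hP _ hnb _
    obtain ⟨X, hXl, rfl⟩ := Finset.mem_image.mp hP
    exfalso
    have e1 : (P₁ f).1 = h := by rw [(h1.1 f hfg).trans hf]
    have := hnb.1
    change 0 - (X f).1 < 0 - (P₁ f).1 at this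
    have hle := fst_le_of_inDiamond (hU.1 X hXl f)
    omega
  · -- `WfEmpty⁺`: vacuous
    intro P hP hnb
    obtain ⟨X, hXl, rfl⟩ := Finset.mem_image.mp hP
    exfalso
    have e1 : (P₁ f).1 = h := by rw [(h1.1 f hfg).trans hf]
    have := hnb.1
    change 0 - (X f).1 < 0 - (P₁ f).1 at this
    have hle := fst_le_of_inDiamond (hU.1 X hXl f)
    omega

/-- **THE X⁺ SIBLING CLAUSE AT A CEILING APEX** (KERNEL, every `h`). -/
theorem xplus_two_children {h : ℤ} {C : MConfig} (hU : C.InDiamond h) (hX : XPlusClosed C) {Z : MCell} (hZ : Z ∈ C.lower)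
    (hZc : ∀ j, OnCeiling h (Z j)) {g f : Fin 4} (hfg : f ≠ g) (hg : Z g = (h, 0, 0)) (hf : Z f = (h, 0, 0)) {P₁ P₂ : MCell}
    (hP₁ : P₁ ∈ C.upper) (hP₂ : P₂ ∈ C.upper) {r₁ r₂ : Fin 4} (hr : r₂ ≠ r₁) (h1 : UPartner Z P₁ g r₁) (h2 : UPartner Z P₂ g r₂)
    (hNT : ∀ X ∈ C.lower, MAgree X Z g → ¬ isApex (X g) → (∀ j, OnCeiling h (X j)) → False) : False :=
  xplus_two_children_gen hU hX hZ hfg hg hf hP₁ hP₂ hr h1 h2 fun X hXl hag hna hc =>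
    hNT X hXl hag hna fun j => by
      by_cases hj : j = g
      · rw [hj]; exact hc
      · rw [hag j hj]; exact hZc j

/-- **(DL) AT THE DEEPEST SINGLE-CHARGED HEADS** (KERNEL, every `h`). -/
theorem downLine_base {h : ℤ} {C : MConfig} (hU : C.InDiamond h) (hX : XPlusClosed C) {Z : MCell} (hZ : Z ∈ C.lower) (hD : RuleDMu4N C Z)
    {σ₀ : Fin 4} (hap : ∀ j, j ≠ σ₀ → Z j = (h, 0, 0)) (hna : ¬ isApex (Z σ₀)) (hc : OnCeiling h (Z σ₀)) (ht : nodeLevel (Z σ₀) = 2)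
    (hNT : ∀ g, g ≠ σ₀ → ∀ X ∈ C.lower, MAgree X Z g → ¬ isApex (X g) → (∀ j, OnCeiling h (X j)) → False)
    (hNC : ∀ g, g ≠ σ₀ → ∀ P ∈ C.upper, MAgree2 P Z σ₀ g → OnFloor (P σ₀) → ¬ isApex (P σ₀) → ¬ isApex (P g) →
      (∀ j, OnCeiling h (P j)) → False)
    {k : Fin 4} (hk : Adapted (Z σ₀) k) (hkh : coord (Z σ₀) k ≠ h) : MServedBelow C Z σ₀ k := by
  have hxax := (hU.1 Z hZ σ₀).1
  have hZc : ∀ j, OnCeiling h (Z j) := fun j => by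
    by_cases hj : j = σ₀
    · rw [hj]; exact hc
    · rw [hap j hj]; exact onCeiling_apex h
  have hcpos : 0 < absCharge (Z σ₀) := absCharge_pos_of_not_isApex hxax hna
  have hx1 : (Z σ₀).1 = 2 + absCharge (Z σ₀) := by unfold nodeLevel at ht; omega
  have hh : h = 2 + 2 * absCharge (Z σ₀) := by have e : (Z σ₀).1 + absCharge (Z σ₀) = h := hc; omega
  have hcoord : coord (Z σ₀) k = 2 := by
    rcases coord_adapted_cases hxax hk with e | e
    · exact absurd (e.trans hc) hkh
    · unfold nodeLevel at ht; omega
  -- two apex slots `g ≠ f` off `σ₀`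
  obtain ⟨g, f, hgσ, hfσ, hfg⟩ : ∃ g f : Fin 4, g ≠ σ₀ ∧ f ≠ σ₀ ∧ f ≠ g :=
    ⟨σ₀ + 1, σ₀ + 2, by fin_cases σ₀ <;> decide, by fin_cases σ₀ <;> decide, by fin_cases σ₀ <;> decide⟩
  by_contra hDL
  -- every direction `k'` at the apex `Z g = hI` yields a `P`-child of `hI` at `g` in a direction `≠ k' + 2`
  have key : ∀ k' : Fin 4, ∃ r, r ≠ k' + 2 ∧ ∃ P ∈ C.upper, UPartner Z P g r := by
    intro k'
    have hadg : Adapted (Z g) k' := by rw [hap g hgσ]; fin_cases k' <;> simp [Adapted]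
    have hne : coord (Z σ₀) k ≠ coord (Z g) k' := by
      rw [hcoord, hap g hgσ]
      fin_cases k' <;> simp [coord] <;> omega
    rcases hD σ₀ g hgσ.symm k k' hk hadg hne with ⟨r, hr, P, hP, hZP⟩ | ⟨r, hr, P, hP, hZP⟩ | ⟨a, b, ha, _, P, hP, hag2, h01, h02, hg1, hg2⟩
    · -- `x` settled below: along its frame only, i.e. by the down-line partner — excluded
      rcases ray_dir_of_adapted_down hxax hna hk (by have := hZP.2.1; omega) hZP.2.2 (hU.2 P hP σ₀).1 with rfl | rfl
      · exact (hDL ⟨P, hP, hZP⟩).elim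
      · exact (hr rfl).elim
    · exact ⟨r, hr, P, hP, hZP⟩
    · -- a cover moves `x` one step down its line onto the floor letter and `hI` onto a child: excluded
      exfalso
      have ha' : a = k := by
        rcases ha with e | ⟨hapx, _⟩
        · exact e
        · exact (hna hapx).elim
      subst ha'
      have hPax := (hU.2 P hP σ₀).1
      have hcP : coord (P σ₀) a + 2 * ((Z σ₀).1 - (P σ₀).1) = 2 := by
        have := coord_ray_self (P σ₀) a ((Z σ₀).1 - (P σ₀).1); rw [← h02] at this; omega
      have hc0 : 0 ≤ coord (P σ₀) a := coord_nonneg_of_inDiamond (hU.2 P hP σ₀) a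
      have hc00 : coord (P σ₀) a = 0 := by omega
      have hfl : OnFloor (P σ₀) := onFloor_of_coord_zero (hU.2 P hP σ₀) hc00
      have hPna : ¬ isApex (P σ₀) := by
        rintro ⟨hb, hc'⟩
        have e0 : (P σ₀).1 = absCharge (P σ₀) := hfl
        simp only [absCharge, chargeOf, hb, hc', sub_zero, abs_zero] at e0
        omega
      have hgray : ((h, 0, 0) : BPoint) = ray (P g) b ((Z g).1 - (P g).1) := by rw [← hap g hgσ]; exact hg2
      have hg1' : (P g).1 < h := by rw [hap g hgσ] at hg1; exact hg1
      have hZg1 : (Z g).1 = h := by rw [hap g hgσ]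
      have hPg : ¬ isApex (P g) := not_isApex_below_apex (by omega) hgray
      refine hNC g hgσ P hP hag2 hfl hPna hPg (fun j => ?_)
      by_cases hj1 : j = σ₀
      · rw [hj1]; exact onCeiling_of_ray_down a (by omega) h02 hc hxax hPax (Or.inr hkh)
      · by_cases hj2 : j = g
        · rw [hj2]; exact onCeiling_between hgray (ray_zero (P g) b).symm (by omega)
        · rw [hag2 j hj1 hj2]; exact hZc j
  obtain ⟨r₁, -, P₁, hP₁, h1⟩ := key 0
  obtain ⟨r₂, hr₂, P₂, hP₂, h2⟩ := key (r₁ + 2)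
  rw [fin4_add_two_add_two] at hr₂
  exact xplus_two_children hU hX hZ hZc hfg (hap g hgσ) (hap f hfσ) hP₁ hP₂ hr₂ h1 h2 (hNT g hgσ)

/-- **(DL) AT THE DEEPEST SINGLE-CHARGED HEADS FROM (CD)** (KERNEL, every `h`). -/
theorem downLine_base_of_cd {h : ℤ} {C : MConfig} (hU : C.InDiamond h) (hX : XPlusClosed C) (hCD : CDIneq C) {Z : MCell} (hZ : Z ∈ C.lower)
    (hD : RuleDMu4N C Z) {σ₀ : Fin 4} (hap : ∀ j, j ≠ σ₀ → Z j = (h, 0, 0)) (hna : ¬ isApex (Z σ₀)) (hc : OnCeiling h (Z σ₀))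
    (ht : nodeLevel (Z σ₀) = 2) {k : Fin 4} (hk : Adapted (Z σ₀) k) (hkh : coord (Z σ₀) k ≠ h) :
    MServedBelow C Z σ₀ k ∧ MServedBelow (lineRestrict h C) Z σ₀ k := by
  have hxax := (hU.1 Z hZ σ₀).1
  have hNT : ∀ g, g ≠ σ₀ → ∀ X ∈ C.lower, MAgree X Z g → ¬ isApex (X g) → (∀ j, OnCeiling h (X j)) → False := by
    intro g hgσ X hXl hag hXg hXc
    have hlev : LevelCell X := levelCell_of_onCeiling hXc
    have hXσ : X σ₀ = Z σ₀ := hag σ₀ hgσ.symm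
    have h2 : 2 ≤ chargeCount X :=
      two_le_chargeCount hgσ.symm (by rw [hXσ]; exact snd_ne_of_not_isApex hna) (snd_ne_of_not_isApex hXg)
    have := hCD.2 X hXl hlev σ₀ (by rw [hXσ]; exact snd_ne_of_not_isApex hna)
    rw [hXσ, ht] at this
    omega
  have hNC : ∀ g, g ≠ σ₀ → ∀ P ∈ C.upper, MAgree2 P Z σ₀ g → OnFloor (P σ₀) → ¬ isApex (P σ₀) → ¬ isApex (P g) →
      (∀ j, OnCeiling h (P j)) → False := by
    intro g hgσ P hP _ hfl hPσ hPg hPc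
    have hlev : LevelCell P := levelCell_of_onCeiling hPc
    have h2 : 2 ≤ chargeCount P := two_le_chargeCount hgσ.symm (snd_ne_of_not_isApex hPσ) (snd_ne_of_not_isApex hPg)
    have := hCD.1 P hP hlev σ₀ (snd_ne_of_not_isApex hPσ)
    have e0 : nodeLevel (P σ₀) = 0 := by unfold nodeLevel; have e : (P σ₀).1 = absCharge (P σ₀) := hfl; omega
    rw [e0] at this
    omega
  have hS : MServedBelow C Z σ₀ k := downLine_base hU hX hZ hD hap hna hc ht hNT hNC hk hkh
  refine ⟨hS, ?_⟩
  obtain ⟨P, hP, hZP⟩ := hS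
  refine ⟨P, mem_lineRestrict_upper.2 ⟨hP, fun j => ?_⟩, hZP⟩
  by_cases hj : j = σ₀
  · rw [hj]
    exact onCeiling_of_ray_down k (by have := hZP.2.1; omega) hZP.2.2 hc hxax (hU.2 P hP σ₀).1 (Or.inr hkh)
  · rw [hZP.1 j hj, hap j hj]; exact onCeiling_apex h

/-- an apex on the ceiling `h` is `hI`. -/
theorem eq_ceilingApex {h : ℤ} {x : BPoint} (hap : isApex x) (hc : OnCeiling h x) : x = (h, 0, 0) := by
  obtain ⟨α, a, b⟩ := x
  obtain ⟨ha, hb⟩ := hap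
  simp only at ha hb
  subst ha; subst hb
  have e : α + absCharge ((α, 0, 0) : BPoint) = h := hc
  simp [absCharge, chargeOf] at e
  subst e; rfl

/-- **(DL_h) AT NODE LEVEL 2 — FOR EVERY `h`, FROM RULE D + X⁺ + (CD)** (KERNEL). -/
theorem downLine_nodeLevel_two_of_cd {h : ℤ} {C : MConfig} (hU : C.InDiamond h) (hX : XPlusClosed C) (hCD : CDIneq C) {Z : MCell}
    (hZ : Z ∈ C.lower) (hZc : ∀ j, OnCeiling h (Z j)) (hD : RuleDMu4N C Z) {σ₀ : Fin 4} (hna : ¬ isApex (Z σ₀)) (ht : nodeLevel (Z σ₀) = 2)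
    {k : Fin 4} (hk : Adapted (Z σ₀) k) (hkh : coord (Z σ₀) k ≠ h) :
    MServedBelow C Z σ₀ k ∧ MServedBelow (lineRestrict h C) Z σ₀ k := by
  have hap : ∀ j, j ≠ σ₀ → Z j = (h, 0, 0) := by
    intro j hj
    by_cases hja : isApex (Z j)
    · exact eq_ceilingApex hja (hZc j)
    · exfalso
      have h2 : 2 ≤ chargeCount Z := two_le_chargeCount hj (snd_ne_of_not_isApex hja) (snd_ne_of_not_isApex hna)
      have := hCD.2 Z hZ (levelCell_of_onCeiling hZc) σ₀ (snd_ne_of_not_isApex hna)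
      rw [ht] at this
      omega
  exact downLine_base_of_cd hU hX hCD hZ hD hap hna (hZc σ₀) ht hk hkh

/-- the same from the typed law (CD_h), for static `G₁` designs in ◇_h (RULE D at `Z` from `C.StaticH1`). -/
theorem downLine_nodeLevel_two {h : ℤ} (hCDL : ChargeDepthLaw h) {C : MConfig} (hU : C.InDiamond h) (hG : C.G1Closed) (hS : C.StaticH1)
    {Z : MCell} (hZ : Z ∈ C.lower) (hZc : ∀ j, OnCeiling h (Z j)) {σ₀ : Fin 4} (hna : ¬ isApex (Z σ₀)) (ht : nodeLevel (Z σ₀) = 2)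
    {k : Fin 4} (hk : Adapted (Z σ₀) k) (hkh : coord (Z σ₀) k ≠ h) :
    MServedBelow C Z σ₀ k ∧ MServedBelow (lineRestrict h C) Z σ₀ k :=
  downLine_nodeLevel_two_of_cd hU hS.2.1 (hCDL C hU hG hS) hZ hZc (hS.1.1 Z hZ) hna ht hk hkh

/-! ## §19 (v1.7) THE INDUCTION -/

/-- the height of a ray point. -/
theorem fst_ray (x : BPoint) (k : Fin 4) (e : ℤ) : (ray x k e).1 = x.1 + e := rfl

/-- composing two steps of one null ray. -/
theorem ray_trans {x y z : BPoint} {k : Fin 4} {d₁ d₂ : ℤ} (h1 : x = ray y k d₁) (h2 : y = ray z k d₂) : x = ray z k (d₂ + d₁) := by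
  rw [ray_add, ← h2]; exact h1

/-- a `U`-partner from an explicit ray step. -/
theorem uPartner_of_ray {Z P : MCell} {σ k : Fin 4} {d : ℤ} (hag : MAgree P Z σ) (hd : 0 < d) (h : Z σ = ray (P σ) k d) :
    UPartner Z P σ k := by
  have h1 : (Z σ).1 = (P σ).1 + d := by have := congrArg Prod.fst h; exact this
  refine ⟨hag, by omega, ?_⟩
  rw [show (Z σ).1 - (P σ).1 = d by omega]; exact h

/-- a child of the apex, `hI = ray y b e`: `y` is adapted to `b` with `coord y b = h − 2e`. -/
theorem child_adapted {h : ℤ} {y : BPoint} {b : Fin 4} {e : ℤ} (hy : ((h, 0, 0) : BPoint) = ray y b e) :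
    Adapted y b ∧ coord y b = h - 2 * e := by
  obtain ⟨α, a, c⟩ := y
  simp only [ray, Prod.mk.injEq] at hy
  fin_cases b <;> simp [Adapted, coord] at hy ⊢ <;> omega

/-- a charged ceiling letter lies strictly below the ceiling apex `hI` on a null ray (its node ray). -/
theorem exists_apex_ray {h : ℤ} {y : BPoint} (hy : OnCeiling h y) (hyax : y.2 = (0, 0) ∨ AxisPt y) (hna : ¬ isApex y) :
    ∃ b : Fin 4, y.1 < h ∧ ((h, 0, 0) : BPoint) = ray y b (h - y.1) := by
  obtain ⟨α, a, c⟩ := y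
  simp only [OnCeiling, absCharge, chargeOf, isApex, AxisPt, Prod.mk.injEq] at hy hyax hna ⊢
  rcases hyax with ⟨ha, hc⟩ | ⟨ha, hc⟩ | ⟨ha, hc⟩
  · exact (hna ⟨ha, hc⟩).elim
  · subst hc
    rcases lt_or_gt_of_ne ha with hlt | hgt
    · refine ⟨0, ?_, ?_⟩ <;> simp [abs_of_neg hlt] at hy ⊢ <;> omega
    · refine ⟨2, ?_, ?_⟩ <;> simp [abs_of_pos hgt] at hy ⊢ <;> omega
  · subst ha
    rcases lt_or_gt_of_ne hc with hlt | hgt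
    · refine ⟨3, ?_, ?_⟩ <;> simp [abs_of_neg hlt] at hy ⊢ <;> omega
    · refine ⟨1, ?_, ?_⟩ <;> simp [abs_of_pos hgt] at hy ⊢ <;> omega

/-- stepping DOWN the node ray of a charged ceiling letter `x` (`x = ray y k e`, `e > 0`, `k` adapted, `coord x k ≠ h`): `y` is charged and adapted to `k`. -/
theorem nodeRay_below {h : ℤ} {x y : BPoint} {k : Fin 4} {e : ℤ} (hx : OnCeiling h x) (hxax : x.2 = (0, 0) ∨ AxisPt x)
    (hna : ¬ isApex x) (hk : Adapted x k) (hkh : coord x k ≠ h) (he : 0 < e) (hxy : x = ray y k e)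
    (hyax : y.2 = (0, 0) ∨ AxisPt y) : ¬ isApex y ∧ Adapted y k := by
  obtain ⟨α, a, b⟩ := y
  subst hxy
  simp only [OnCeiling, absCharge, chargeOf, isApex, coord, AxisPt, Adapted, Prod.mk.injEq] at *
  fin_cases k <;> simp at hx hxax hna hk hkh hyax ⊢ <;>
    (simp only [abs_eq_max_neg, max_def] at *; split_ifs at * <;> omega)

/-- an adapted frame coordinate of a ceiling letter is at most `h`. -/
theorem coord_le_of_onCeiling {h : ℤ} {x : BPoint} (hx : OnCeiling h x) (hxax : x.2 = (0, 0) ∨ AxisPt x) {k : Fin 4}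
    (hk : Adapted x k) : coord x k ≤ h := by
  have h0 : 0 ≤ absCharge x := abs_nonneg _
  have hc : x.1 + absCharge x = h := hx
  rcases coord_adapted_cases hxax hk with e | e <;> omega

/-- **`y` AT OR STRICTLY BELOW `x` ON THE `k`-RAY** (the position of the `σ₀`-letters of the cells met by the induction). -/
abbrev OnRayBelow (k : Fin 4) (x y : BPoint) : Prop := y = x ∨ (y.1 < x.1 ∧ x = ray y k (x.1 - y.1))

theorem onRayBelow_trans {x y z : BPoint} {k : Fin 4} (h1 : OnRayBelow k x y) (h2 : OnRayBelow k y z) : OnRayBelow k x z := by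
  rcases h1 with rfl | ⟨hlt1, hr1⟩
  · exact h2
  · rcases h2 with rfl | ⟨hlt2, hr2⟩
    · exact Or.inr ⟨hlt1, hr1⟩
    · refine Or.inr ⟨lt_trans hlt2 hlt1, ?_⟩
      have e := ray_trans hr1 hr2
      rwa [show (y.1 - z.1) + (x.1 - y.1) = x.1 - z.1 by ring] at e

/-- a μ₄ letter at or below a charged ceiling letter `x` on its node ray is a charged ceiling letter with the same node direction and …. -/
theorem onRayBelow_props {h : ℤ} {x y : BPoint} {k : Fin 4} (hx : OnCeiling h x) (hxax : x.2 = (0, 0) ∨ AxisPt x) (hna : ¬ isApex x)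
    (hk : Adapted x k) (hkh : coord x k ≠ h) (hyax : y.2 = (0, 0) ∨ AxisPt y) (hxy : OnRayBelow k x y) :
    OnCeiling h y ∧ ¬ isApex y ∧ Adapted y k ∧ coord y k ≤ coord x k ∧ coord y k ≠ h := by
  rcases hxy with rfl | ⟨hlt, hr⟩
  · exact ⟨hx, hna, hk, le_rfl, hkh⟩
  · obtain ⟨hna', hk'⟩ := nodeRay_below hx hxax hna hk hkh (by omega) hr hyax
    have e := coord_ray_self y k (x.1 - y.1)
    rw [← hr] at e
    have hle := coord_le_of_onCeiling hx hxax hk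
    exact ⟨onCeiling_of_ray_down k (by omega) hr hx hxax hyax (Or.inr hkh), hna', hk', by omega, by omega⟩

/-- **COVERS CLIMB** (KERNEL, every `h`). -/
theorem cover_chain {h : ℤ} {C : MConfig} (hU : C.InDiamond h) (hDP : ∀ P ∈ C.upper, RuleDMu4P C P) {Z : MCell} (hZ : Z ∈ C.lower)
    (hZc : ∀ j, OnCeiling h (Z j)) {σ₀ g : Fin 4} (hgσ : g ≠ σ₀) (hg : Z g = (h, 0, 0))
    {k : Fin 4} (hkh : coord (Z σ₀) k ≠ h) (hDL : ¬ MServedBelow C Z σ₀ k)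
    (IH : ∀ Z₁ ∈ C.lower, MAgree Z₁ Z σ₀ → (Z₁ σ₀).1 < (Z σ₀).1 → Z σ₀ = ray (Z₁ σ₀) k ((Z σ₀).1 - (Z₁ σ₀).1) →
      MServedBelow C Z₁ σ₀ k)
    (H2 : ∀ N₁ ∈ C.lower, MAgree2 N₁ Z σ₀ g → (N₁ σ₀).1 < (Z σ₀).1 → Z σ₀ = ray (N₁ σ₀) k ((Z σ₀).1 - (N₁ σ₀).1) →
      ¬ isApex (N₁ g) → OnCeiling h (N₁ g) → MServedBelow C N₁ σ₀ k) :
    ∀ n : ℕ, ∀ Q ∈ C.upper, MAgree2 Q Z σ₀ g → (Q σ₀).1 < (Z σ₀).1 → Z σ₀ = ray (Q σ₀) k ((Z σ₀).1 - (Q σ₀).1) →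
      ∀ b : Fin 4, (Q g).1 < h → ((h, 0, 0) : BPoint) = ray (Q g) b (h - (Q g).1) → h - (Q g).1 ≤ n → False := by
  have hxax := (hU.1 Z hZ σ₀).1
  intro n
  induction n with
  | zero => intro Q _ _ _ _ b hlt _ hn; simp only [Nat.cast_zero] at hn; omega
  | succ n ih =>
    intro Q hQ hag2 hlt1 hray1 b hlt2 hray2 hn
    have hQax := fun j => (hU.2 Q hQ j).1
    have hQσc : OnCeiling h (Q σ₀) := onCeiling_of_ray_down k (by omega) hray1 (hZc σ₀) hxax (hQax σ₀) (Or.inr hkh)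
    have hyna : ¬ isApex (Q g) := not_isApex_below_apex (by omega) hray2
    obtain ⟨hyad, hyco⟩ := child_adapted hray2
    -- (UL) at `Q`: the child is served up its ray by `N₁ = Q(g ↦ y')`, `y < y' ≤ hI`
    obtain ⟨N₁, hN₁, hNQ⟩ := upLine_of_ruleDMu4P hU hQ (hDP Q hQ) hgσ.symm hQσc hyna hyad (by rw [hyco]; omega)
    have hN1le : (N₁ g).1 ≤ h := fst_le_of_inDiamond (hU.1 N₁ hN₁ g)
    have hNσ : N₁ σ₀ = Q σ₀ := (hNQ.1 σ₀ hgσ.symm).symm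
    have hltσ : (N₁ σ₀).1 < (Z σ₀).1 := by rw [hNσ]; exact hlt1
    have hrayσ : Z σ₀ = ray (N₁ σ₀) k ((Z σ₀).1 - (N₁ σ₀).1) := by rw [hNσ]; exact hray1
    by_cases htop : (N₁ g).1 = h
    · -- `y' = hI`: `N₁ = Z(σ₀ ↦ x₁)` is the deeper head; its down-line partner is one of `Z`
      have hNg : N₁ g = (h, 0, 0) := by rw [hNQ.2.2, htop]; exact hray2.symm
      have hag : MAgree N₁ Z σ₀ := fun j hj => by
        by_cases hjg : j = g
        · rw [hjg, hNg, hg]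
        · rw [← hNQ.1 j hjg]; exact hag2 j hj hjg
      obtain ⟨P, hP, hP1⟩ := IH N₁ hN₁ hag hltσ hrayσ
      refine hDL ⟨P, hP, uPartner_of_ray (fun j hj => (hP1.1 j hj).trans (hag j hj)) ?_ (ray_trans hrayσ hP1.2.2)⟩
      have := hP1.2.1; omega
    · -- `y' < hI`: `N₁ = Z(σ₀ ↦ x₁, g ↦ y')` is a deeper twin; its down-line partner is a higher cover
      have hlt' : (N₁ g).1 < h := lt_of_le_of_ne hN1le htop
      have hy'na : ¬ isApex (N₁ g) := not_isApex_between hray2 hNQ.2.2 (by omega)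
      have hy'c : OnCeiling h (N₁ g) := onCeiling_between hray2 hNQ.2.2 (by omega)
      have hag2' : MAgree2 N₁ Z σ₀ g := fun j hj1 hj2 => by rw [← hNQ.1 j hj2]; exact hag2 j hj1 hj2
      obtain ⟨P₁, hP₁, hPN⟩ := H2 N₁ hN₁ hag2' hltσ hrayσ hy'na hy'c
      have hPg : P₁ g = N₁ g := hPN.1 g hgσ
      have hray2' : ((h, 0, 0) : BPoint) = ray (P₁ g) b (h - (P₁ g).1) := by
        have e1 : h - (Q g).1 = ((N₁ g).1 - (Q g).1) + (h - (N₁ g).1) := by ring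
        have h2 := hray2
        rw [e1, ray_add, ← hNQ.2.2] at h2
        rw [hPg]; exact h2
      have hlt1' : (P₁ σ₀).1 < (Z σ₀).1 := by have := hPN.2.1; omega
      have hray1' : Z σ₀ = ray (P₁ σ₀) k ((Z σ₀).1 - (P₁ σ₀).1) := by
        have e := ray_trans hrayσ hPN.2.2
        rwa [show ((N₁ σ₀).1 - (P₁ σ₀).1) + ((Z σ₀).1 - (N₁ σ₀).1) = (Z σ₀).1 - (P₁ σ₀).1 by ring] at e
      have hagP : MAgree2 P₁ Z σ₀ g := fun j hj1 hj2 => by rw [hPN.1 j hj1]; exact hag2' j hj1 hj2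
      have hQN := hNQ.2.1
      exact ih P₁ hP₁ hagP hlt1' hray1' b (by rw [hPg]; exact hlt') hray2' (by rw [hPg]; push_cast at hn; omega)

/-- **THE INDUCTION STEP** (KERNEL, every `h`). -/
theorem dl_core_step {h : ℤ} {C : MConfig} (hU : C.InDiamond h) (hDN : ∀ Z ∈ C.lower, RuleDMu4N C Z)
    (hDP : ∀ P ∈ C.upper, RuleDMu4P C P) (hX : XPlusClosed C) {Z : MCell} (hZ : Z ∈ C.lower) (hZc : ∀ j, OnCeiling h (Z j))
    {σ₀ g f : Fin 4} (hgσ : g ≠ σ₀) (hfg : f ≠ g) (hg : Z g = (h, 0, 0)) (hf : Z f = (h, 0, 0)) (hna : ¬ isApex (Z σ₀))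
    {k : Fin 4} (hk : Adapted (Z σ₀) k) (hkh : coord (Z σ₀) k ≠ h)
    (IH : ∀ Z₁ ∈ C.lower, MAgree Z₁ Z σ₀ → (Z₁ σ₀).1 < (Z σ₀).1 → Z σ₀ = ray (Z₁ σ₀) k ((Z σ₀).1 - (Z₁ σ₀).1) →
      MServedBelow C Z₁ σ₀ k)
    (H3 : ∀ T ∈ C.lower, MAgree2 T Z σ₀ g → OnRayBelow k (Z σ₀) (T σ₀) → ¬ isApex (T g) → OnCeiling h (T g) →
      MServedBelow C T σ₀ k) :
    MServedBelow C Z σ₀ k := by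
  have hxax := (hU.1 Z hZ σ₀).1
  by_contra hDL
  -- (1) covers climb: no cover at `(σ₀, g)`
  have hcov : ∀ Q ∈ C.upper, MAgree2 Q Z σ₀ g → (Q σ₀).1 < (Z σ₀).1 → Z σ₀ = ray (Q σ₀) k ((Z σ₀).1 - (Q σ₀).1) →
      ∀ b : Fin 4, (Q g).1 < h → ((h, 0, 0) : BPoint) = ray (Q g) b (h - (Q g).1) → False :=
    fun Q hQ hag2 hlt hray b hltg hrayg =>
      cover_chain hU hDP hZ hZc hgσ hg hkh hDL IH
        (fun N₁ hN₁ hag hlt' hray' hna' hc' => H3 N₁ hN₁ hag (Or.inr ⟨hlt', hray'⟩) hna' hc') _ Q hQ hag2 hlt hray b hltg hrayg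
        (Int.self_le_toNat _)
  -- (2) RULE D at `Z`: every direction `k'` at the apex slot `g` yields a `P`-child of `hI` at `g` in a direction `≠ k' + 2`
  have key : ∀ k' : Fin 4, ∃ r, r ≠ k' + 2 ∧ ∃ P ∈ C.upper, UPartner Z P g r := by
    intro k'
    have hadg : Adapted (Z g) k' := by rw [hg]; fin_cases k' <;> simp [Adapted]
    have hcg : coord (Z g) k' = h := coord_apex_onCeiling (by rw [hg]; exact ⟨rfl, rfl⟩) (hZc g) k'
    have hne : coord (Z σ₀) k ≠ coord (Z g) k' := by rw [hcg]; exact hkh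
    rcases hDN Z hZ σ₀ g hgσ.symm k k' hk hadg hne with ⟨r, hr, P, hP, hZP⟩ | ⟨r, hr, P, hP, hZP⟩ |
        ⟨a, b, ha, -, P, hP, hag2, h01, h02, hg1, hg2⟩
    · rcases ray_dir_of_adapted_down hxax hna hk (by have := hZP.2.1; omega) hZP.2.2 (hU.2 P hP σ₀).1 with rfl | rfl
      · exact (hDL ⟨P, hP, hZP⟩).elim
      · exact (hr rfl).elim
    · exact ⟨r, hr, P, hP, hZP⟩
    · exfalso
      have ha' : a = k := by
        rcases ha with e | ⟨hapx, _⟩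
        · exact e
        · exact (hna hapx).elim
      subst ha'
      have hZg1 : (Z g).1 = h := by rw [hg]
      refine hcov P hP hag2 h01 h02 b (by omega) ?_
      have e := hg2
      rw [hZg1, hg] at e
      exact e
  obtain ⟨r₁, -, P₁, hP₁, h1⟩ := key 0
  obtain ⟨r₂, hr₂, P₂, hP₂, h2⟩ := key (r₁ + 2)
  rw [fin4_add_two_add_two] at hr₂
  -- (3) `X⁺`: two children in different directions give an `N`-twin `T = Z(g ↦ y')`; (4) twins descend: its down-line partner (H3) is a cover
  refine xplus_two_children hU hX hZ hZc hfg hg hf hP₁ hP₂ hr₂ h1 h2 (fun T hT hag hTg hTc => ?_)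
  have hTσ : T σ₀ = Z σ₀ := hag σ₀ hgσ.symm
  obtain ⟨P, hP, hTP⟩ := H3 T hT (fun j _ hj2 => hag j hj2) (Or.inl hTσ) hTg (hTc g)
  obtain ⟨b, hylt, hray⟩ := exists_apex_ray (hTc g) (hU.1 T hT g).1 hTg
  have hPg : P g = T g := hTP.1 g hgσ
  refine hcov P hP (fun j hj1 hj2 => (hTP.1 j hj1).trans (hag j hj2)) (by rw [← hTσ]; exact hTP.2.1)
    (by rw [← hTσ]; exact hTP.2.2) b (by rw [hPg]; exact hylt) (by rw [hPg]; exact hray)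

/-- **THE INDUCTION ON THE NODE COORDINATE** (KERNEL, every `h`). -/
theorem dl_core {h : ℤ} {C : MConfig} (hU : C.InDiamond h) (hDN : ∀ Z ∈ C.lower, RuleDMu4N C Z)
    (hDP : ∀ P ∈ C.upper, RuleDMu4P C P) (hX : XPlusClosed C) {σ₀ g f k : Fin 4} (hgσ : g ≠ σ₀) (hfg : f ≠ g) :
    ∀ n : ℕ, ∀ Z ∈ C.lower, (∀ j, OnCeiling h (Z j)) → Z g = (h, 0, 0) → Z f = (h, 0, 0) → ¬ isApex (Z σ₀) →
      Adapted (Z σ₀) k → coord (Z σ₀) k ≠ h → coord (Z σ₀) k ≤ n →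
      (∀ T ∈ C.lower, MAgree2 T Z σ₀ g → OnRayBelow k (Z σ₀) (T σ₀) → ¬ isApex (T g) → OnCeiling h (T g) →
        MServedBelow C T σ₀ k) →
      MServedBelow C Z σ₀ k := by
  intro n
  induction n with
  | zero =>
    intro Z hZ hZc hg hf hna hk hkh hn H3
    refine dl_core_step hU hDN hDP hX hZ hZc hgσ hfg hg hf hna hk hkh (fun Z₁ hZ₁ _ _ hray => ?_) H3
    exfalso
    have e := coord_ray_self (Z₁ σ₀) k ((Z σ₀).1 - (Z₁ σ₀).1)
    rw [← hray] at e
    have := coord_nonneg_of_inDiamond (hU.1 Z₁ hZ₁ σ₀) k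
    simp only [Nat.cast_zero] at hn
    omega
  | succ n ih =>
    intro Z hZ hZc hg hf hna hk hkh hn H3
    refine dl_core_step hU hDN hDP hX hZ hZc hgσ hfg hg hf hna hk hkh (fun Z₁ hZ₁ hag hlt hray => ?_) H3
    have hxax := (hU.1 Z hZ σ₀).1
    have h1ax := (hU.1 Z₁ hZ₁ σ₀).1
    obtain ⟨hZ₁c, hna₁, hk₁, hle₁, hkh₁⟩ := onRayBelow_props (hZc σ₀) hxax hna hk hkh h1ax (Or.inr ⟨hlt, hray⟩)
    have e := coord_ray_self (Z₁ σ₀) k ((Z σ₀).1 - (Z₁ σ₀).1)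
    rw [← hray] at e
    have hfσ : f ≠ σ₀ := by rintro rfl; exact hna (by rw [hf]; exact ⟨rfl, rfl⟩)
    have hZ₁c' : ∀ j, OnCeiling h (Z₁ j) := fun j => by
      by_cases hj : j = σ₀
      · rw [hj]; exact hZ₁c
      · rw [hag j hj]; exact hZc j
    refine ih Z₁ hZ₁ hZ₁c' (by rw [hag g hgσ]; exact hg) (by rw [hag f hfσ]; exact hf) hna₁ hk₁ hkh₁
      (by push_cast at hn; omega) (fun T hT hag2 hpos hTg hTc => ?_)
    exact H3 T hT (fun j hj1 hj2 => by rw [hag2 j hj1 hj2]; exact hag j hj1) (onRayBelow_trans (Or.inr ⟨hlt, hray⟩) hpos) hTg hTc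

/-- the fourth slot. -/
theorem exists_fourth (a b c : Fin 4) : ∃ w : Fin 4, w ≠ a ∧ w ≠ b ∧ w ≠ c := by
  revert a b c; decide

/-- a slot other than `d` is one of the three others. -/
theorem fin4_other {a b c d : Fin 4} (hab : a ≠ b) (hac : a ≠ c) (had : a ≠ d) (hbc : b ≠ c) (hbd : b ≠ d) (hcd : c ≠ d)
    {j : Fin 4} (hj : j ≠ d) : j = a ∨ j = b ∨ j = c := by
  revert a b c d j; decide

/-- **(DL) AT THE 3-CHARGED CEILING `N`-CELLS BELOW `x`** (the residual hypothesis of the induction). -/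
def DL3Below (h : ℤ) (C : MConfig) (σ₀ k : Fin 4) (x : BPoint) : Prop :=
  ∀ T ∈ C.lower, (∀ j, OnCeiling h (T j)) → OnRayBelow k x (T σ₀) →
    ∀ f : Fin 4, isApex (T f) → (∀ j, j ≠ f → ¬ isApex (T j)) → MServedBelow C T σ₀ k

/-- **(DL) AT EVERY CEILING `N`-CELL WITH TWO APEX LETTERS, EVERY `h`, FROM RULE D + `X⁺` + (DL) AT THE 3-CHARGED CELLS BELOW** (KERNEL). -/
theorem downLine_twoApex_of_dl3 {h : ℤ} {C : MConfig} (hU : C.InDiamond h) (hDN : ∀ Z ∈ C.lower, RuleDMu4N C Z)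
    (hDP : ∀ P ∈ C.upper, RuleDMu4P C P) (hX : XPlusClosed C) {Z : MCell} (hZ : Z ∈ C.lower) (hZc : ∀ j, OnCeiling h (Z j))
    {σ₀ g f : Fin 4} (hgσ : g ≠ σ₀) (hfg : f ≠ g) (hg : Z g = (h, 0, 0)) (hf : Z f = (h, 0, 0)) (hna : ¬ isApex (Z σ₀))
    {k : Fin 4} (hk : Adapted (Z σ₀) k) (hkh : coord (Z σ₀) k ≠ h) (hDL3 : DL3Below h C σ₀ k (Z σ₀)) :
    MServedBelow C Z σ₀ k := by
  have hxax := (hU.1 Z hZ σ₀).1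
  have hfσ : f ≠ σ₀ := by rintro rfl; exact hna (by rw [hf]; exact ⟨rfl, rfl⟩)
  obtain ⟨w, hwσ, hwg, hwf⟩ := exists_fourth σ₀ g f
  -- the letters of a cell `T` agreeing with `Z` off `{σ₀, g}`, with `T σ₀` at or below `x` and `T g` a charged ceiling letter
  have props : ∀ T ∈ C.lower, MAgree2 T Z σ₀ g → OnRayBelow k (Z σ₀) (T σ₀) → ¬ isApex (T g) → OnCeiling h (T g) →
      (∀ j, OnCeiling h (T j)) ∧ ¬ isApex (T σ₀) ∧ Adapted (T σ₀) k ∧ coord (T σ₀) k ≠ h ∧ T f = (h, 0, 0) ∧ T w = Z w := by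
    intro T hT hag2 hpos hTg hTc
    obtain ⟨hc, hna', hk', _, hkh'⟩ := onRayBelow_props (hZc σ₀) hxax hna hk hkh (hU.1 T hT σ₀).1 hpos
    have hTf : T f = (h, 0, 0) := by rw [hag2 f hfσ hfg]; exact hf
    refine ⟨fun j => ?_, hna', hk', hkh', hTf, hag2 w hwσ hwg⟩
    by_cases hj1 : j = σ₀
    · rw [hj1]; exact hc
    · by_cases hj2 : j = g
      · rw [hj2]; exact hTc
      · rw [hag2 j hj1 hj2]; exact hZc j
  by_cases hw : isApex (Z w)
  · -- three apexes: the twins met are 2-apex cells (apexes `f`, `w`), handled by `dl_core` itself, whose own twins are 3-charged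
    have hZw : Z w = (h, 0, 0) := eq_ceilingApex hw (hZc w)
    refine dl_core hU hDN hDP hX hgσ hfg _ Z hZ hZc hg hf hna hk hkh (Int.self_le_toNat _) (fun T hT hag2 hpos hTg hTc => ?_)
    obtain ⟨hTc', hna', hk', hkh', hTf, hTw⟩ := props T hT hag2 hpos hTg hTc
    rw [hZw] at hTw
    refine dl_core hU hDN hDP hX hfσ hwf _ T hT hTc' hTf hTw hna' hk' hkh' (Int.self_le_toNat _) (fun T' hT' hag2' hpos' hT'f hT'fc => ?_)
    -- `T'` agrees with `T` off `{σ₀, f}`: letters `x'' ≤ x' ≤ x`, `y'` at `g`, a charged ceiling letter at `f`, `hI` at `w`: 3-charged, one apex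
    have hposZ : OnRayBelow k (Z σ₀) (T' σ₀) := onRayBelow_trans hpos hpos'
    obtain ⟨hc'', hna'', _, _, _⟩ := onRayBelow_props (hZc σ₀) hxax hna hk hkh (hU.1 T' hT' σ₀).1 hposZ
    have hT'g : T' g = T g := hag2' g hgσ hfg.symm
    have hT'w : T' w = (h, 0, 0) := by rw [hag2' w hwσ hwf]; exact hTw
    refine hDL3 T' hT' (fun j => ?_) hposZ w (by rw [hT'w]; exact ⟨rfl, rfl⟩) (fun j hj => ?_)
    · by_cases hj1 : j = σ₀
      · rw [hj1]; exact hc''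
      · by_cases hj2 : j = f
        · rw [hj2]; exact hT'fc
        · rw [hag2' j hj1 hj2]; exact hTc' j
    · rcases fin4_other hgσ.symm hfσ.symm hwσ.symm hfg.symm hwg.symm hwf.symm hj with rfl | rfl | rfl
      · exact hna''
      · rw [hT'g]; exact hTg
      · exact hT'f
  · -- two apexes (`g`, `f`), `Z w` charged: the twins met are 3-charged with the single apex `f`
    refine dl_core hU hDN hDP hX hgσ hfg _ Z hZ hZc hg hf hna hk hkh (Int.self_le_toNat _) (fun T hT hag2 hpos hTg hTc => ?_)
    obtain ⟨hTc', hna', _, _, hTf, hTw⟩ := props T hT hag2 hpos hTg hTc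
    refine hDL3 T hT hTc' hpos f (by rw [hTf]; exact ⟨rfl, rfl⟩) (fun j hj => ?_)
    rcases fin4_other hgσ.symm hwσ.symm hfσ.symm hwg.symm hfg.symm hwf hj with rfl | rfl | rfl
    · exact hna'
    · exact hTg
    · rw [hTw]; exact hw

/-- **… AND UNCONDITIONALLY FOR NODE COORDINATE ≤ 4 UNDER (CD)** (KERNEL, every `h`). -/
theorem downLine_twoApex_of_cd {h : ℤ} {C : MConfig} (hU : C.InDiamond h) (hDN : ∀ Z ∈ C.lower, RuleDMu4N C Z)
    (hDP : ∀ P ∈ C.upper, RuleDMu4P C P) (hX : XPlusClosed C) (hCD : CDIneq C) {Z : MCell} (hZ : Z ∈ C.lower)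
    (hZc : ∀ j, OnCeiling h (Z j)) {σ₀ g f : Fin 4} (hgσ : g ≠ σ₀) (hfg : f ≠ g) (hg : Z g = (h, 0, 0)) (hf : Z f = (h, 0, 0))
    (hna : ¬ isApex (Z σ₀)) {k : Fin 4} (hk : Adapted (Z σ₀) k) (hkh : coord (Z σ₀) k ≠ h) (h4 : coord (Z σ₀) k ≤ 4) :
    MServedBelow C Z σ₀ k ∧ MServedBelow (lineRestrict h C) Z σ₀ k := by
  have hxax := (hU.1 Z hZ σ₀).1
  have hS : MServedBelow C Z σ₀ k := by
    refine downLine_twoApex_of_dl3 hU hDN hDP hX hZ hZc hgσ hfg hg hf hna hk hkh (fun T hT hTc hpos f' hf' hnf => ?_)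
    exfalso
    obtain ⟨hc', hna', hk', hle', hkh'⟩ := onRayBelow_props (hZc σ₀) hxax hna hk hkh (hU.1 T hT σ₀).1 hpos
    have hTax := (hU.1 T hT σ₀).1
    -- three charged slots (all but `f'`)
    have h3 : 3 ≤ chargeCount T := by
      unfold chargeCount
      have hsub : Finset.univ.erase f' ⊆ Finset.univ.filter (fun j : Fin 4 => (T j).2 ≠ (0, 0)) := by
        intro j hj
        rw [Finset.mem_erase] at hj
        simp only [Finset.mem_filter, Finset.mem_univ, true_and]
        exact snd_ne_of_not_isApex (hnf j hj.1)
      have hc := Finset.card_le_card hsub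
      rw [Finset.card_erase_of_mem (Finset.mem_univ f')] at hc
      simpa using hc
    have hcd := hCD.2 T hT (levelCell_of_onCeiling hTc) σ₀ (snd_ne_of_not_isApex hna')
    -- node level of `T σ₀` = its node coordinate ≤ 4 < 6
    have hnl : nodeLevel (T σ₀) = coord (T σ₀) k := by
      rcases coord_adapted_cases hTax hk' with e | e
      · exact absurd (e.trans hc') hkh'
      · unfold nodeLevel; omega
    omega
  refine ⟨hS, ?_⟩
  obtain ⟨P, hP, hZP⟩ := hS
  refine ⟨P, mem_lineRestrict_upper.2 ⟨hP, fun j => ?_⟩, hZP⟩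
  by_cases hj : j = σ₀
  · rw [hj]; exact onCeiling_of_ray_down k (by have := hZP.2.1; omega) hZP.2.2 (hZc σ₀) hxax (hU.2 P hP σ₀).1 (Or.inr hkh)
  · rw [hZP.1 j hj]; exact hZc j

/-- **(DL3_h) THE DOWN-LINE LAW AT 3-CHARGED CEILING HEADS** (the residue of (DL_h) after §19; a THEOREM of (CD_h) ∧ (LVN_h) ∧ (LVP3_h) for every `h ≤ 10`, §21–§22;
machine-FALSE at `h = 12`|band 4 at the heads `N[(10I+ℓ₋₁)³∣12I]`, `N[(10I+ℓ₋₁)²∣10I+ℓ₁∣12I]`, `N[8I+2ℓ₋₁∣(10I+ℓ₋₁)²∣12I]` — `ALPHA-D12-BAND4-g11.md`). -/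
def DownLineLaw3 (h : ℤ) : Prop :=
  ∀ C : MConfig, C.InDiamond h → C.G1Closed → C.StaticH1 → ∀ T ∈ C.lower, (∀ j, OnCeiling h (T j)) →
    ∀ f : Fin 4, isApex (T f) → (∀ j, j ≠ f → ¬ isApex (T j)) →
    ∀ j : Fin 4, j ≠ f → ∀ k : Fin 4, Adapted (T j) k → coord (T j) k ≠ h → MServedBelow C T j k

/-- (DL_h) ⇒ (DL3_h) (KERNEL; (DL3_h) is a layer of (DL_h)). -/
theorem dl3_of_downLine {h : ℤ} (H : DownLineLaw h) : DownLineLaw3 h := by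
  intro C hU hG hS T hT hTc f _ hnf j hjf k hk hkh
  obtain ⟨P, hP, hTP⟩ := H C hU hG hS T (mem_lineRestrict_lower.2 ⟨hT, hTc⟩) j (hnf j hjf) k hk hkh
  exact ⟨P, (mem_lineRestrict_upper.1 hP).1, hTP⟩

/-- **(DL_h) ⟸ (DL3_h) ∧ (LV_h) ∧ (AD_h)** (KERNEL, every `h`). -/
theorem downLineLaw_of_dl3 {h : ℤ} (hLV : LevelLaw h) (hAD : ApexDropLaw h) (h3 : DownLineLaw3 h) : DownLineLaw h := by
  intro C hU hG hS Z hZl j hj k hk hkh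
  obtain ⟨hZ, hZc⟩ := mem_lineRestrict_lower.1 hZl
  have hxax := (hU.1 Z hZ j).1
  -- a partner below a ceiling cell along a node ray is a ceiling cell
  have lift : MServedBelow C Z j k → MServedBelow (lineRestrict h C) Z j k := by
    rintro ⟨P, hP, hZP⟩
    refine ⟨P, mem_lineRestrict_upper.2 ⟨hP, fun i => ?_⟩, hZP⟩
    by_cases hi : i = j
    · rw [hi]; exact onCeiling_of_ray_down k (by have := hZP.2.1; omega) hZP.2.2 (hZc j) hxax (hU.2 P hP j).1 (Or.inr hkh)
    · rw [hZP.1 i hi]; exact hZc i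
  by_cases h2 : ∃ g f : Fin 4, g ≠ j ∧ f ≠ g ∧ isApex (Z g) ∧ isApex (Z f)
  · -- two apexes: §19
    obtain ⟨g, f, hgj, hfg, hga, hfa⟩ := h2
    refine lift (downLine_twoApex_of_dl3 hU hS.1.1 hS.1.2 hS.2.1 hZ hZc hgj hfg (eq_ceilingApex hga (hZc g))
      (eq_ceilingApex hfa (hZc f)) hj hk hkh (fun T hT hTc hpos f' hf' hnf => ?_))
    obtain ⟨_, hna', hk', _, hkh'⟩ := onRayBelow_props (hZc j) hxax hj hk hkh (hU.1 T hT j).1 hpos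
    exact h3 C hU hG hS T hT hTc f' hf' hnf j (by rintro rfl; exact hna' hf') k hk' hkh'
  · by_cases h1 : ∃ f : Fin 4, isApex (Z f)
    · -- exactly one apex: (DL3)
      obtain ⟨f, hfa⟩ := h1
      have hjf : j ≠ f := by rintro rfl; exact hj hfa
      have hnf : ∀ i, i ≠ f → ¬ isApex (Z i) := fun i hif hia => h2 ⟨i, f, by rintro rfl; exact hj hia, hif.symm, hia, hfa⟩
      exact lift (h3 C hU hG hS Z hZ hZc f hfa hnf j hjf k hk hkh)
    · -- fully charged: levelness + apex-drop exclusion (`lineNodeSettled_of_fc`)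
      push Not at h1
      have hFC : FCc Z := fun f => snd_ne_of_not_isApex (h1 f)
      obtain ⟨g, hgj⟩ : ∃ g : Fin 4, g ≠ j := ⟨j + 1, by fin_cases j <;> decide⟩
      obtain ⟨r, hr, P, hP, hZP⟩ := lineNodeSettled_of_fc hU hZ hZc hFC (hS.1.1 Z hZ)
        (fun P hP hPF => hLV C hU hG hS P (Finset.mem_union_right _ hP) hPF) (hAD C hU hG hS) g j hgj (h1 g) hj k hk hkh
      rcases ray_dir_of_adapted_down hxax hj hk (by have := hZP.2.1; omega) hZP.2.2
          (hU.2 P (mem_lineRestrict_upper.1 hP).1 j).1 with rfl | rfl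
      · exact ⟨P, hP, hZP⟩
      · exact (hr rfl).elim

/-- the same with the partial level laws: **(DL_h) ⟸ (DL3_h) ∧ (LVN_h) ∧ (LVP3_h)** (KERNEL; (AD) ⟸ (LVP3), (LV) ⟸ (LVN) ∧ (LVP3)). -/
theorem downLineLaw_of_dl3_partial {h : ℤ} (hN : LevelNLaw h) (hP : LevelP3Law h) (h3 : DownLineLaw3 h) : DownLineLaw h :=
  downLineLaw_of_dl3 (levelLaw_of_partial hN hP) (apexDropLaw_of_levelP3 hP) h3

/-- **(T₈) ⟸ CD₈ ∧ LV₈ ∧ AD₈ ∧ DL3₈ ∧ OL₈** (KERNEL; OL₈ = the line theorem, displayed). -/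
theorem seedB1Odd_eight_of_dl3 (hCD : ChargeDepthLaw 8) (hLV : LevelLaw 8) (hAD : ApexDropLaw 8) (h3 : DownLineLaw3 8)
    (hOL : OddLineFree 8) : SeedB1OddDiamondG1H1 8 :=
  seedB1Odd_eight_of_downLine (floorDepthLaw_of_level_chargeDepth hLV hCD) (downLineLaw_of_dl3 hLV hAD h3) hOL

/-- **(T₈) ⟸ CD₈ ∧ LVN₈ ∧ LVP3₈ ∧ DL3₈ ∧ OL₈** (KERNEL, partial-level form). -/
theorem seedB1Odd_eight_of_dl3_partial (hCD : ChargeDepthLaw 8) (hN : LevelNLaw 8) (hP : LevelP3Law 8) (h3 : DownLineLaw3 8)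
    (hOL : OddLineFree 8) : SeedB1OddDiamondG1H1 8 :=
  seedB1Odd_eight_of_dl3 hCD (levelLaw_of_partial hN hP) (apexDropLaw_of_levelP3 hP) h3 hOL

/-- **LEVEL ∧ NEST ∧ APEX-DROP ∧ DL3 ∧ odd-line-freeness below `h` ⇒ (T_h)** (KERNEL master reduction, v1.7 form). -/
theorem seedB1Odd_of_level_nest_dl3 {h : ℤ} (hLV : LevelLaw h) (hN : NestLaw h) (hLV' : ∀ h' ≤ h, LevelLaw h')
    (hAD : ∀ h' ≤ h, ApexDropLaw h') (h3 : ∀ h' ≤ h, DownLineLaw3 h') (hOL : ∀ h' ≤ h, OddLineFree h') : SeedB1OddDiamondG1H1 h :=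
  seedB1Odd_of_level_nest_downLine hLV hN (fun h' hh => downLineLaw_of_dl3 (hLV' h' hh) (hAD h' hh) (h3 h' hh)) hOL

/-! ## §20 (v1.8) THE FIRST STEP INTO THE 3-CHARGED LAYER -/

/-- three distinct charged slots give `chargeCount ≥ 3`. -/
theorem three_le_chargeCount {Z : MCell} {a b c : Fin 4} (hab : a ≠ b) (hac : a ≠ c) (hbc : b ≠ c) (ha : (Z a).2 ≠ (0, 0))
    (hb : (Z b).2 ≠ (0, 0)) (hc : (Z c).2 ≠ (0, 0)) : 3 ≤ chargeCount Z := by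
  unfold chargeCount
  have h3 : ({a, b, c} : Finset (Fin 4)).card = 3 := Finset.card_eq_three.mpr ⟨a, b, c, hab, hac, hbc, rfl⟩
  calc 3 = ({a, b, c} : Finset (Fin 4)).card := h3.symm
    _ ≤ _ := Finset.card_le_card (by
      intro f hf
      simp only [Finset.mem_insert, Finset.mem_singleton] at hf
      rcases hf with rfl | rfl | rfl <;> simp [ha, hb, hc])

/-- a cell with a ceiling letter and a letter off the ceiling is not level. -/
theorem not_levelCell_of_offCeiling {h : ℤ} {P : MCell} {σ₀ σ₁ : Fin 4} (h0 : OnCeiling h (P σ₀)) (h1 : ¬ OnCeiling h (P σ₁)) :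
    ¬ LevelCell P := fun hL => h1 (by
  have e : causalTop (P σ₁) = causalTop (P σ₀) := hL σ₁ σ₀
  show (P σ₁).1 + absCharge (P σ₁) = h
  simp only [causalTop] at e
  rw [e]; exact h0)

/-- **DOWN-LINE SERVICE OR A TOP-DROP** (KERNEL, every `h`). -/
theorem dl_or_topDrop {h : ℤ} {C : MConfig} (hU : C.InDiamond h) {Z : MCell} (hZ : Z ∈ C.lower) (hD : RuleDMu4N C Z)
    {σ₀ σ₁ : Fin 4} (hσ : σ₀ ≠ σ₁) (hna₀ : ¬ isApex (Z σ₀)) (hna₁ : ¬ isApex (Z σ₁))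
    {k : Fin 4} (hk : Adapted (Z σ₀) k) (hkh : coord (Z σ₀) k ≠ h) {m : Fin 4} (hm : Adapted (Z σ₁) m) (hmh : coord (Z σ₁) m = h) :
    MServedBelow C Z σ₀ k ∨ MServedBelow C Z σ₁ m ∨ MCoverBelow C Z σ₀ k σ₁ m := by
  have hne : coord (Z σ₀) k ≠ coord (Z σ₁) m := by rw [hmh]; exact hkh
  have hax₀ := (hU.1 Z hZ σ₀).1
  have hax₁ := (hU.1 Z hZ σ₁).1
  rcases hD σ₀ σ₁ hσ k m hk hm hne with ⟨r, hr, P, hP, hZP⟩ | ⟨r, hr, P, hP, hZP⟩ | ⟨a, b, ha, hb, hcov⟩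
  · rcases ray_dir_of_adapted_down hax₀ hna₀ hk (by have := hZP.2.1; omega) hZP.2.2 (hU.2 P hP σ₀).1 with rfl | rfl
    · exact Or.inl ⟨P, hP, hZP⟩
    · exact (hr rfl).elim
  · rcases ray_dir_of_adapted_down hax₁ hna₁ hm (by have := hZP.2.1; omega) hZP.2.2 (hU.2 P hP σ₁).1 with rfl | rfl
    · exact Or.inr (Or.inl ⟨P, hP, hZP⟩)
    · exact (hr rfl).elim
  · have ha' : a = k := by
      rcases ha with e | ⟨hap, _⟩
      · exact e
      · exact (hna₀ hap).elim
    have hb' : b = m := by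
      rcases hb with e | ⟨hap, _⟩
      · exact e
      · exact (hna₁ hap).elim
    subst ha' hb'
    exact Or.inr (Or.inr hcov)

/-- the new letter of a server strictly below a charged CEILING letter along its top direction lies OFF the ceiling (in the interior of ◇_h). -/
theorem topDrop_not_onCeiling {h : ℤ} {C : MConfig} (hU : C.InDiamond h) {Z P : MCell} (hZ : Z ∈ C.lower) (hP : P ∈ C.upper) {σ₁ m : Fin 4}
    (hc : OnCeiling h (Z σ₁)) (hna : ¬ isApex (Z σ₁)) (hm : Adapted (Z σ₁) m) (hmh : coord (Z σ₁) m = h)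
    (hlt : (P σ₁).1 < (Z σ₁).1) (hray : Z σ₁ = ray (P σ₁) m ((Z σ₁).1 - (P σ₁).1)) : ¬ OnCeiling h (P σ₁) := fun hPc =>
  not_onCeiling_below_top hc (hU.1 Z hZ σ₁).1 hna hm hmh (fin4_ne_add_two m) (by omega) hray (hU.2 P hP σ₁).1 hPc

/-- **AT A 3-CHARGED CEILING HEAD, (LVP3) LEAVES ONLY THE APEX-DROPS** (KERNEL, every `h`). -/
theorem dl_or_apexDrop_of_levelP3 {h : ℤ} {C : MConfig} (hU : C.InDiamond h) {Z : MCell} (hZ : Z ∈ C.lower) (hD : RuleDMu4N C Z)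
    (hLV3 : ∀ P ∈ C.upper, 3 ≤ chargeCount P → LevelCell P) (hZc : ∀ j, OnCeiling h (Z j))
    {σ₀ σ₁ σ₂ : Fin 4} (h01 : σ₀ ≠ σ₁) (h02 : σ₀ ≠ σ₂) (h12 : σ₁ ≠ σ₂)
    (hna₀ : ¬ isApex (Z σ₀)) (hna₁ : ¬ isApex (Z σ₁)) (hna₂ : ¬ isApex (Z σ₂))
    {k : Fin 4} (hk : Adapted (Z σ₀) k) (hkh : coord (Z σ₀) k ≠ h) {m : Fin 4} (hm : Adapted (Z σ₁) m) (hmh : coord (Z σ₁) m = h) :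
    MServedBelow C Z σ₀ k ∨
      (∃ P ∈ C.upper, UPartner Z P σ₁ m ∧ isApex (P σ₁) ∧ ¬ OnCeiling h (P σ₁)) ∨
      (∃ P ∈ C.upper, MAgree2 P Z σ₀ σ₁ ∧ (P σ₀).1 < (Z σ₀).1 ∧ Z σ₀ = ray (P σ₀) k ((Z σ₀).1 - (P σ₀).1) ∧
        (P σ₁).1 < (Z σ₁).1 ∧ Z σ₁ = ray (P σ₁) m ((Z σ₁).1 - (P σ₁).1) ∧ isApex (P σ₁) ∧ ¬ OnCeiling h (P σ₁)) := by
  -- a server with `σ₁` off the ceiling, `σ₂` unchanged and `σ₀` charged has its `σ₁`-letter an apex, by (LVP3)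
  have apx : ∀ P ∈ C.upper, P σ₂ = Z σ₂ → ¬ isApex (P σ₀) → ¬ OnCeiling h (P σ₁) → isApex (P σ₁) := by
    intro P hP h2 h0 hoff
    by_contra h1
    have h3 : 3 ≤ chargeCount P := three_le_chargeCount h01 h02 h12 (snd_ne_of_not_isApex h0) (snd_ne_of_not_isApex h1)
      (by rw [h2]; exact snd_ne_of_not_isApex hna₂)
    exact not_levelCell_of_offCeiling (σ₀ := σ₂) (σ₁ := σ₁) (by rw [h2]; exact hZc σ₂) hoff (hLV3 P hP h3)
  rcases dl_or_topDrop hU hZ hD h01 hna₀ hna₁ hk hkh hm hmh with hDL | ⟨P, hP, hZP⟩ | ⟨P, hP, hag2, hl0, hr0, hl1, hr1⟩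
  · exact Or.inl hDL
  · have hoff := topDrop_not_onCeiling hU hZ hP (hZc σ₁) hna₁ hm hmh hZP.2.1 hZP.2.2
    exact Or.inr (Or.inl ⟨P, hP, hZP, apx P hP (hZP.1 σ₂ h12.symm) (by rw [hZP.1 σ₀ h01]; exact hna₀) hoff, hoff⟩)
  · have hoff := topDrop_not_onCeiling hU hZ hP (hZc σ₁) hna₁ hm hmh hl1 hr1
    have h0 : ¬ isApex (P σ₀) := not_isApex_below_node hr0 (hZc σ₀) (by omega) hkh
    exact Or.inr (Or.inr ⟨P, hP, hag2, hl0, hr0, hl1, hr1, apx P hP (hag2 σ₂ h02.symm h12.symm) h0 hoff, hoff⟩)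

/-! ## §21 (v1.9) THE 3-CHARGED LAYER AT COMPANION NODE LEVEL ≤ 7 -/

/-! ### apex-ray geometry -/

/-- an apex letter is adapted to every frame. -/
theorem adapted_of_isApex {x : BPoint} (hap : isApex x) (k : Fin 4) : Adapted x k := by
  obtain ⟨α, a, b⟩ := x
  obtain ⟨ha, hb⟩ := hap
  simp only at ha hb; subst ha; subst hb
  fin_cases k <;> simp [Adapted]

/-- the coordinates of an apex letter all equal `α`. -/
theorem coord_of_isApex {x : BPoint} (hap : isApex x) (k : Fin 4) : coord x k = x.1 := by
  obtain ⟨α, a, b⟩ := x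
  obtain ⟨ha, hb⟩ := hap
  simp only at ha hb; subst ha; subst hb
  fin_cases k <;> simp [coord]

theorem eq_of_isApex {x : BPoint} (hap : isApex x) : x = (x.1, 0, 0) := by
  obtain ⟨α, a, b⟩ := x
  obtain ⟨ha, hb⟩ := hap
  simp only at ha hb; subst ha; subst hb; rfl

/-- `d ≥ 0` null steps up from an apex `aI`: causal top `a + 2d`, node level `a`, charged iff `d ≠ 0`, adapted to the step direction …. -/
theorem top_ray_apex (a : ℤ) (m : Fin 4) {d : ℤ} (hd : 0 ≤ d) :
    (ray ((a, 0, 0) : BPoint) m d).1 + absCharge (ray ((a, 0, 0) : BPoint) m d) = a + 2 * d := by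
  fin_cases m <;> simp [absCharge, chargeOf] <;> (simp only [abs_eq_max_neg, max_def]; split_ifs <;> omega)

theorem nodeLevel_ray_apex (a : ℤ) (m : Fin 4) {d : ℤ} (hd : 0 ≤ d) : nodeLevel (ray ((a, 0, 0) : BPoint) m d) = a := by
  unfold nodeLevel
  fin_cases m <;> simp [absCharge, chargeOf] <;> (simp only [abs_eq_max_neg, max_def]; split_ifs <;> omega)

theorem snd_ne_ray_apex (a : ℤ) (m : Fin 4) {d : ℤ} (hd : d ≠ 0) : (ray ((a, 0, 0) : BPoint) m d).2 ≠ (0, 0) := by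
  fin_cases m <;> simp [hd]

theorem adapted_ray_apex (a : ℤ) (m : Fin 4) (d : ℤ) :
    Adapted (ray ((a, 0, 0) : BPoint) m d) m ∧ Adapted (ray ((a, 0, 0) : BPoint) m d) (m + 2) := by
  fin_cases m <;> simp [Adapted]

theorem coord_ray_apex_antip (a : ℤ) (m : Fin 4) (d : ℤ) : coord (ray ((a, 0, 0) : BPoint) m d) (m + 2) = a := by
  rw [coord_ray_antip, coord_of_isApex ⟨rfl, rfl⟩]

theorem eq_ray_neg {x y : BPoint} {k : Fin 4} {e : ℤ} (h : x = ray y k e) : y = ray x k (-e) := by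
  obtain ⟨α, a, b⟩ := y
  subst h
  fin_cases k <;> simp [ray]

/-- TURNING below an apex: `(aI − e·n_r) + s·n_{r+2} = (a − 2e)I + (e + s)·n_{r+2}`. -/
theorem ray_turn (a e s : ℤ) (r : Fin 4) :
    ray (ray ((a, 0, 0) : BPoint) r (-e)) (r + 2) s = ray ((a - 2 * e, 0, 0) : BPoint) (r + 2) (e + s) := by
  fin_cases r <;> simp [ray] <;> omega

theorem ray_left_cancel {x y : BPoint} {k : Fin 4} {e : ℤ} (h : ray x k e = ray y k e) : x = y := by
  obtain ⟨α, a, b⟩ := x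
  obtain ⟨β, c, d⟩ := y
  simp only [ray, Prod.mk.injEq] at h
  obtain ⟨h1, h2, h3⟩ := h
  simp only [Prod.mk.injEq]
  refine ⟨by omega, by omega, by omega⟩

theorem ray_apex_dir_inj {a e : ℤ} {r₁ r₂ : Fin 4} (he : e ≠ 0)
    (h : ray ((a, 0, 0) : BPoint) r₁ e = ray ((a, 0, 0) : BPoint) r₂ e) : r₁ = r₂ := by
  fin_cases r₁ <;> fin_cases r₂ <;> simp [ray] at h ⊢ <;> omega

/-- the causal top of a point at or below an apex `aI` on a null ray is `a`; below an INTERIOR apex it is off the ceiling. -/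
theorem onCeiling_below_apex {a : ℤ} {y : BPoint} {r : Fin 4} {e : ℤ} (he : 0 ≤ e) (hy : ((a, 0, 0) : BPoint) = ray y r e) :
    OnCeiling a y :=
  onCeiling_between hy (ray_zero y r).symm he

theorem not_onCeiling_below_interiorApex {a h : ℤ} {y : BPoint} {r : Fin 4} {e : ℤ} (he : 0 ≤ e)
    (hy : ((a, 0, 0) : BPoint) = ray y r e) (hah : a ≠ h) : ¬ OnCeiling h y :=
  fun h' => hah ((onCeiling_below_apex he hy).symm.trans h')

/-! ### `Δ` (the `G₁` symmetry `β ↦ iβ` on every factor, `Pad4TowerDeltaWindow`) on letters, rays and partners -/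

theorem mdelta_apply (Z : MCell) (f : Fin 4) : Z.delta f = deltaPt (Z f) := rfl

theorem deltaPt_fst (x : BPoint) : (deltaPt x).1 = x.1 := rfl

theorem deltaPt_of_isApex {x : BPoint} (hap : isApex x) : deltaPt x = x := by
  obtain ⟨α, a, b⟩ := x
  obtain ⟨ha, hb⟩ := hap
  simp only at ha hb; subst ha; subst hb
  simp [deltaPt]

/-- `Δ` turns null directions: `Δ(x + e·n_k) = Δx + e·n_{k+3}`. -/
theorem deltaPt_ray (x : BPoint) (k : Fin 4) (e : ℤ) : deltaPt (ray x k e) = ray (deltaPt x) (k + 3) e := by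
  obtain ⟨α, a, b⟩ := x
  fin_cases k <;> simp [deltaPt, ray] <;> omega

/-- the four `Δ`-rotates of an apex ray exhaust the apex rays of the same apex and length. -/
theorem deltaPt_align (a e : ℤ) (r₁ r₂ : Fin 4) :
    ray ((a, 0, 0) : BPoint) r₁ e = ray ((a, 0, 0) : BPoint) r₂ e ∨
      ray ((a, 0, 0) : BPoint) r₁ e = deltaPt (ray ((a, 0, 0) : BPoint) r₂ e) ∨
      ray ((a, 0, 0) : BPoint) r₁ e = deltaPt (deltaPt (ray ((a, 0, 0) : BPoint) r₂ e)) ∨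
      ray ((a, 0, 0) : BPoint) r₁ e = deltaPt (deltaPt (deltaPt (ray ((a, 0, 0) : BPoint) r₂ e))) := by
  fin_cases r₁ <;> fin_cases r₂ <;> simp [deltaPt, ray]

/-- `Δ`, `Δ²`, `Δ³` move every charged letter. -/
theorem deltaPt_ne_self₁ {x : BPoint} (hx : x.2 ≠ (0, 0)) : deltaPt x ≠ x := by
  obtain ⟨α, a, b⟩ := x
  simp only [deltaPt, ne_eq, Prod.mk.injEq] at hx ⊢
  omega

theorem deltaPt_ne_self₂ {x : BPoint} (hx : x.2 ≠ (0, 0)) : deltaPt (deltaPt x) ≠ x := by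
  obtain ⟨α, a, b⟩ := x
  simp only [deltaPt, ne_eq, Prod.mk.injEq] at hx ⊢
  omega

theorem deltaPt_ne_self₃ {x : BPoint} (hx : x.2 ≠ (0, 0)) : deltaPt (deltaPt (deltaPt x)) ≠ x := by
  obtain ⟨α, a, b⟩ := x
  simp only [deltaPt, ne_eq, Prod.mk.injEq] at hx ⊢
  omega

/-- `Δ` transports partners: `Z = P + d·n_k` on `σ` ⇒ `ΔZ = ΔP + d·n_{k+3}` on `σ`. -/
theorem uPartner_delta {Z P : MCell} {σ k : Fin 4} (hZP : UPartner Z P σ k) : UPartner Z.delta P.delta σ (k + 3) := by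
  refine ⟨fun g hg => ?_, ?_, ?_⟩
  · show deltaPt (P g) = deltaPt (Z g); rw [hZP.1 g hg]
  · show (deltaPt (P σ)).1 < (deltaPt (Z σ)).1
    simp only [deltaPt_fst]; exact hZP.2.1
  · show deltaPt (Z σ) = ray (deltaPt (P σ)) (k + 3) ((deltaPt (Z σ)).1 - (deltaPt (P σ)).1)
    simp only [deltaPt_fst]; rw [← deltaPt_ray, ← hZP.2.2]

/-! ### the chain -/

/-- **CLIMB TO THE APEX** (KERNEL, every `h`; (UL) iterated). -/
theorem climb_to_apex {h : ℤ} {C : MConfig} (hU : C.InDiamond h) (hDP : ∀ P ∈ C.upper, RuleDMu4P C P)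
    (hLVN : ∀ X ∈ C.lower, 2 ≤ chargeCount X → LevelCell X) {P : MCell} (hP : P ∈ C.upper) {g j τ o : Fin 4}
    (hgj : g ≠ j) (hgc : OnCeiling h (P g)) (hτj : τ ≠ j) (hτ : (P τ).2 ≠ (0, 0)) (hoj : o ≠ j) (ho : ¬ OnCeiling h (P o))
    (hjc : OnCeiling h (P j)) (hj : ¬ isApex (P j)) {k : Fin 4} (hk : Adapted (P j) k) (hkh : coord (P j) k ≠ h) :
    ∃ N ∈ C.lower, UPartner N P j k ∧ N j = (h, 0, 0) := by
  obtain ⟨N, hN, hNP⟩ := upLine_of_ruleDMu4P hU hP (hDP P hP) hgj hgc hj hk hkh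
  have hNc : OnCeiling h (N j) := onCeiling_of_ray_up hjc (hU.1 N hN j) k (by have := hNP.2.1; omega) hNP.2.2
  refine ⟨N, hN, hNP, eq_ceilingApex ?_ hNc⟩
  by_contra hna
  have h2 : 2 ≤ chargeCount N := two_le_chargeCount hτj.symm (snd_ne_of_not_isApex hna) (by rw [← hNP.1 τ hτj]; exact hτ)
  have hNo : ¬ OnCeiling h (N o) := by rw [← hNP.1 o hoj]; exact ho
  exact not_levelCell_of_offCeiling hNc hNo (hLVN N hN h2)

/-- **THE APEX-DROP NODE** (KERNEL, every `h`). -/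
theorem apexDrop_node {h : ℤ} {C : MConfig} (hU : C.InDiamond h) (hDN : ∀ Z ∈ C.lower, RuleDMu4N C Z)
    (hDP : ∀ P ∈ C.upper, RuleDMu4P C P) (hLVN : ∀ X ∈ C.lower, 2 ≤ chargeCount X → LevelCell X)
    (hLV3 : ∀ P ∈ C.upper, 3 ≤ chargeCount P → LevelCell P) {T : MCell} (hT : T ∈ C.lower) (hTc : ∀ j, OnCeiling h (T j))
    {σ₀ σ₁ σ₂ : Fin 4} (h01 : σ₀ ≠ σ₁) (h02 : σ₀ ≠ σ₂) (h12 : σ₁ ≠ σ₂)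
    (hna₀ : ¬ isApex (T σ₀)) (hna₁ : ¬ isApex (T σ₁)) (hna₂ : ¬ isApex (T σ₂))
    {k : Fin 4} (hk : Adapted (T σ₀) k) (hkh : coord (T σ₀) k ≠ h) (hDL : ¬ MServedBelow C T σ₀ k) :
    ∃ N₁ ∈ C.lower, ∃ P₀ ∈ C.upper, MAgree2 N₁ T σ₀ σ₁ ∧ N₁ σ₀ = (h, 0, 0) ∧ isApex (N₁ σ₁) ∧ (N₁ σ₁).1 = nodeLevel (T σ₁) ∧
      UPartner N₁ P₀ σ₀ k := by
  have hax₀ := (hU.1 T hT σ₀).1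
  have hax₁ := (hU.1 T hT σ₁).1
  obtain ⟨m, hm, hmh⟩ := exists_top_dir (hTc σ₁) hax₁
  -- the apex below `x_{σ₁}` along its top direction is its node apex
  have low : ∀ P : MCell, (P σ₁).1 < (T σ₁).1 → T σ₁ = ray (P σ₁) m ((T σ₁).1 - (P σ₁).1) → isApex (P σ₁) →
      (P σ₁).1 = nodeLevel (T σ₁) := fun P hlt hray hap => by
    have e := top_ray_apex (P σ₁).1 m (d := (T σ₁).1 - (P σ₁).1) (by omega)
    rw [← eq_of_isApex hap, ← hray] at e
    have hc : (T σ₁).1 + absCharge (T σ₁) = h := hTc σ₁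
    unfold nodeLevel; omega
  rcases dl_or_apexDrop_of_levelP3 hU hT (hDN T hT) hLV3 hTc h01 h02 h12 hna₀ hna₁ hna₂ hk hkh hm hmh with
      hdl | ⟨P, hP, hTP, hap, hoff⟩ | ⟨P, hP, hag2, hl0, hr0, hl1, hr1, hap, hoff⟩
  · exact (hDL hdl).elim
  · -- top-drop `P = T(σ₁ ↦ aI)`: climb `x_{σ₀}` to the apex
    have hP0 : P σ₀ = T σ₀ := hTP.1 σ₀ h01
    have hP2 : P σ₂ = T σ₂ := hTP.1 σ₂ h12.symm
    obtain ⟨N₁, hN₁, hNP, hN0⟩ := climb_to_apex hU hDP hLVN hP (g := σ₂) (j := σ₀) (τ := σ₂) (o := σ₁) h02.symm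
      (by rw [hP2]; exact hTc σ₂) h02.symm (by rw [hP2]; exact snd_ne_of_not_isApex hna₂) h01.symm hoff
      (by rw [hP0]; exact hTc σ₀) (by rw [hP0]; exact hna₀) (by rw [hP0]; exact hk) (by rw [hP0]; exact hkh)
    refine ⟨N₁, hN₁, P, hP, fun i hi0 hi1 => (hNP.1 i hi0).symm.trans (hTP.1 i hi1), hN0, ?_, ?_, hNP⟩
    · rw [← hNP.1 σ₁ h01.symm]; exact hap
    · rw [← hNP.1 σ₁ h01.symm]; exact low P hTP.2.1 hTP.2.2 hap
  · -- cover `P = T(σ₀ ↦ x⁻, σ₁ ↦ aI)`: its `σ₀`-letter is a charged ceiling letter on the `k`-ray; climb it to the apex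
    have hPax := (hU.2 P hP σ₀).1
    obtain ⟨hPc, hPna, hPk, -, hPkh⟩ := onRayBelow_props (hTc σ₀) hax₀ hna₀ hk hkh hPax (Or.inr ⟨hl0, hr0⟩)
    have hP2 : P σ₂ = T σ₂ := hag2 σ₂ h02.symm h12.symm
    obtain ⟨N₁, hN₁, hNP, hN0⟩ := climb_to_apex hU hDP hLVN hP (g := σ₂) (j := σ₀) (τ := σ₂) (o := σ₁) h02.symm
      (by rw [hP2]; exact hTc σ₂) h02.symm (by rw [hP2]; exact snd_ne_of_not_isApex hna₂) h01.symm hoff hPc hPna hPk hPkh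
    refine ⟨N₁, hN₁, P, hP, fun i hi0 hi1 => (hNP.1 i hi0).symm.trans (hag2 i hi0 hi1), hN0, ?_, ?_, hNP⟩
    · rw [← hNP.1 σ₁ h01.symm]; exact hap
    · rw [← hNP.1 σ₁ h01.symm]; exact low P hl1 hr1 hap

/-- **CHILDREN OF THE INTERIOR APEX** (KERNEL, every `h`). -/
theorem interiorApex_settled {h : ℤ} {C : MConfig} (hU : C.InDiamond h) (hDN : ∀ Z ∈ C.lower, RuleDMu4N C Z) (hX : XPlusClosed C)
    (hLVN : ∀ X ∈ C.lower, 2 ≤ chargeCount X → LevelCell X) (hLV3 : ∀ P ∈ C.upper, 3 ≤ chargeCount P → LevelCell P)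
    {N₁ : MCell} (hN₁ : N₁ ∈ C.lower) {σ₀ σ₁ σ₂ f : Fin 4} (h01 : σ₀ ≠ σ₁) (h02 : σ₀ ≠ σ₂) (h12 : σ₁ ≠ σ₂) (hf0 : f ≠ σ₀)
    (hg : N₁ σ₀ = (h, 0, 0)) (hf : N₁ f = (h, 0, 0)) (hap₁ : isApex (N₁ σ₁)) (hlow : (N₁ σ₁).1 < h)
    (hc₂ : OnCeiling h (N₁ σ₂)) (hna₂ : ¬ isApex (N₁ σ₂)) {P₀ : MCell} (hP₀ : P₀ ∈ C.upper) {k : Fin 4} (h0 : UPartner N₁ P₀ σ₀ k)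
    (k' : Fin 4) : ∃ r, r ≠ k' + 2 ∧ MServedBelow C N₁ σ₁ r := by
  have hoff₁ : ¬ OnCeiling h (N₁ σ₁) := fun hc => by
    have e := coord_apex_onCeiling hap₁ hc 0
    rw [coord_of_isApex hap₁] at e
    omega
  -- the twins `N₁(σ₀ ↦ y)`, `y` a charged ceiling letter, are non-level `N`-cells with two charged letters
  have hNT : ∀ X ∈ C.lower, MAgree X N₁ σ₀ → ¬ isApex (X σ₀) → OnCeiling h (X σ₀) → False := fun X hXl hag hna hc => by
    have hX1 : ¬ OnCeiling h (X σ₁) := by rw [hag σ₁ h01.symm]; exact hoff₁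
    exact not_levelCell_of_offCeiling hc hX1
      (hLVN X hXl (two_le_chargeCount h02 (snd_ne_of_not_isApex hna) (by rw [hag σ₂ h02.symm]; exact snd_ne_of_not_isApex hna₂)))
  have hadg : Adapted (N₁ σ₀) (k + 2) := by rw [hg]; fin_cases k <;> simp [Adapted]
  have hcg : coord (N₁ σ₀) (k + 2) = h :=
    coord_apex_onCeiling (by rw [hg]; exact ⟨rfl, rfl⟩) (by rw [hg]; exact onCeiling_apex h) _
  have hc1 : coord (N₁ σ₁) k' = (N₁ σ₁).1 := coord_of_isApex hap₁ k'
  have hne : coord (N₁ σ₀) (k + 2) ≠ coord (N₁ σ₁) k' := by rw [hcg, hc1]; omega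
  rcases hDN N₁ hN₁ σ₀ σ₁ h01 (k + 2) k' hadg (adapted_of_isApex hap₁ k') hne with
      ⟨r, hr, P₁, hP₁, h1⟩ | hset | ⟨a, b, -, -, P, hP, hag2, hl0, hr0, hl1, hr1⟩
  · rw [fin4_add_two_add_two] at hr
    exact (xplus_two_children_gen hU hX hN₁ hf0 hg hf hP₀ hP₁ hr h0 h1 hNT).elim
  · exact hset
  · exfalso
    have hr0' : ((h, 0, 0) : BPoint) = ray (P σ₀) a ((N₁ σ₀).1 - (P σ₀).1) := by rw [← hg]; exact hr0
    have hr1' : (((N₁ σ₁).1, 0, 0) : BPoint) = ray (P σ₁) b ((N₁ σ₁).1 - (P σ₁).1) := by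
      rw [← eq_of_isApex hap₁]; exact hr1
    have hna0' : ¬ isApex (P σ₀) := not_isApex_below_apex (by omega) hr0'
    have hna1' : ¬ isApex (P σ₁) := not_isApex_below_apex (by omega) hr1'
    have hP2 : P σ₂ = N₁ σ₂ := hag2 σ₂ h02.symm h12.symm
    have h3 : 3 ≤ chargeCount P := three_le_chargeCount h01 h02 h12 (snd_ne_of_not_isApex hna0') (snd_ne_of_not_isApex hna1')
      (by rw [hP2]; exact snd_ne_of_not_isApex hna₂)
    have hPc2 : OnCeiling h (P σ₂) := by rw [hP2]; exact hc₂
    exact not_levelCell_of_offCeiling hPc2 (not_onCeiling_below_interiorApex (by omega) hr1' (by omega)) (hLV3 P hP h3)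

/-- **THE DEPTH OF A CHILD OF THE INTERIOR APEX** (KERNEL, every `h`). -/
theorem child_depth {h : ℤ} {C : MConfig} (hU : C.InDiamond h) (hDP : ∀ P ∈ C.upper, RuleDMu4P C P)
    (hLVN : ∀ X ∈ C.lower, 2 ≤ chargeCount X → LevelCell X)
    (hCDN : ∀ Z ∈ C.lower, LevelCell Z → ∀ f, (Z f).2 ≠ (0, 0) → 2 * (chargeCount Z : ℤ) ≤ nodeLevel (Z f))
    {N₁ : MCell} {σ₁ σ₂ : Fin 4} (h12 : σ₁ ≠ σ₂) (hap₁ : isApex (N₁ σ₁)) (hlow : (N₁ σ₁).1 < h)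
    (hc₂ : OnCeiling h (N₁ σ₂)) (hna₂ : ¬ isApex (N₁ σ₂)) {P : MCell} (hP : P ∈ C.upper) {r : Fin 4} (hNP : UPartner N₁ P σ₁ r) :
    4 + 2 * ((N₁ σ₁).1 - (P σ₁).1) ≤ (N₁ σ₁).1 := by
  have hP2 : P σ₂ = N₁ σ₂ := hNP.1 σ₂ h12.symm
  obtain ⟨e, he0, hed, hapex⟩ : ∃ e, 0 < e ∧ e = (N₁ σ₁).1 - (P σ₁).1 ∧ (((N₁ σ₁).1, 0, 0) : BPoint) = ray (P σ₁) r e :=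
    ⟨_, by have := hNP.2.1; omega, rfl, by rw [← eq_of_isApex hap₁]; exact hNP.2.2⟩
  have hy : P σ₁ = ray (((N₁ σ₁).1, 0, 0) : BPoint) r (-e) := eq_ray_neg hapex
  -- UL at `σ₁` in the turning direction `r + 2`
  have hk : Adapted (P σ₁) (r + 2) := by rw [hy]; exact (adapted_ray_apex _ r _).2
  have hkh : coord (P σ₁) (r + 2) ≠ h := by rw [hy, coord_ray_apex_antip]; omega
  obtain ⟨N, hN, hNP'⟩ :=
    upLine_of_ruleDMu4P hU hP (hDP P hP) h12.symm (by rw [hP2]; exact hc₂) (not_isApex_below_apex he0 hapex) hk hkh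
  obtain ⟨s, hs0, hNs⟩ : ∃ s, 0 < s ∧ N σ₁ = ray (P σ₁) (r + 2) s := ⟨_, by have := hNP'.2.1; omega, hNP'.2.2⟩
  have hNσ : N σ₁ = ray (((N₁ σ₁).1 - 2 * e, 0, 0) : BPoint) (r + 2) (e + s) := by rw [hNs, hy, ray_turn]
  have hch : (N σ₁).2 ≠ (0, 0) := by rw [hNσ]; exact snd_ne_ray_apex _ _ (by omega)
  have h2 : 2 ≤ chargeCount N :=
    two_le_chargeCount h12 hch (by rw [← hNP'.1 σ₂ h12.symm, hP2]; exact snd_ne_of_not_isApex hna₂)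
  have hcd := hCDN N hN (hLVN N hN h2) σ₁ hch
  rw [hNσ, nodeLevel_ray_apex _ _ (by omega)] at hcd
  have h2' : (2 : ℤ) ≤ chargeCount N := by exact_mod_cast h2
  omega

/-- **THE HEAD OF A CHILD** (KERNEL, every `h`). -/
theorem child_head {h : ℤ} {C : MConfig} (hU : C.InDiamond h) (hDP : ∀ P ∈ C.upper, RuleDMu4P C P)
    (hLVN : ∀ X ∈ C.lower, 2 ≤ chargeCount X → LevelCell X)
    {N₁ : MCell} {σ₀ σ₁ σ₂ : Fin 4} (h01 : σ₀ ≠ σ₁) (h02 : σ₀ ≠ σ₂) (h12 : σ₁ ≠ σ₂) (hg : N₁ σ₀ = (h, 0, 0))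
    (hap₁ : isApex (N₁ σ₁)) (hlow : (N₁ σ₁).1 < h) (hc₂ : OnCeiling h (N₁ σ₂)) (hna₂ : ¬ isApex (N₁ σ₂))
    {P : MCell} (hP : P ∈ C.upper) {r : Fin 4} (hNP : UPartner N₁ P σ₁ r) :
    ∃ N₂ ∈ C.lower, ∃ k₂, UPartner N₂ P σ₂ k₂ ∧ N₂ σ₂ = (h, 0, 0) := by
  have hP2 : P σ₂ = N₁ σ₂ := hNP.1 σ₂ h12.symm
  have hP0 : P σ₀ = N₁ σ₀ := hNP.1 σ₀ h01
  have hax₂ := (hU.2 P hP σ₂).1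
  obtain ⟨k₂, hk₂, hck₂⟩ := exists_node_dir hax₂
  have hna : ¬ isApex (P σ₂) := by rw [hP2]; exact hna₂
  have hcP : OnCeiling h (P σ₂) := by rw [hP2]; exact hc₂
  have hkh : coord (P σ₂) k₂ ≠ h := by
    have h1 := absCharge_pos_of_not_isApex hax₂ hna
    have hc : (P σ₂).1 + absCharge (P σ₂) = h := hcP
    omega
  have he0 : 0 < (N₁ σ₁).1 - (P σ₁).1 := by have := hNP.2.1; omega
  have hapex : (((N₁ σ₁).1, 0, 0) : BPoint) = ray (P σ₁) r ((N₁ σ₁).1 - (P σ₁).1) := by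
    rw [← eq_of_isApex hap₁]; exact hNP.2.2
  obtain ⟨N₂, hN₂, h2, hN2⟩ := climb_to_apex hU hDP hLVN hP (g := σ₀) (j := σ₂) (τ := σ₁) (o := σ₁) h02
    (by rw [hP0, hg]; exact onCeiling_apex h) h12 (snd_ne_of_not_isApex (not_isApex_below_apex he0 hapex)) h12
    (not_onCeiling_below_interiorApex (by omega) hapex (by omega)) hcP hna hk₂ hkh
  exact ⟨N₂, hN₂, k₂, h2, hN2⟩

/-- **TWO CHILDREN OF EQUAL DEPTH IN DIFFERENT DIRECTIONS ARE CONTRADICTORY** (KERNEL, every `h`; `Δ ∈ G₁`). -/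
theorem interiorApex_two_children {h : ℤ} {C : MConfig} (hU : C.InDiamond h) (hDP : ∀ P ∈ C.upper, RuleDMu4P C P) (hX : XPlusClosed C)
    (hLVN : ∀ X ∈ C.lower, 2 ≤ chargeCount X → LevelCell X) (hΔl : DeltaClosed C.lower) (hΔu : DeltaClosed C.upper)
    {N₁ : MCell} {σ₀ σ₁ σ₂ f : Fin 4} (h01 : σ₀ ≠ σ₁) (h02 : σ₀ ≠ σ₂) (h12 : σ₁ ≠ σ₂) (hf0 : f ≠ σ₀) (hf1 : f ≠ σ₁) (hf2 : f ≠ σ₂)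
    (hg : N₁ σ₀ = (h, 0, 0)) (hf : N₁ f = (h, 0, 0)) (hap₁ : isApex (N₁ σ₁)) (hlow : (N₁ σ₁).1 < h)
    (hc₂ : OnCeiling h (N₁ σ₂)) (hna₂ : ¬ isApex (N₁ σ₂)) {P₁ P₂ : MCell} (hP₁ : P₁ ∈ C.upper) (hP₂ : P₂ ∈ C.upper)
    {r₁ r₂ : Fin 4} (hr : r₂ ≠ r₁) (h1 : UPartner N₁ P₁ σ₁ r₁) (h2 : UPartner N₁ P₂ σ₁ r₂) (heq : (P₁ σ₁).1 = (P₂ σ₁).1) :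
    False := by
  obtain ⟨N₂, hN₂, k₁, hc1, hN2⟩ := child_head hU hDP hLVN h01 h02 h12 hg hap₁ hlow hc₂ hna₂ hP₁ h1
  obtain ⟨M₂, hM₂, k₂, hc2, hM2⟩ := child_head hU hDP hLVN h01 h02 h12 hg hap₁ hlow hc₂ hna₂ hP₂ h2
  -- the two `σ₁`-letters are apex rays of the same apex and length, in different directions
  obtain ⟨e, he0, hap1, hap2⟩ : ∃ e, 0 < e ∧ (((N₁ σ₁).1, 0, 0) : BPoint) = ray (P₁ σ₁) r₁ e ∧
      (((N₁ σ₁).1, 0, 0) : BPoint) = ray (P₂ σ₁) r₂ e := by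
    refine ⟨(N₁ σ₁).1 - (P₁ σ₁).1, by have := h1.2.1; omega, by rw [← eq_of_isApex hap₁]; exact h1.2.2, ?_⟩
    rw [← eq_of_isApex hap₁, heq]; exact h2.2.2
  have hy1 : P₁ σ₁ = ray (((N₁ σ₁).1, 0, 0) : BPoint) r₁ (-e) := eq_ray_neg hap1
  have hy2 : P₂ σ₁ = ray (((N₁ σ₁).1, 0, 0) : BPoint) r₂ (-e) := eq_ray_neg hap2
  have hy1c : (P₁ σ₁).2 ≠ (0, 0) := snd_ne_of_not_isApex (not_isApex_below_apex he0 hap1)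
  have hy1off : ¬ OnCeiling h (P₁ σ₁) := not_onCeiling_below_interiorApex (by omega) hap1 (by omega)
  -- letters of the two heads
  have hN2σ0 : N₂ σ₀ = (h, 0, 0) := by rw [← hc1.1 σ₀ h02, h1.1 σ₀ h01, hg]
  have hN2f : N₂ f = (h, 0, 0) := by rw [← hc1.1 f hf2, h1.1 f hf1, hf]
  have hN2σ1 : N₂ σ₁ = P₁ σ₁ := (hc1.1 σ₁ h12).symm
  have hM2σ0 : M₂ σ₀ = (h, 0, 0) := by rw [← hc2.1 σ₀ h02, h2.1 σ₀ h01, hg]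
  have hM2f : M₂ f = (h, 0, 0) := by rw [← hc2.1 f hf2, h2.1 f hf1, hf]
  have hM2σ1 : M₂ σ₁ = P₂ σ₁ := (hc2.1 σ₁ h12).symm
  have hxw : P₂ σ₂ = P₁ σ₂ := by rw [h2.1 σ₂ h12.symm, h1.1 σ₂ h12.symm]
  have hxwc : (P₁ σ₂).2 ≠ (0, 0) := by rw [h1.1 σ₂ h12.symm]; exact snd_ne_of_not_isApex hna₂
  -- twins of `N₂` at `σ₂` are (LVN)-dead
  have hNT : ∀ X ∈ C.lower, MAgree X N₂ σ₂ → ¬ isApex (X σ₂) → OnCeiling h (X σ₂) → False := fun X hXl hag hna hc => by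
    have hX1 : ¬ OnCeiling h (X σ₁) := by rw [hag σ₁ h12, hN2σ1]; exact hy1off
    exact not_levelCell_of_offCeiling hc hX1
      (hLVN X hXl (two_le_chargeCount h12.symm (snd_ne_of_not_isApex hna) (by rw [hag σ₁ h12, hN2σ1]; exact hy1c)))
  -- a second child `Q` of `N₂` at `σ₂` with `Q σ₂ ≠ P₁ σ₂` at the same height contradicts `X⁺`
  have clash : ∀ Q ∈ C.upper, ∀ k', UPartner N₂ Q σ₂ k' → (Q σ₂).1 = (P₁ σ₂).1 → Q σ₂ ≠ P₁ σ₂ → False := by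
    intro Q hQ k' hcQ hQ1 hQne
    have hk : k' ≠ k₁ := by
      rintro rfl
      have e1 := hc1.2.2
      have e2 := hcQ.2.2
      rw [hQ1] at e2
      exact hQne (ray_left_cancel (e2.symm.trans e1))
    exact xplus_two_children_gen hU hX hN₂ h02 hN2 hN2σ0 hP₁ hQ hk hc1 hcQ hNT
  -- every cell agreeing with `N₂` off `σ₁` and carrying `P₁ σ₁` at `σ₁` IS `N₂`
  have heqN : ∀ M : MCell, M σ₀ = (h, 0, 0) → M f = (h, 0, 0) → M σ₂ = (h, 0, 0) → M σ₁ = P₁ σ₁ → M = N₂ := by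
    intro M h0 hf' h2' h1'
    funext i
    by_cases hi : i = σ₁
    · rw [hi, h1', hN2σ1]
    · rcases fin4_other h02.symm hf2.symm h12.symm hf0.symm h01 hf1 hi with rfl | rfl | rfl
      · rw [h2', hN2]
      · rw [h0, hN2σ0]
      · rw [hf', hN2f]
  -- align `y₂` onto `y₁` by a power of `Δ`
  rcases deltaPt_align (N₁ σ₁).1 (-e) r₁ r₂ with e0 | e1 | e2 | e3
  · -- `j = 0`: the same child letter, hence the same direction
    exact hr (ray_apex_dir_inj (by omega) e0).symm
  · -- `j = 1`
    have hQ := hΔu P₂ hP₂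
    have hM := hΔl M₂ hM₂
    have hMN : M₂.delta = N₂ := heqN _ (by rw [mdelta_apply, hM2σ0]; rfl) (by rw [mdelta_apply, hM2f]; rfl)
      (by rw [mdelta_apply, hM2]; rfl) (by rw [mdelta_apply, hM2σ1, hy2, ← e1, ← hy1])
    obtain hcQ := uPartner_delta hc2
    rw [hMN] at hcQ
    exact clash _ hQ _ hcQ (by rw [mdelta_apply, deltaPt_fst, hxw]) (by rw [mdelta_apply, hxw]; exact deltaPt_ne_self₁ hxwc)
  · -- `j = 2`
    have hQ := hΔu _ (hΔu P₂ hP₂)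
    have hM := hΔl _ (hΔl M₂ hM₂)
    have hMN : M₂.delta.delta = N₂ := heqN _ (by rw [mdelta_apply, mdelta_apply, hM2σ0]; rfl)
      (by rw [mdelta_apply, mdelta_apply, hM2f]; rfl) (by rw [mdelta_apply, mdelta_apply, hM2]; rfl)
      (by rw [mdelta_apply, mdelta_apply, hM2σ1, hy2, ← e2, ← hy1])
    obtain hcQ := uPartner_delta (uPartner_delta hc2)
    rw [hMN] at hcQ
    exact clash _ hQ _ hcQ (by rw [mdelta_apply, mdelta_apply, deltaPt_fst, deltaPt_fst, hxw])
      (by rw [mdelta_apply, mdelta_apply, hxw]; exact deltaPt_ne_self₂ hxwc)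
  · -- `j = 3`
    have hQ := hΔu _ (hΔu _ (hΔu P₂ hP₂))
    have hM := hΔl _ (hΔl _ (hΔl M₂ hM₂))
    have hMN : M₂.delta.delta.delta = N₂ := heqN _ (by rw [mdelta_apply, mdelta_apply, mdelta_apply, hM2σ0]; rfl)
      (by rw [mdelta_apply, mdelta_apply, mdelta_apply, hM2f]; rfl) (by rw [mdelta_apply, mdelta_apply, mdelta_apply, hM2]; rfl)
      (by rw [mdelta_apply, mdelta_apply, mdelta_apply, hM2σ1, hy2, ← e3, ← hy1])
    obtain hcQ := uPartner_delta (uPartner_delta (uPartner_delta hc2))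
    rw [hMN] at hcQ
    exact clash _ hQ _ hcQ (by rw [mdelta_apply, mdelta_apply, mdelta_apply, deltaPt_fst, deltaPt_fst, deltaPt_fst, hxw])
      (by rw [mdelta_apply, mdelta_apply, mdelta_apply, hxw]; exact deltaPt_ne_self₃ hxwc)

/-- **(DL) AT THE 3-CHARGED HEADS WHOSE COMPANION HAS NODE LEVEL ≤ 7** (KERNEL, every `h`). -/
theorem downLine_threeCharged {h : ℤ} {C : MConfig} (hU : C.InDiamond h) (hDN : ∀ Z ∈ C.lower, RuleDMu4N C Z)
    (hDP : ∀ P ∈ C.upper, RuleDMu4P C P) (hX : XPlusClosed C) (hLVN : ∀ X ∈ C.lower, 2 ≤ chargeCount X → LevelCell X)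
    (hLV3 : ∀ P ∈ C.upper, 3 ≤ chargeCount P → LevelCell P)
    (hCDN : ∀ Z ∈ C.lower, LevelCell Z → ∀ f, (Z f).2 ≠ (0, 0) → 2 * (chargeCount Z : ℤ) ≤ nodeLevel (Z f))
    (hΔl : DeltaClosed C.lower) (hΔu : DeltaClosed C.upper) {T : MCell} (hT : T ∈ C.lower) (hTc : ∀ j, OnCeiling h (T j))
    {σ₀ σ₁ σ₂ f : Fin 4} (h01 : σ₀ ≠ σ₁) (h02 : σ₀ ≠ σ₂) (h12 : σ₁ ≠ σ₂) (hf0 : f ≠ σ₀) (hf1 : f ≠ σ₁) (hf2 : f ≠ σ₂)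
    (hfa : isApex (T f)) (hna₀ : ¬ isApex (T σ₀)) (hna₁ : ¬ isApex (T σ₁)) (hna₂ : ¬ isApex (T σ₂)) (h7 : nodeLevel (T σ₁) ≤ 7)
    {k : Fin 4} (hk : Adapted (T σ₀) k) (hkh : coord (T σ₀) k ≠ h) : MServedBelow C T σ₀ k := by
  by_contra hDL
  obtain ⟨N₁, hN₁, P₀, hP₀, hag2, hg, hap₁, hA, h0⟩ :=
    apexDrop_node hU hDN hDP hLVN hLV3 hT hTc h01 h02 h12 hna₀ hna₁ hna₂ hk hkh hDL
  have hlow : (N₁ σ₁).1 < h := by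
    have h1 := nodeLevel_le_of_charged (hU.1 T hT σ₁).1 (snd_ne_of_not_isApex hna₁)
    have hc : causalTop (T σ₁) = h := (onCeiling_iff h _).1 (hTc σ₁)
    omega
  have hN2 : N₁ σ₂ = T σ₂ := hag2 σ₂ h02.symm h12.symm
  have hNf : N₁ f = (h, 0, 0) := by rw [hag2 f hf0 hf1]; exact eq_ceilingApex hfa (hTc f)
  have hc₂ : OnCeiling h (N₁ σ₂) := by rw [hN2]; exact hTc σ₂
  have hna₂' : ¬ isApex (N₁ σ₂) := by rw [hN2]; exact hna₂
  obtain ⟨r₁, -, P₁, hP₁, h1⟩ :=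
    interiorApex_settled hU hDN hX hLVN hLV3 hN₁ h01 h02 h12 hf0 hg hNf hap₁ hlow hc₂ hna₂' hP₀ h0 0
  obtain ⟨r₂, hr₂, P₂, hP₂, h2⟩ :=
    interiorApex_settled hU hDN hX hLVN hLV3 hN₁ h01 h02 h12 hf0 hg hNf hap₁ hlow hc₂ hna₂' hP₀ h0 (r₁ + 2)
  rw [fin4_add_two_add_two] at hr₂
  have hd₁ := child_depth hU hDP hLVN hCDN h12 hap₁ hlow hc₂ hna₂' hP₁ h1
  have hd₂ := child_depth hU hDP hLVN hCDN h12 hap₁ hlow hc₂ hna₂' hP₂ h2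
  have hl₁ := h1.2.1
  have hl₂ := h2.2.1
  exact interiorApex_two_children hU hDP hX hLVN hΔl hΔu h01 h02 h12 hf0 hf1 hf2 hg hNf hap₁ hlow hc₂ hna₂' hP₁ hP₂ hr₂ h1 h2
    (by omega)

/-- **(DL3₈) IS A THEOREM OF (CD₈), (LVN₈), (LVP3₈)** (KERNEL): at height 8 every charged ceiling letter has node level `≤ 6`. -/
theorem dl3_eight_of_partial_cd (hCD : ChargeDepthLaw 8) (hN : LevelNLaw 8) (hP : LevelP3Law 8) : DownLineLaw3 8 := by
  intro C hU hG hS T hT hTc f hfa hnf j hjf k hk hkh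
  obtain ⟨σ₁, h1j, h1f, -⟩ := exists_fourth j f f
  obtain ⟨σ₂, h2j, h2f, h21⟩ := exists_fourth j f σ₁
  have h7 : nodeLevel (T σ₁) ≤ 7 := by
    have h1 := nodeLevel_le_of_charged (hU.1 T hT σ₁).1 (snd_ne_of_not_isApex (hnf σ₁ h1f))
    have hc : causalTop (T σ₁) = 8 := (onCeiling_iff 8 _).1 (hTc σ₁)
    omega
  exact downLine_threeCharged hU hS.1.1 hS.1.2 hS.2.1 (fun X hX h2 => hN C hU hG hS X hX h2)
    (fun P hP' h3 => hP C hU hG hS P hP' h3) (hCD C hU hG hS).2 hG.2.2.1 hG.2.2.2 hT hTc h1j.symm h2j.symm h21.symm hjf.symm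
    h1f.symm h2f.symm hfa (hnf j hjf) (hnf σ₁ h1f) (hnf σ₂ h2f) h7 hk hkh

/-- **THE DOWN-LINE LAW AT HEIGHT 8 IS A THEOREM OF (CD₈), (LVN₈), (LVP3₈)** (KERNEL; §19 for the heads with two apexes, §14 for the fully charged heads,
§21 for the 3-charged layer). -/
theorem downLineLaw_eight_of_partial_cd (hCD : ChargeDepthLaw 8) (hN : LevelNLaw 8) (hP : LevelP3Law 8) : DownLineLaw 8 :=
  downLineLaw_of_dl3_partial hN hP (dl3_eight_of_partial_cd hCD hN hP)

/-- **(T₈) ⟸ (CD₈) ∧ (LVN₈) ∧ (LVP3₈) ∧ (OL₈)** (KERNEL): the UP-facts (CD₈), (LVN₈), (LVP3₈) are CONJECTURES (displayed, NOT proved here; CHARGEDEPTH-d8-d12,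
machine ≠ kernel), (OL₈) the line theorem (displayed).  HC ∕ HC_CM ∕ HC_AV ∕ H2 ∕ (T₈) NOT proved. -/
theorem seedB1Odd_eight_of_partial_cd (hCD : ChargeDepthLaw 8) (hN : LevelNLaw 8) (hP : LevelP3Law 8) (hOL : OddLineFree 8) :
    SeedB1OddDiamondG1H1 8 :=
  seedB1Odd_eight_of_dl3_partial hCD hN hP (dl3_eight_of_partial_cd hCD hN hP) hOL

/-! ## §22 THE `X⁺` FORK AT A CHARGED CEILING LETTER and -/

/-- going DOWN THE LINE from an apex ray: `(aI + c·n_m) − d·n_{m+2} = (a − 2d)I + (c + d)·n_m`. -/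
theorem ray_line_down (a c d : ℤ) (m : Fin 4) :
    ray (ray ((a, 0, 0) : BPoint) m c) (m + 2) (-d) = ray ((a - 2 * d, 0, 0) : BPoint) m (c + d) := by
  fin_cases m <;> simp [ray] <;> omega

/-- an apex ray read from its TOP apex: `aI + t·n_m = (a + 2t)I − t·n_{m+2}`. -/
theorem ray_apex_flip (a t : ℤ) (m : Fin 4) :
    ray ((a, 0, 0) : BPoint) m t = ray ((a + 2 * t, 0, 0) : BPoint) (m + 2) (-t) := by
  fin_cases m <;> simp [ray] <;> omega

/-- **TWO CEILING LETTERS IN CAUSAL ORDER LIE ON ONE CEILING LINE** (KERNEL): a ceiling letter `x` causally above `w = hI − d₁·n_ℓ` (`d₁ > 0`) is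
`hI − d₂·n_ℓ` with `0 ≤ d₂ ≤ d₁` (on a null cone two causally related points share a generator). -/
theorem ceiling_effective_sameRay {h d₁ : ℤ} {w x : BPoint} {ℓ : Fin 4} (hd₁ : 0 < d₁)
    (hw : w = ray ((h, 0, 0) : BPoint) ℓ (-d₁)) (hx : OnCeiling h x) (hxax : x.2 = (0, 0) ∨ AxisPt x)
    (hE : Effective (bsub x w)) : ∃ d₂, 0 ≤ d₂ ∧ d₂ ≤ d₁ ∧ x = ray ((h, 0, 0) : BPoint) ℓ (-d₂) := by
  by_cases hap : isApex x
  · refine ⟨0, le_rfl, hd₁.le, ?_⟩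
    rw [eq_ceilingApex hap hx, neg_zero, ray_zero]
  · obtain ⟨b, hlt, hxI⟩ := exists_apex_ray hx hxax hap
    obtain ⟨d₂, hd₂, hxd⟩ : ∃ d₂, 0 < d₂ ∧ x = ray ((h, 0, 0) : BPoint) b (-d₂) := ⟨h - x.1, by omega, eq_ray_neg hxI⟩
    subst hxd
    subst hw
    by_cases hb : b = ℓ
    · subst hb
      have h1 : 0 ≤ (h + -d₂) - (h + -d₁) := hE.1
      exact ⟨d₂, hd₂.le, by omega, rfl⟩
    · exfalso
      have hp := mul_pos hd₁ hd₂
      fin_cases ℓ <;> fin_cases b <;> simp [Effective] at hE hb <;> nlinarith [hp]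

/-- **THE FORK GEOMETRY** (KERNEL): for `z = hI − c·n_ℓ`, its node-ward partner `y = z − s·n_{ℓ+2}` (`s > 0`) and a ceiling letter `x = hI − d₂·n_ℓ`,
`y − x` not timelike forces `d₂ ≥ c`, whence `x` lies causally below `z`. -/
theorem fork_effective {h c s d₂ : ℤ} {ℓ : Fin 4} {z y x : BPoint} (hs : 0 < s) (hz : z = ray ((h, 0, 0) : BPoint) ℓ (-c))
    (hy : y = ray z (ℓ + 2) (-s)) (hx : x = ray ((h, 0, 0) : BPoint) ℓ (-d₂)) (hnT : ¬ Timelike (bsub y x)) :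
    Effective (bsub z x) := by
  subst hy
  subst hz
  subst hx
  fin_cases ℓ <;> simp [Effective, Timelike] at hnT ⊢ <;>
    first
      | (constructor <;> nlinarith [hs])
      | nlinarith [hs]

/-- **THE `X⁺` FORK** (KERNEL, every `h`; the `X⁺` sibling clause of `Pad4TowerXresFamilies` read at a CHARGED letter): an `N`-cell `Z ∈ C` with a ceiling apex
at `f` whose `g`-letter `z` has two `P`-partners below it in different directions — `P₁ = Z(g ↦ y)`, `y` charged, in direction `r₁`, with `Z` the LOWEST `r₁`-server of
`P₁`; `P₂` in direction `r₂` with no `N`-twin of `Z` strictly between — fires the clause `(P₁^∨; g, r₁; Z^∨; r₂, P₂^∨; f)` of the dual family unless an (H-e′) breaker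
is present; `hHe` says none is.  `xplus_two_children_gen` is the case `z = hI`. -/
theorem xplus_fork {h : ℤ} {C : MConfig} (hU : C.InDiamond h) (hX : XPlusClosed C) {Z : MCell} (hZ : Z ∈ C.lower)
    {g f : Fin 4} (hfg : f ≠ g) (hf : Z f = (h, 0, 0)) {P₁ P₂ : MCell} (hP₁ : P₁ ∈ C.upper) (hP₂ : P₂ ∈ C.upper)
    {r₁ r₂ : Fin 4} (hr : r₂ ≠ r₁) (h1 : UPartner Z P₁ g r₁) (h2 : UPartner Z P₂ g r₂) (hna : ¬ isApex (P₁ g))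
    (htop : ∀ X ∈ C.lower, UPartner X P₁ g r₁ → (Z g).1 ≤ (X g).1)
    (hNC : ∀ X ∈ C.lower, MAgree X Z g → (X g).1 < (Z g).1 → (P₂ g).1 < (X g).1 → Z g ≠ ray (X g) r₂ ((Z g).1 - (X g).1))
    (hHe : ∀ X ∈ C.lower, MAgree X P₁ g → X g ≠ P₁ g → Effective (bsub (X g) (P₂ g)) → ¬ Timelike (bsub (P₁ g) (X g)) →
      Effective (bsub (Z g) (X g))) : False := by
  have e1 : (P₁ f).1 = h := by rw [(h1.1 f hfg).trans hf]
  refine hX (dualCell 0 P₁) (dualCell_mem_dual_lower hP₁) (dualCell 0 Z) (dualCell_mem_dual_upper hZ) (dualCell 0 P₂)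
    (dualCell_mem_dual_lower hP₂) g r₁ r₂ f ⟨?_, hfg, (uPartner_dual 0 Z P₁ g r₁).mpr h1, ?_, hr, ?_, ?_, ?_, ?_, ?_⟩
  · exact fun hap => hna ((isApex_dual 0 (P₁ g)).mp hap)
  · -- `Z` is the lowest `r₁`-server of `P₁`
    intro P hP hPu
    obtain ⟨X, hXl, rfl⟩ := Finset.mem_image.mp hP
    have hle := htop X hXl ((uPartner_dual 0 X P₁ g r₁).mp hPu)
    show 0 - (X g).1 ≤ 0 - (Z g).1
    omega
  · exact ⟨magree_dual.mpr (fun j hj => (h2.1 j hj).symm), (ray_dual_iff 0 (Z g) (P₂ g) r₂).mpr ⟨h2.2.1, h2.2.2⟩⟩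
  · -- no `N`-twin of `Z` strictly between `Z g` and `P₂ g` on the `r₂`-ray
    intro P hP hag hlt1 hlt2 hray
    obtain ⟨X, hXl, rfl⟩ := Finset.mem_image.mp hP
    have hag' : MAgree Z X g := magree_dual.mp hag
    obtain ⟨hlt, hZX⟩ := (ray_dual_iff 0 (Z g) (X g) r₂).mp ⟨hlt1, hray⟩
    have hlt2' : (P₂ g).1 < (X g).1 := by change 0 - (X g).1 < 0 - (P₂ g).1 at hlt2; omega
    exact hNC X hXl (fun j hj => (hag' j hj).symm) hlt hlt2' hZX
  · -- (H-e′)⁺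
    intro P hP hag hne hE hnT
    obtain ⟨X, hXl, rfl⟩ := Finset.mem_image.mp hP
    show Effective (bsub (dualPt 0 (X g)) (dualPt 0 (Z g)))
    rw [bsub_dualPt0]
    have hag' : MAgree X P₁ g := fun j hj => ((magree_dual.mp hag) j hj).symm
    have hne' : X g ≠ P₁ g := fun e => hne (by show dualPt 0 (X g) = dualPt 0 (P₁ g); rw [e])
    have hE' : Effective (bsub (X g) (P₂ g)) := by
      change Effective (bsub (dualPt 0 (P₂ g)) (dualPt 0 (X g))) at hE; rwa [bsub_dualPt0] at hE
    have hnT' : ¬ Timelike (bsub (P₁ g) (X g)) := by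
      change ¬ Timelike (bsub (dualPt 0 (X g)) (dualPt 0 (P₁ g))) at hnT; rwa [bsub_dualPt0] at hnT
    exact hHe X hXl hag' hne' hE' hnT'
  · -- `HbOkP⁺`: vacuous (`f` is a ceiling apex of `P₁`)
    intro P hP _ hnb _
    obtain ⟨X, hXl, rfl⟩ := Finset.mem_image.mp hP
    exfalso
    have := hnb.1
    change 0 - (X f).1 < 0 - (P₁ f).1 at this
    have hle := fst_le_of_inDiamond (hU.1 X hXl f)
    omega
  · -- `WfEmpty⁺`: vacuous
    intro P hP hnb
    obtain ⟨X, hXl, rfl⟩ := Finset.mem_image.mp hP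
    exfalso
    have := hnb.1
    change 0 - (X f).1 < 0 - (P₁ f).1 at this
    have hle := fst_le_of_inDiamond (hU.1 X hXl f)
    omega

/-- **A CHILD OF THE INTERIOR APEX NEVER REACHES NODE LEVEL 4** (KERNEL, every `h`): if the (UL)-server `N = [hI | z | x_w | hI]` of a `P`-child `P = N₁(σ₁ ↦ y)`,
`aI = y + e·n_r`, had `z` of node level `a − 2e = 4`, then (DL) at `z` (`downLine_twoApex_of_cd`, node coordinate `4`) and (CD-`P`) put the ADJACENT line child
`W = N(σ₁ ↦ z − n_line)` in `C`, and the `X⁺` fork at `z` (`xplus_fork`: partners `P` node-ward, `W` on the line; lowest server by (LVN); (H-e′) by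
`ceiling_effective_sameRay` + `fork_effective`) is violated.  ◇₁₀: the depth-2 child `P[10I | 4I+2ℓ_u | 8I+ℓ_v | 10I]` of `N[10I | 8I | 8I+ℓ_v | 10I]` dies
(peel j318002 h10 round 24; census clause `Xp` at it with NO positive literal). -/
theorem child_not_node_four {h : ℤ} {C : MConfig} (hU : C.InDiamond h) (hDN : ∀ Z ∈ C.lower, RuleDMu4N C Z)
    (hDP : ∀ P ∈ C.upper, RuleDMu4P C P) (hX : XPlusClosed C) (hCD : CDIneq C)
    (hLVN : ∀ X ∈ C.lower, 2 ≤ chargeCount X → LevelCell X)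
    {N₁ : MCell} {σ₀ σ₁ σ₂ f : Fin 4} (h01 : σ₀ ≠ σ₁) (h02 : σ₀ ≠ σ₂) (h12 : σ₁ ≠ σ₂) (hf0 : f ≠ σ₀) (hf1 : f ≠ σ₁) (hf2 : f ≠ σ₂)
    (hg : N₁ σ₀ = (h, 0, 0)) (hf : N₁ f = (h, 0, 0)) (hap₁ : isApex (N₁ σ₁)) (hlow : (N₁ σ₁).1 < h)
    (hc₂ : OnCeiling h (N₁ σ₂)) (hna₂ : ¬ isApex (N₁ σ₂)) {P : MCell} (hP : P ∈ C.upper) {r : Fin 4} (hNP : UPartner N₁ P σ₁ r) :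
    (N₁ σ₁).1 - 2 * ((N₁ σ₁).1 - (P σ₁).1) ≠ 4 := by
  intro h4
  have hP2 : P σ₂ = N₁ σ₂ := hNP.1 σ₂ h12.symm
  have hP0 : P σ₀ = (h, 0, 0) := (hNP.1 σ₀ h01).trans hg
  have hPf : P f = (h, 0, 0) := (hNP.1 f hf1).trans hf
  obtain ⟨e, he0, hed, hapex⟩ : ∃ e, 0 < e ∧ e = (N₁ σ₁).1 - (P σ₁).1 ∧ (((N₁ σ₁).1, 0, 0) : BPoint) = ray (P σ₁) r e :=
    ⟨_, by have := hNP.2.1; omega, rfl, by rw [← eq_of_isApex hap₁]; exact hNP.2.2⟩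
  have hy : P σ₁ = ray (((N₁ σ₁).1, 0, 0) : BPoint) r (-e) := eq_ray_neg hapex
  have hyna : ¬ isApex (P σ₁) := not_isApex_below_apex he0 hapex
  have hxw : (P σ₂).2 ≠ (0, 0) := by rw [hP2]; exact snd_ne_of_not_isApex hna₂
  have hy1 : (P σ₁).1 = 4 + e := by rw [hy]; show (N₁ σ₁).1 + -e = 4 + e; omega
  -- (UL) at `σ₁` in the turning direction `r + 2`
  have hk : Adapted (P σ₁) (r + 2) := by rw [hy]; exact (adapted_ray_apex _ r _).2
  have hkh : coord (P σ₁) (r + 2) ≠ h := by rw [hy, coord_ray_apex_antip]; omega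
  obtain ⟨N, hN, hNP'⟩ := upLine_of_ruleDMu4P hU hP (hDP P hP) h12.symm (by rw [hP2]; exact hc₂) hyna hk hkh
  -- every `(r+2)`-server `X` of `P` at `σ₁`: `X σ₁ = 4I + (e + s)·n_{r+2}`, level by (LVN), so `h = 4 + 2(e + s)`
  have server : ∀ X ∈ C.lower, UPartner X P σ₁ (r + 2) →
      ∃ s, 0 < s ∧ X σ₁ = ray ((4, 0, 0) : BPoint) (r + 2) (e + s) ∧ h = 4 + 2 * (e + s) := by
    intro X hX hXP
    obtain ⟨s, hs0, hXs⟩ : ∃ s, 0 < s ∧ X σ₁ = ray (P σ₁) (r + 2) s := ⟨_, by have := hXP.2.1; omega, hXP.2.2⟩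
    have hXσ : X σ₁ = ray (((N₁ σ₁).1 - 2 * e, 0, 0) : BPoint) (r + 2) (e + s) := by rw [hXs, hy, ray_turn]
    rw [show (N₁ σ₁).1 - 2 * e = 4 by omega] at hXσ
    have hch : (X σ₁).2 ≠ (0, 0) := by rw [hXσ]; exact snd_ne_ray_apex _ _ (by omega)
    have h2 : 2 ≤ chargeCount X := two_le_chargeCount h12 hch (by rw [← hXP.1 σ₂ h12.symm]; exact hxw)
    have hlev := hLVN X hX h2 σ₁ σ₀
    rw [← hXP.1 σ₀ h01, hP0] at hlev
    have htopI : causalTop ((h, 0, 0) : BPoint) = h := (onCeiling_iff h _).1 (onCeiling_apex h)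
    have htop := top_ray_apex 4 (r + 2) (d := e + s) (by omega)
    rw [← hXσ] at htop
    refine ⟨s, hs0, hXσ, ?_⟩
    unfold causalTop at hlev htopI
    omega
  obtain ⟨s, hs0, hNσ, hh⟩ := server N hN hNP'
  -- the letters of `N = [hI | z | x_w | hI]`
  have hN0 : N σ₀ = (h, 0, 0) := (hNP'.1 σ₀ h01).symm.trans hP0
  have hNf : N f = (h, 0, 0) := (hNP'.1 f hf1).symm.trans hPf
  have hN2 : N σ₂ = P σ₂ := (hNP'.1 σ₂ h12.symm).symm
  have hN1 : (N σ₁).1 = 4 + (e + s) := congrArg Prod.fst hNσ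
  have hzc : OnCeiling h (N σ₁) := by
    have htop := top_ray_apex 4 (r + 2) (d := e + s) (by omega)
    rw [← hNσ] at htop
    show (N σ₁).1 + absCharge (N σ₁) = h
    omega
  have hzch : (N σ₁).2 ≠ (0, 0) := by rw [hNσ]; exact snd_ne_ray_apex _ _ (by omega)
  have hNc : ∀ j, OnCeiling h (N j) := by
    intro j
    by_cases hj : j = σ₁
    · rw [hj]; exact hzc
    · rcases fin4_other h02.symm hf2.symm h12.symm hf0.symm h01 hf1 hj with rfl | rfl | rfl
      · rw [hN2, hP2]; exact hc₂
      · rw [hN0]; exact onCeiling_apex h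
      · rw [hNf]; exact onCeiling_apex h
  -- (DL) at `z` in the line direction `r + 2 + 2` (node coordinate `4`): the nearest line partner `W`
  have hkz : Adapted (N σ₁) (r + 2 + 2) := by rw [hNσ]; exact (adapted_ray_apex _ _ _).2
  have hcz : coord (N σ₁) (r + 2 + 2) = 4 := by rw [hNσ]; exact coord_ray_apex_antip _ _ _
  obtain ⟨W, hW, hNW⟩ := (downLine_twoApex_of_cd hU hDN hDP hX hCD hN hNc h01 hf0 hN0 hNf (not_isApex_of_snd_ne hzch) hkz
    (by rw [hcz]; omega) (by rw [hcz])).1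
  obtain ⟨d, hdd⟩ : ∃ d, d = (N σ₁).1 - (W σ₁).1 := ⟨_, rfl⟩
  have hd0 : 0 < d := by have := hNW.2.1; omega
  have hWray : W σ₁ = ray (N σ₁) (r + 2 + 2) (-d) := by rw [hdd]; exact eq_ray_neg hNW.2.2
  have hWσ : W σ₁ = ray ((4 - 2 * d, 0, 0) : BPoint) (r + 2) (e + s + d) := by rw [hWray, hNσ, ray_line_down]
  -- `W` is a level `P`-cell with two charged letters and node level `4 − 2d` at `σ₁`: (CD-`P`) forces `d = 1`
  have hW2 : W σ₂ = P σ₂ := (hNW.1 σ₂ h12.symm).trans hN2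
  have hWch : (W σ₁).2 ≠ (0, 0) := by rw [hWσ]; exact snd_ne_ray_apex _ _ (by omega)
  have hWc : ∀ j, OnCeiling h (W j) := by
    intro j
    by_cases hj : j = σ₁
    · rw [hj]
      have htop := top_ray_apex (4 - 2 * d) (r + 2) (d := e + s + d) (by omega)
      rw [← hWσ] at htop
      show (W σ₁).1 + absCharge (W σ₁) = h
      omega
    · rw [hNW.1 j hj]; exact hNc j
  have hcdW := hCD.1 W hW (levelCell_of_onCeiling hWc) σ₁ hWch
  have h2W : 2 ≤ chargeCount W := two_le_chargeCount h12 hWch (by rw [hW2]; exact hxw)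
  have h2W' : (2 : ℤ) ≤ chargeCount W := by exact_mod_cast h2W
  rw [hWσ, nodeLevel_ray_apex _ _ (by omega)] at hcdW
  have hd1 : d = 1 := by omega
  -- the fork at `z`: partners `P` (node-ward, direction `r + 2`) and `W` (on the line, direction `r + 2 + 2`)
  refine xplus_fork hU hX hN h01 hN0 hP hW (r₁ := r + 2) (r₂ := r + 2 + 2) (fun e => ?_) hNP' hNW hyna
    (fun X hX hXP => ?_) (fun X _ _ hlt hlt2 _ => by omega) (fun X hX _ _ hE hnT => ?_)
  · have e' := congrArg (fun t : Fin 4 => t + 2) e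
    simp only [fin4_add_two_add_two] at e'
    revert e'; fin_cases r <;> decide
  · obtain ⟨s', -, hXσ, hh'⟩ := server X hX hXP
    have hX1 : (X σ₁).1 = 4 + (e + s') := congrArg Prod.fst hXσ
    omega
  · -- (H-e′): `x = X σ₁ ∈ ◇_h` causally above the ceiling letter `W σ₁` is `hI − d₂·n_ℓ`, and `y − x` not timelike forces `d₂ ≥ c`
    have hWI : W σ₁ = ray ((h, 0, 0) : BPoint) (r + 2 + 2) (-(e + s + d)) := by
      rw [hWσ, ray_apex_flip, show (4 : ℤ) - 2 * d + 2 * (e + s + d) = h by omega]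
    have hxc : OnCeiling h (X σ₁) := onCeiling_of_effective_above (hWc σ₁) (hU.2 W hW σ₁).1 (hU.1 X hX σ₁) hE
    obtain ⟨d₂, -, -, hxd⟩ := ceiling_effective_sameRay (by omega) hWI hxc (hU.1 X hX σ₁).1 hE
    have hzI : N σ₁ = ray ((h, 0, 0) : BPoint) (r + 2 + 2) (-(e + s)) := by
      rw [hNσ, ray_apex_flip, show (4 : ℤ) + 2 * (e + s) = h by omega]
    have hyz : P σ₁ = ray (N σ₁) (r + 2 + 2 + 2) (-s) := by
      rw [fin4_add_two_add_two, show s = (N σ₁).1 - (P σ₁).1 by omega]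
      exact eq_ray_neg hNP'.2.2
    exact fork_effective hs0 hzI hyz hxd hnT

/-- **(DL) AT THE 3-CHARGED HEADS WHOSE COMPANION HAS NODE LEVEL ≤ 9** (KERNEL, every `h`; extends `downLine_threeCharged` (companion node level `≤ 7`) by
`child_not_node_four`): with RULE D, `X⁺`, `CDIneq C`, the (LVN), (LVP3) instances and `Δ`-closed levels, every child of the interior apex `aI` (`a ≤ 9`) has depth `1`
(`4 + 2e ≤ a`, `a − 2e ≠ 4`, `a` even), and two depth-1 children in different directions are contradictory.  Covers ALL 3-charged heads of ◇₈ and ◇₁₀. -/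
theorem downLine_threeCharged_nine {h : ℤ} {C : MConfig} (hU : C.InDiamond h) (hDN : ∀ Z ∈ C.lower, RuleDMu4N C Z)
    (hDP : ∀ P ∈ C.upper, RuleDMu4P C P) (hX : XPlusClosed C) (hCD : CDIneq C) (hLVN : ∀ X ∈ C.lower, 2 ≤ chargeCount X → LevelCell X)
    (hLV3 : ∀ P ∈ C.upper, 3 ≤ chargeCount P → LevelCell P) (hΔl : DeltaClosed C.lower) (hΔu : DeltaClosed C.upper)
    {T : MCell} (hT : T ∈ C.lower) (hTc : ∀ j, OnCeiling h (T j))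
    {σ₀ σ₁ σ₂ f : Fin 4} (h01 : σ₀ ≠ σ₁) (h02 : σ₀ ≠ σ₂) (h12 : σ₁ ≠ σ₂) (hf0 : f ≠ σ₀) (hf1 : f ≠ σ₁) (hf2 : f ≠ σ₂)
    (hfa : isApex (T f)) (hna₀ : ¬ isApex (T σ₀)) (hna₁ : ¬ isApex (T σ₁)) (hna₂ : ¬ isApex (T σ₂)) (h9 : nodeLevel (T σ₁) ≤ 9)
    {k : Fin 4} (hk : Adapted (T σ₀) k) (hkh : coord (T σ₀) k ≠ h) : MServedBelow C T σ₀ k := by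
  by_contra hDL
  obtain ⟨N₁, hN₁, P₀, hP₀, hag2, hg, hap₁, hA, h0⟩ :=
    apexDrop_node hU hDN hDP hLVN hLV3 hT hTc h01 h02 h12 hna₀ hna₁ hna₂ hk hkh hDL
  have hlow : (N₁ σ₁).1 < h := by
    have h1 := nodeLevel_le_of_charged (hU.1 T hT σ₁).1 (snd_ne_of_not_isApex hna₁)
    have hc : causalTop (T σ₁) = h := (onCeiling_iff h _).1 (hTc σ₁)
    omega
  have hN2 : N₁ σ₂ = T σ₂ := hag2 σ₂ h02.symm h12.symm
  have hNf : N₁ f = (h, 0, 0) := by rw [hag2 f hf0 hf1]; exact eq_ceilingApex hfa (hTc f)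
  have hc₂ : OnCeiling h (N₁ σ₂) := by rw [hN2]; exact hTc σ₂
  have hna₂' : ¬ isApex (N₁ σ₂) := by rw [hN2]; exact hna₂
  -- the interior apex has even node level
  have hpar : (N₁ σ₁).1 % 2 = 0 := by
    have h3 := (hU.1 N₁ hN₁ σ₁).2.2.1
    have h0 : absCharge (N₁ σ₁) = 0 := by
      have e := eq_of_isApex hap₁; rw [e]; simp [absCharge, chargeOf]
    omega
  obtain ⟨r₁, -, P₁, hP₁, h1⟩ :=
    interiorApex_settled hU hDN hX hLVN hLV3 hN₁ h01 h02 h12 hf0 hg hNf hap₁ hlow hc₂ hna₂' hP₀ h0 0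
  obtain ⟨r₂, hr₂, P₂, hP₂, h2⟩ :=
    interiorApex_settled hU hDN hX hLVN hLV3 hN₁ h01 h02 h12 hf0 hg hNf hap₁ hlow hc₂ hna₂' hP₀ h0 (r₁ + 2)
  rw [fin4_add_two_add_two] at hr₂
  have hd₁ := child_depth hU hDP hLVN hCD.2 h12 hap₁ hlow hc₂ hna₂' hP₁ h1
  have hd₂ := child_depth hU hDP hLVN hCD.2 h12 hap₁ hlow hc₂ hna₂' hP₂ h2
  have hn₁ := child_not_node_four hU hDN hDP hX hCD hLVN h01 h02 h12 hf0 hf1 hf2 hg hNf hap₁ hlow hc₂ hna₂' hP₁ h1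
  have hn₂ := child_not_node_four hU hDN hDP hX hCD hLVN h01 h02 h12 hf0 hf1 hf2 hg hNf hap₁ hlow hc₂ hna₂' hP₂ h2
  have hl₁ := h1.2.1
  have hl₂ := h2.2.1
  exact interiorApex_two_children hU hDP hX hLVN hΔl hΔu h01 h02 h12 hf0 hf1 hf2 hg hNf hap₁ hlow hc₂ hna₂' hP₁ hP₂ hr₂ h1 h2
    (by omega)

/-- **(DL3_h) IS A THEOREM OF (CD_h), (LVN_h), (LVP3_h) FOR `h ≤ 10`** (KERNEL): every charged ceiling letter of ◇_h has node level `≤ h − 2 ≤ 8`.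
`h ≤ 10` is SHARP: at `h = 12` the implication is machine-FALSE (band-4 census j329409, `ALPHA-D12-BAND4-g11.md`). -/
theorem dl3_of_partial_cd_le_ten {h : ℤ} (hh : h ≤ 10) (hCD : ChargeDepthLaw h) (hN : LevelNLaw h) (hP : LevelP3Law h) :
    DownLineLaw3 h := by
  intro C hU hG hS T hT hTc f hfa hnf j hjf k hk hkh
  obtain ⟨σ₁, h1j, h1f, -⟩ := exists_fourth j f f
  obtain ⟨σ₂, h2j, h2f, h21⟩ := exists_fourth j f σ₁
  have h9 : nodeLevel (T σ₁) ≤ 9 := by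
    have h1 := nodeLevel_le_of_charged (hU.1 T hT σ₁).1 (snd_ne_of_not_isApex (hnf σ₁ h1f))
    have hc : causalTop (T σ₁) = h := (onCeiling_iff h _).1 (hTc σ₁)
    omega
  exact downLine_threeCharged_nine hU hS.1.1 hS.1.2 hS.2.1 (hCD C hU hG hS) (fun X hX h2 => hN C hU hG hS X hX h2)
    (fun P hP' h3 => hP C hU hG hS P hP' h3) hG.2.2.1 hG.2.2.2 hT hTc h1j.symm h2j.symm h21.symm hjf.symm
    h1f.symm h2f.symm hfa (hnf j hjf) (hnf σ₁ h1f) (hnf σ₂ h2f) h9 hk hkh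

/-- **(DL3₁₀) ⟸ (CD₁₀) ∧ (LVN₁₀) ∧ (LVP3₁₀)** (KERNEL): the ◇₁₀ residue of v1.9 (the charge-1 companions, i.e. the mixed-depth children of `8I`) is closed by
`child_not_node_four`.  (CD₁₀), (LVN₁₀), (LVP3₁₀) are displayed UP-facts, NOT proved here (CHARGEDEPTH-d8-d12; machine ≠ kernel). -/
theorem dl3_ten_of_partial_cd (hCD : ChargeDepthLaw 10) (hN : LevelNLaw 10) (hP : LevelP3Law 10) : DownLineLaw3 10 :=
  dl3_of_partial_cd_le_ten le_rfl hCD hN hP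

/-- **THE DOWN-LINE LAW AT HEIGHT `h ≤ 10` IS A THEOREM OF (CD_h), (LVN_h), (LVP3_h)** (KERNEL; `downLineLaw_of_dl3_partial`). -/
theorem downLineLaw_of_partial_cd_le_ten {h : ℤ} (hh : h ≤ 10) (hCD : ChargeDepthLaw h) (hN : LevelNLaw h) (hP : LevelP3Law h) :
    DownLineLaw h :=
  downLineLaw_of_dl3_partial hN hP (dl3_of_partial_cd_le_ten hh hCD hN hP)

/-- **(DL₁₀) ⟸ (CD₁₀) ∧ (LVN₁₀) ∧ (LVP3₁₀)** (KERNEL).  HC ∕ HC_CM ∕ HC_AV ∕ H2 ∕ (T₈) ∕ (T₁₀) ∕ (CD) ∕ (LVN) ∕ (LVP3) NOT proved. -/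
theorem downLineLaw_ten_of_partial_cd (hCD : ChargeDepthLaw 10) (hN : LevelNLaw 10) (hP : LevelP3Law 10) : DownLineLaw 10 :=
  downLineLaw_of_partial_cd_le_ten le_rfl hCD hN hP

end Summit.HodgeConjecture.HodgeConjecture.Cruxes.BlochSeedDiscOne.DiamondLevelLaws
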